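import Literature.NumberTheory.Irrationality.Zudilin2002.WellPoisedIntegrals
import Literature.Analysis.SpecialFunctions.LemniscaticEllipticValuesProofs
import Literature.NumberTheory.Irrationality.BrownZudilin2022.BarnesDoubleProofs
import Literature.Analysis.Complex.MellinBarnesShift
import Literature.Analysis.SpecialFunctions.GammaStirlingVertical
import Literature.Analysis.SpecialFunctions.HypergeometricEulerIntegral
import Literature.Analysis.Complex.ConeTubeIdentity
import HarnessLib

/-!
# Zudilin 2004 §4 (Bailey's transformation for `ζ(3)`), 2/4 — Sorokin integrands, Barnes–Mellin integrals with complex powers, the Barnes–Euler integral and its continuation (re-homed proofs)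

**Zudilin 2004, §4 (Bailey's transformation and the Rhin–Viola group for `ζ(3)`) — the named facts `Literature.NumberTheory.Irrationality.Zudilin2004.baileyTransform`
(the quantity (4.4) `F̃₅(B)/Π(B)` is unchanged by the generator `𝔞₁₂` of the group `𝔊`, for admissible integer parameters) and `…baileyTransformClosed`
(the same on the closed parameter box), `GroupStructureZeta3.lean` / `GroupStructureZeta3Closed.lean`, HOLD — EXACT names `…_holds`** ([Zudilin2004] W. Zudilin,
*Arithmetic of linear forms involving odd zeta values*, J. Théor. Nombres Bordeaux **16** (2004), §4, Lemma 7, Prop. 2 with (4.4)–(4.6); the analytic inputs are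
Bailey's 1935 tract [Bailey1935] (Dougall's ₇F₆ summation, Whipple's transformation), the Barnes–Mellin representation of very-well-poised series
[Zudilin2002CatalanRemarks], [Zudilin2002Zeta5], and Sorokin-type multiple integrals as treated in [Lai2024BallRivoal]).  Contents: (1, definitions
file) the rising factorial `rf`, the factorial weight `facQ` / `lamOf` of the level descent, the elementary symmetric functions `eS1 … eS5` of six
parameters; (2) Sorokin integrands and their bounds / convergence, Barnes–Mellin integrals with complex powers, the Barnes–Euler integral, its
continuation and cut-off, kernel bounds, Sorokin's first / last variable and Lemma 3; (3) uniform Gamma-ratio bounds, the very-well-poised Barnes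
kernel and inner integral, the step of the induction, the Sorokin parameter line and holomorphy, the analytic side conditions of Dougall's theorem,
holomorphy and continuation in `h₀`, the reflection `Bailey ⇐ Sorokin`; (4) Dougall's theorem (terminating and non-terminating, Zudilin's form, full
range, complex parameters), the very-well-poised induction, `vwp = integral` for positive parameters, and the two discharges.
RE-HOMED into `Literature/` by the Hodge foundations lane (`lit-hodgefound`, seat p20, generation 40): verbatim DECLARATION-LEVEL ports (the 229
declarations needed, in dependency order; each Part is a slice of one Summits module) of 50 theorem modules `Summits/KontsevichZagierPeriods/Zeta5Search/*.lean`
(Barnes*, Sorokin*, Dougall*, VWP*, HypergeometricWhipple, GammaRatioUniform, WedgeDictionary*, BaileyFromSorokinReflection); the namespace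
`Summit.KontsevichZagierPeriods.Zeta5Search` is re-rooted at `Literature.NumberTheory.Irrationality.Zudilin2004` (module sub-namespaces kept); the nine Barnes–Mellin / Barnes-cube
lemmas the tree already has (`Literature.NumberTheory.Irrationality.BrownZudilin2022.BarnesMellin/BarnesCube`, `BarnesDoubleProofs.lean`) are used, not re-declared; the two `_holds`
theorems carry the EXACT names.  No new named fact (D-0026); imports Mathlib/Literature only; every declaration carries the citation of the printed statement it
formalises or serves.  The Summits originals stay in place (transitional duplication).  WHAT THIS IS NOT: nothing here bears on the period conjecture or on the
irrationality of `ζ(5)`; it is the classical hypergeometric analysis behind Zudilin's group structure, re-proved in the tree's vocabulary.  (This is file 2 of 4.)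
-/

noncomputable section

/-!
## Part 1 — port of `Summits/KontsevichZagierPeriods/Zeta5Search/SorokinIntegrandBounds.lean` (12 declarations kept)

# The nested kernel `Q_k` and a pointwise recursion bound for Zudilin's integrand

Declarations of this Part (verbatim port; each keeps its own docstring and citation): `nestedQ_ofFn_succ`, `nestedQ_ofFn_cons`, `nestedQ_mem_Icc`, `nestedQ_mem_Ioo`, `nestedQ_ofFn_mem_Ioo`, `nestedQ_ofFn_mem_Icc`, `continuous_nestedQ_ofFn`, `measurable_weight`, `sorokinIntegrand_eq`, `half_rpow_neg`, `split_rpow_le`, `weight_succ_le`.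

Reference keys (see `references.bib` and the declarations' citations): [Zudilin2004].
-/

section Part1

namespace Literature.NumberTheory.Irrationality.Zudilin2004.SorokinIntegrandBounds

open _root_.MeasureTheory _root_.Set _root_.Filter
open Literature.NumberTheory.Irrationality.Zudilin2002 (nestedQ sorokinIntegrand)

/-! ### 1. The nested kernel -/

/-- First recursion of Zudilin's (3) on `Fin (k+1) → ℝ`: `Q_{k+1}(x) = 1 − x₀ · Q_k(x ∘ succ)`.
[cite: Zudilin2004, §4 (supporting lemma)] -/
theorem nestedQ_ofFn_succ {k : ℕ} (x : Fin (k + 1) → ℝ) :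
    nestedQ (List.ofFn x) = 1 - x 0 * nestedQ (List.ofFn fun j : Fin k => x j.succ) := by
  rw [List.ofFn_succ]
  rfl

/-- The same recursion for `Fin.cons`: `Q_{k+1}(t, x') = 1 − t · Q_k(x')`.
[cite: Zudilin2004, §4 (supporting lemma)] -/
theorem nestedQ_ofFn_cons {k : ℕ} (t : ℝ) (x' : Fin k → ℝ) :
    nestedQ (List.ofFn (Fin.cons t x' : Fin (k + 1) → ℝ)) = 1 - t * nestedQ (List.ofFn x') := by
  rw [nestedQ_ofFn_succ]
  simp only [Fin.cons_zero, Fin.cons_succ]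

/-- On lists with entries in `[0,1]`, `0 ≤ Q ≤ 1`. [cite: Zudilin2004, §4 (supporting lemma)] -/
theorem nestedQ_mem_Icc : ∀ (l : List ℝ), (∀ t ∈ l, t ∈ Icc (0 : ℝ) 1) → nestedQ l ∈ Icc (0 : ℝ) 1
  | [], _ => by simp [nestedQ]
  | t :: l, h => by
    have ht : t ∈ Icc (0 : ℝ) 1 := h t (by simp)
    have hl := nestedQ_mem_Icc l fun s hs => h s (by simp [hs])
    simp only [nestedQ, mem_Icc] at hl ⊢
    constructor <;> nlinarith [ht.1, ht.2, hl.1, hl.2, mul_nonneg ht.1 hl.1]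

/-- On nonempty lists with entries in `(0,1)`, `0 < Q < 1` (Zudilin's (11)).
[cite: Zudilin2004, §4 (supporting lemma)] -/
theorem nestedQ_mem_Ioo : ∀ (l : List ℝ), l ≠ [] → (∀ t ∈ l, t ∈ Ioo (0 : ℝ) 1) → nestedQ l ∈ Ioo (0 : ℝ) 1
  | [], h, _ => (h rfl).elim
  | t :: l, _, h => by
    have ht : t ∈ Ioo (0 : ℝ) 1 := h t (by simp)
    have hl : nestedQ l ∈ Icc (0 : ℝ) 1 := nestedQ_mem_Icc l fun s hs => Ioo_subset_Icc_self (h s (by simp [hs]))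
    rcases l with _ | ⟨s, l'⟩
    · simp only [nestedQ, mem_Ioo, mul_one]
      constructor <;> linarith [ht.1, ht.2]
    · have hl' : nestedQ (s :: l') ∈ Ioo (0 : ℝ) 1 := nestedQ_mem_Ioo (s :: l') (by simp) fun r hr => h r (by simp [hr])
      simp only [mem_Ioo] at hl' ⊢
      change 0 < 1 - t * nestedQ (s :: l') ∧ 1 - t * nestedQ (s :: l') < 1
      constructor <;> nlinarith [ht.1, ht.2, hl'.1, hl'.2, mul_pos ht.1 hl'.1, mul_lt_mul'' ht.2 hl'.2 ht.1.le hl'.1.le]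

/-- On the open cube (`k ≥ 1`), `0 < Q_k(x) < 1`. [cite: Zudilin2004, §4 (supporting lemma)] -/
theorem nestedQ_ofFn_mem_Ioo {k : ℕ} (hk : 1 ≤ k) {x : Fin k → ℝ} (hx : ∀ j, x j ∈ Ioo (0 : ℝ) 1) :
    nestedQ (List.ofFn x) ∈ Ioo (0 : ℝ) 1 := by
  refine nestedQ_mem_Ioo _ ?_ fun t ht => ?_
  · intro h
    have := congrArg List.length h
    simp at this
    omega
  · obtain ⟨j, rfl⟩ := (List.mem_ofFn' _ _).1 ht
    exact hx j

/-- On the closed cube, `0 ≤ Q_k(x) ≤ 1`. [cite: Zudilin2004, §4 (supporting lemma)] -/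
theorem nestedQ_ofFn_mem_Icc {k : ℕ} {x : Fin k → ℝ} (hx : ∀ j, x j ∈ Icc (0 : ℝ) 1) :
    nestedQ (List.ofFn x) ∈ Icc (0 : ℝ) 1 :=
  nestedQ_mem_Icc _ fun t ht => by
    obtain ⟨j, rfl⟩ := (List.mem_ofFn' _ _).1 ht
    exact hx j

/-- Continuity of `x ↦ Q_k(x)` on `Fin k → ℝ` (a polynomial in the coordinates).
[cite: Zudilin2004, §4 (supporting lemma)] -/
theorem continuous_nestedQ_ofFn : ∀ k : ℕ, Continuous fun x : Fin k → ℝ => nestedQ (List.ofFn x)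
  | 0 => by simp [nestedQ]; exact continuous_const
  | k + 1 => by
    have ih := continuous_nestedQ_ofFn k
    have h : (fun x : Fin (k + 1) → ℝ => nestedQ (List.ofFn x)) =
        fun x => 1 - x 0 * nestedQ (List.ofFn fun j : Fin k => x j.succ) := by
      funext x; exact nestedQ_ofFn_succ x
    rw [h]
    exact continuous_const.sub ((continuous_apply 0).mul (ih.comp (continuous_pi fun j => continuous_apply _)))

/-- Measurability of the two-exponent integrand `∏ x_j^{a_j−1}(1−x_j)^{b_j−a_j−1} · Q_k^{−a₀} · (1−Q_k)^{−c₀}`.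
[cite: Zudilin2004, §4 (supporting lemma)] -/
theorem measurable_weight (k : ℕ) (a₀ c₀ : ℝ) (a b : ℕ → ℝ) :
    Measurable fun x : Fin k → ℝ =>
      (∏ j : Fin k, x j ^ (a j - 1) * (1 - x j) ^ (b j - a j - 1)) *
        nestedQ (List.ofFn x) ^ (-a₀) * (1 - nestedQ (List.ofFn x)) ^ (-c₀) := by
  have hQ := (continuous_nestedQ_ofFn k).measurable
  refine Measurable.mul (Measurable.mul ?_ (hQ.pow_const _)) ((measurable_const.sub hQ).pow_const _)
  refine Finset.measurable_prod _ fun j _ => ?_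
  exact ((measurable_pi_apply j).pow_const _).mul ((measurable_const.sub (measurable_pi_apply j)).pow_const _)

/-- On the closed cube the typed integrand is the two-exponent integrand with `c₀ = 0`.
[cite: Zudilin2004, §4 (supporting lemma)] -/
theorem sorokinIntegrand_eq (k : ℕ) (a₀ : ℝ) (a b : ℕ → ℝ) {x : Fin k → ℝ} (hx : ∀ j, x j ∈ Icc (0 : ℝ) 1) :
    sorokinIntegrand k a₀ a b x =
      (∏ j : Fin k, x j ^ (a j - 1) * (1 - x j) ^ (b j - a j - 1)) *
        nestedQ (List.ofFn x) ^ (-a₀) * (1 - nestedQ (List.ofFn x)) ^ (-(0 : ℝ)) := by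
  rw [sorokinIntegrand, neg_zero, Real.rpow_zero, mul_one, div_eq_mul_inv, Real.rpow_neg (nestedQ_ofFn_mem_Icc hx).1]

/-! ### 2. The one-variable kernel bound -/

/-- `(1/2)^{−a} = 2^{a}`. [cite: Zudilin2004, §4 (supporting lemma)] -/
theorem half_rpow_neg (a : ℝ) : (1 / 2 : ℝ) ^ (-a) = 2 ^ a := by
  rw [one_div, Real.inv_rpow (by norm_num), Real.rpow_neg (by norm_num), inv_inv]

/-- **The splitting bound**: for `t ∈ (0,1)`, `P ∈ (0,1]`, `a₀ ≥ 0`, `γ ≥ 0`,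
`((1−t) + tP)^{−a₀} ≤ 2^{a₀} (1−t)^{−max(a₀−γ,0)} P^{−γ}` — on `t ≤ 1/2` the base is `≥ 1/2`; on `t ≥ 1/2` it is
`≥ (max(1−t, P))/2` and `max^{−a₀} = max^{−δ}·max^{−(a₀−δ)} ≤ (1−t)^{−δ} P^{−γ}` (`δ = max(a₀−γ,0)`, `P ≤ 1`).
[cite: Zudilin2004, §4 (supporting lemma)] -/
theorem split_rpow_le {t P a₀ γ : ℝ} (ht : t ∈ Ioo (0 : ℝ) 1) (hP : P ∈ Ioc (0 : ℝ) 1) (ha₀ : 0 ≤ a₀) (hγ : 0 ≤ γ) :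
    ((1 - t) + t * P) ^ (-a₀) ≤ (2 : ℝ) ^ a₀ * (1 - t) ^ (-max (a₀ - γ) 0) * P ^ (-γ) := by
  have hu : 0 < 1 - t := by linarith [ht.2]
  have hu1 : 1 - t ≤ 1 := by linarith [ht.1]
  set δ : ℝ := max (a₀ - γ) 0 with hδ
  have hδ0 : 0 ≤ δ := le_max_right _ _
  have hδa : δ ≤ a₀ := max_le (by linarith) ha₀
  have hγ' : a₀ - δ ≤ γ := by have := le_max_left (a₀ - γ) 0; rw [← hδ] at this; linarith
  have hm : 0 < (1 - t) + t * P := by nlinarith [ht.1, hP.1]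
  -- the right-hand side dominates `2^{a₀}`
  have h1 : 1 ≤ (1 - t) ^ (-δ) := Real.one_le_rpow_of_pos_of_le_one_of_nonpos hu hu1 (by linarith)
  have h2 : 1 ≤ P ^ (-γ) := Real.one_le_rpow_of_pos_of_le_one_of_nonpos hP.1 hP.2 (by linarith)
  have h2a : (0 : ℝ) < 2 ^ a₀ := by positivity
  rcases le_or_gt t (1 / 2) with hth | hth
  · -- `t ≤ 1/2`: the base is at least `1/2`
    have hbase : (1 / 2 : ℝ) ≤ (1 - t) + t * P := by nlinarith [ht.1, hP.1]
    calc ((1 - t) + t * P) ^ (-a₀) ≤ (1 / 2 : ℝ) ^ (-a₀) := Real.rpow_le_rpow_of_nonpos (by norm_num) hbase (by linarith)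
      _ = 2 ^ a₀ * 1 * 1 := by rw [half_rpow_neg, mul_one, mul_one]
      _ ≤ 2 ^ a₀ * (1 - t) ^ (-δ) * P ^ (-γ) := by gcongr
  · -- `t > 1/2`: the base is at least `max(1−t, P)/2`
    set M : ℝ := max (1 - t) P with hM
    have hM0 : 0 < M := lt_max_of_lt_left hu
    have hbase : M / 2 ≤ (1 - t) + t * P := by
      have : M ≤ (1 - t) + P := max_le (by linarith [hP.1]) (by linarith)
      nlinarith [hP.1]
    have hMa : M ^ (-a₀) = M ^ (-δ) * M ^ (-(a₀ - δ)) := by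
      rw [← Real.rpow_add hM0]; congr 1; ring
    have hMu : M ^ (-δ) ≤ (1 - t) ^ (-δ) := Real.rpow_le_rpow_of_nonpos hu (le_max_left _ _) (by linarith)
    have hMP : M ^ (-(a₀ - δ)) ≤ P ^ (-γ) :=
      calc M ^ (-(a₀ - δ)) ≤ P ^ (-(a₀ - δ)) := Real.rpow_le_rpow_of_nonpos hP.1 (le_max_right _ _) (by linarith)
        _ ≤ P ^ (-γ) := Real.rpow_le_rpow_of_exponent_ge hP.1 hP.2 (by linarith)
    calc ((1 - t) + t * P) ^ (-a₀) ≤ (M / 2) ^ (-a₀) := Real.rpow_le_rpow_of_nonpos (by positivity) hbase (by linarith)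
      _ = 2 ^ a₀ * (M ^ (-δ) * M ^ (-(a₀ - δ))) := by
          rw [Real.div_rpow hM0.le (by norm_num), Real.rpow_neg (by norm_num : (0 : ℝ) ≤ 2), hMa]
          field_simp
      _ ≤ 2 ^ a₀ * ((1 - t) ^ (-δ) * P ^ (-γ)) := by gcongr
      _ = 2 ^ a₀ * (1 - t) ^ (-δ) * P ^ (-γ) := by ring

/-! ### 3. The recursion bound for the two-exponent integrand -/

/-- **Recursion bound** (`k ≥ 1`, open cube): for `x = Fin.cons t x'`, with `Q_{k+1}(x) = (1−t) + t(1−Q_k(x'))`,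
`1 − Q_{k+1}(x) = t·Q_k(x')` and `split_rpow_le`, the `(k+1)`-variable integrand with exponents `(a₀, c₀)` is at most
`2^{a₀} · t^{a₀−c₀−1}(1−t)^{b₀−a₀−max(a₀−γ,0)−1}` times the `k`-variable integrand in `x'` with exponents `(c₀, γ)` and shifted
parameters `a(·+1)`, `b(·+1)` (`a₀, γ ≥ 0`). [cite: Zudilin2004, §4 (supporting lemma)] -/
theorem weight_succ_le {k : ℕ} (hk : 1 ≤ k) {a₀ γ : ℝ} (ha₀ : 0 ≤ a₀) (hγ : 0 ≤ γ) (c₀ : ℝ) (a b : ℕ → ℝ)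
    {t : ℝ} {x' : Fin k → ℝ} (ht : t ∈ Ioo (0 : ℝ) 1) (hx' : ∀ j, x' j ∈ Ioo (0 : ℝ) 1) :
    (∏ j : Fin (k + 1), (Fin.cons t x' : Fin (k + 1) → ℝ) j ^ (a j - 1) *
          (1 - (Fin.cons t x' : Fin (k + 1) → ℝ) j) ^ (b j - a j - 1)) *
        nestedQ (List.ofFn (Fin.cons t x' : Fin (k + 1) → ℝ)) ^ (-a₀) *
          (1 - nestedQ (List.ofFn (Fin.cons t x' : Fin (k + 1) → ℝ))) ^ (-c₀) ≤
      (2 : ℝ) ^ a₀ * (t ^ (a 0 - c₀ - 1) * (1 - t) ^ (b 0 - a 0 - max (a₀ - γ) 0 - 1)) *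
        ((∏ j : Fin k, x' j ^ (a ((j : ℕ) + 1) - 1) * (1 - x' j) ^ (b ((j : ℕ) + 1) - a ((j : ℕ) + 1) - 1)) *
          nestedQ (List.ofFn x') ^ (-c₀) * (1 - nestedQ (List.ofFn x')) ^ (-γ)) := by
  have hu : 0 < 1 - t := by linarith [ht.2]
  have hq : nestedQ (List.ofFn x') ∈ Ioo (0 : ℝ) 1 := nestedQ_ofFn_mem_Ioo hk hx'
  have hP : 1 - nestedQ (List.ofFn x') ∈ Ioc (0 : ℝ) 1 := ⟨by linarith [hq.2], by linarith [hq.1]⟩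
  have hQ : nestedQ (List.ofFn (Fin.cons t x' : Fin (k + 1) → ℝ)) = (1 - t) + t * (1 - nestedQ (List.ofFn x')) := by
    rw [nestedQ_ofFn_cons]; ring
  have h1Q : 1 - nestedQ (List.ofFn (Fin.cons t x' : Fin (k + 1) → ℝ)) = t * nestedQ (List.ofFn x') := by
    rw [nestedQ_ofFn_cons]; ring
  -- split the product over `Fin (k+1)`
  have hprod : (∏ j : Fin (k + 1), (Fin.cons t x' : Fin (k + 1) → ℝ) j ^ (a j - 1) *
        (1 - (Fin.cons t x' : Fin (k + 1) → ℝ) j) ^ (b j - a j - 1)) =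
      (t ^ (a 0 - 1) * (1 - t) ^ (b 0 - a 0 - 1)) *
        ∏ j : Fin k, x' j ^ (a ((j : ℕ) + 1) - 1) * (1 - x' j) ^ (b ((j : ℕ) + 1) - a ((j : ℕ) + 1) - 1) := by
    rw [Fin.prod_univ_succ]
    simp only [Fin.cons_zero, Fin.cons_succ, Fin.val_zero, Fin.val_succ]
  have hR0 : 0 ≤ ∏ j : Fin k, x' j ^ (a ((j : ℕ) + 1) - 1) * (1 - x' j) ^ (b ((j : ℕ) + 1) - a ((j : ℕ) + 1) - 1) :=
    Finset.prod_nonneg fun j _ =>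
      mul_nonneg (Real.rpow_nonneg (hx' j).1.le _) (Real.rpow_nonneg (by linarith [(hx' j).2]) _)
  have hf0 : 0 ≤ t ^ (a 0 - 1) * (1 - t) ^ (b 0 - a 0 - 1) := mul_nonneg (Real.rpow_nonneg ht.1.le _) (Real.rpow_nonneg hu.le _)
  have hsplit := split_rpow_le ht hP ha₀ hγ
  have hmul : (t * nestedQ (List.ofFn x')) ^ (-c₀) = t ^ (-c₀) * nestedQ (List.ofFn x') ^ (-c₀) :=
    Real.mul_rpow ht.1.le hq.1.le
  have htq0 : 0 ≤ (t * nestedQ (List.ofFn x')) ^ (-c₀) := Real.rpow_nonneg (mul_nonneg ht.1.le hq.1.le) _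
  rw [hprod, h1Q, hQ]
  calc t ^ (a 0 - 1) * (1 - t) ^ (b 0 - a 0 - 1) *
          (∏ j : Fin k, x' j ^ (a ((j : ℕ) + 1) - 1) * (1 - x' j) ^ (b ((j : ℕ) + 1) - a ((j : ℕ) + 1) - 1)) *
          ((1 - t) + t * (1 - nestedQ (List.ofFn x'))) ^ (-a₀) * (t * nestedQ (List.ofFn x')) ^ (-c₀)
      ≤ t ^ (a 0 - 1) * (1 - t) ^ (b 0 - a 0 - 1) *
          (∏ j : Fin k, x' j ^ (a ((j : ℕ) + 1) - 1) * (1 - x' j) ^ (b ((j : ℕ) + 1) - a ((j : ℕ) + 1) - 1)) *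
          ((2 : ℝ) ^ a₀ * (1 - t) ^ (-max (a₀ - γ) 0) * (1 - nestedQ (List.ofFn x')) ^ (-γ)) *
          (t * nestedQ (List.ofFn x')) ^ (-c₀) :=
        mul_le_mul_of_nonneg_right (mul_le_mul_of_nonneg_left hsplit (mul_nonneg hf0 hR0)) htq0
    _ = (2 : ℝ) ^ a₀ * ((t ^ (a 0 - 1) * t ^ (-c₀)) * ((1 - t) ^ (b 0 - a 0 - 1) * (1 - t) ^ (-max (a₀ - γ) 0))) *
          ((∏ j : Fin k, x' j ^ (a ((j : ℕ) + 1) - 1) * (1 - x' j) ^ (b ((j : ℕ) + 1) - a ((j : ℕ) + 1) - 1)) *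
            nestedQ (List.ofFn x') ^ (-c₀) * (1 - nestedQ (List.ofFn x')) ^ (-γ)) := by
        rw [hmul]; ring
    _ = _ := by
        rw [← Real.rpow_add ht.1, ← Real.rpow_add hu]
        congr 3 <;> ring

end Literature.NumberTheory.Irrationality.Zudilin2004.SorokinIntegrandBounds

end Part1

/-!
## Part 2 — port of `Summits/KontsevichZagierPeriods/Zeta5Search/SorokinConvergence.lean` (5 declarations kept)

# Convergence of Zudilin's multiple integral `J_k`

Declarations of this Part (verbatim port; each keeps its own docstring and citation): `exists_gap`, `lintegral_beta_lt_top`, `ae_mem_openCube`, `lintegral_weight_lt_top`, `integrableOn_sorokinIntegrand`.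

Reference keys (see `references.bib` and the declarations' citations): [Zudilin2004].
-/

section Part2

namespace Literature.NumberTheory.Irrationality.Zudilin2004.SorokinConvergence

open _root_.MeasureTheory _root_.Set _root_.Filter
open scoped _root_.ENNReal
open Literature.NumberTheory.Irrationality.Zudilin2002 (nestedQ sorokinIntegrand)
open Literature.NumberTheory.Irrationality.Zudilin2004.SorokinIntegrandBounds

/-! ### 1. Elementary helpers -/

/-- A real strictly between a lower bound `L` and finitely many upper bounds `A`, `V`, `U 0, …, U (N−1)`.
[cite: Zudilin2004, §4 (supporting lemma)] -/
theorem exists_gap : ∀ (N : ℕ) {L A V : ℝ} {U : ℕ → ℝ}, L < A → L < V → (∀ i, i < N → L < U i) →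
    ∃ γ : ℝ, L < γ ∧ γ < A ∧ γ < V ∧ ∀ i, i < N → γ < U i
  | 0, L, A, V, U, hA, hV, _ =>
    ⟨(L + min A V) / 2, by
      have := lt_min hA hV
      refine ⟨by linarith, ?_, ?_, fun i hi => (Nat.not_lt_zero i hi).elim⟩ <;>
        linarith [min_le_left A V, min_le_right A V]⟩
  | N + 1, L, A, V, U, hA, hV, hU => by
    obtain ⟨γ', h1, h2, h3, h4⟩ := exists_gap N hA hV fun i hi => hU i (Nat.lt_succ_of_lt hi)
    have hN := hU N (Nat.lt_succ_self N)
    refine ⟨min γ' ((L + U N) / 2), lt_min h1 (by linarith), lt_of_le_of_lt (min_le_left _ _) h2,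
      lt_of_le_of_lt (min_le_left _ _) h3, fun i hi => ?_⟩
    rcases Nat.lt_succ_iff_lt_or_eq.1 hi with hi | rfl
    · exact lt_of_le_of_lt (min_le_left _ _) (h4 i hi)
    · exact lt_of_le_of_lt (min_le_right _ _) (by linarith)

/-- The real Beta integral as a finite lintegral: `∫⁻_{(0,1)} t^{u−1}(1−t)^{v−1} < ∞` for `u, v > 0`.
[cite: Zudilin2004, §4 (supporting lemma)] -/
theorem lintegral_beta_lt_top {u v : ℝ} (hu : 0 < u) (hv : 0 < v) :
    ∫⁻ t, ENNReal.ofReal (t ^ (u - 1) * (1 - t) ^ (v - 1)) ∂((volume : Measure ℝ).restrict (Ioo 0 1)) < ⊤ := by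
  have h : ∫⁻ t in Ioo (0 : ℝ) 1, ‖t ^ (u - 1) * (1 - t) ^ (v - 1)‖ₑ < ⊤ :=
    (Literature.Analysis.SpecialFunctions.integrableOn_Ioo_rpow_mul_one_sub_rpow hu hv).hasFiniteIntegral
  refine lt_of_le_of_lt (lintegral_mono fun t => ?_) h
  rw [← ofReal_norm, Real.norm_eq_abs]
  exact ENNReal.ofReal_le_ofReal (le_abs_self _)

/-- Almost every point of the product of restricted Lebesgue measures lies in the open cube.
[cite: Zudilin2004, §4 (supporting lemma)] -/
theorem ae_mem_openCube (n : ℕ) :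
    ∀ᵐ x ∂(Measure.pi fun _ : Fin n => (volume : Measure ℝ).restrict (Ioo 0 1)), ∀ j, x j ∈ Ioo (0 : ℝ) 1 := by
  have h : (Measure.pi fun _ : Fin n => (volume : Measure ℝ).restrict (Ioo 0 1)) =
      (Measure.pi fun _ : Fin n => (volume : Measure ℝ)).restrict (Set.pi univ fun _ => Ioo (0 : ℝ) 1) :=
    (Measure.restrict_pi_pi _ _).symm
  rw [h]
  filter_upwards [ae_restrict_mem (MeasurableSet.univ_pi fun _ => measurableSet_Ioo)] with x hx
  exact fun j => hx j (mem_univ _)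

/-! ### 2. The induction -/

/-- **Finiteness of the two-exponent integrals** on the open cube `(0,1)^{k+1}` (product of restricted Lebesgue measures):
for `a₀, c₀ ≥ 0`, edge conditions `0 < a_j < b_j`, `c₀ < a_0`, and the two interleaved chains of corner conditions (the
`a₀`-chain from the zero set of `Q_{k+1}`, the `c₀`-chain from that of `1 − Q_{k+1} = x₀ Q_k`), the lintegral of
`∏ x_j^{a_j−1}(1−x_j)^{b_j−a_j−1} Q^{−a₀} (1−Q)^{−c₀}` is finite.  Induction on `k`: Beta base, `weight_succ_le` + Tonelli step.
[cite: Zudilin2004, §4 (supporting lemma)] -/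
theorem lintegral_weight_lt_top : ∀ (k : ℕ) (a₀ c₀ : ℝ) (a b : ℕ → ℝ), 0 ≤ a₀ → 0 ≤ c₀ →
    (∀ j, j < k + 1 → 0 < a j ∧ a j < b j) → c₀ < a 0 →
    (∀ i, 2 * i + 2 ≤ k + 1 → a₀ < (∑ m ∈ Finset.range (i + 1), (b (2 * m) - a (2 * m))) + a (2 * i + 1)) →
    (Odd (k + 1) → a₀ < ∑ m ∈ Finset.range ((k + 2) / 2), (b (2 * m) - a (2 * m))) →
    (∀ i, 2 * i + 3 ≤ k + 1 → c₀ < (∑ m ∈ Finset.range (i + 1), (b (2 * m + 1) - a (2 * m + 1))) + a (2 * i + 2)) →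
    (Even (k + 1) → c₀ < ∑ m ∈ Finset.range ((k + 1) / 2), (b (2 * m + 1) - a (2 * m + 1))) →
    ∫⁻ x, ENNReal.ofReal ((∏ j : Fin (k + 1), x j ^ (a j - 1) * (1 - x j) ^ (b j - a j - 1)) *
        nestedQ (List.ofFn x) ^ (-a₀) * (1 - nestedQ (List.ofFn x)) ^ (-c₀))
      ∂(Measure.pi fun _ : Fin (k + 1) => (volume : Measure ℝ).restrict (Ioo 0 1)) < ⊤
  | 0, a₀, c₀, a, b, ha₀, hc₀, hE, hC0, hA, hAodd, hC, hCeven => by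
    -- base: `J₁`-type Beta integral `∫ t^{a₀'-c₀-1}(1-t)^{b₀-a₀'-a₀-1}`
    have hβ : a₀ < b 0 - a 0 := by
      have := hAodd (by decide)
      simpa using this
    set μI : Measure ℝ := (volume : Measure ℝ).restrict (Ioo 0 1) with hμI
    set g : ℝ → ℝ≥0∞ := fun t => ENNReal.ofReal ((t ^ (a 0 - 1) * (1 - t) ^ (b 0 - a 0 - 1)) *
      (1 - t * 1) ^ (-a₀) * (1 - (1 - t * 1)) ^ (-c₀)) with hg
    have hmp := measurePreserving_funUnique μI (Fin 1)
    have heq : (fun x : Fin 1 → ℝ => ENNReal.ofReal ((∏ j : Fin 1, x j ^ (a j - 1) * (1 - x j) ^ (b j - a j - 1)) *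
          nestedQ (List.ofFn x) ^ (-a₀) * (1 - nestedQ (List.ofFn x)) ^ (-c₀))) =
        fun x => g (MeasurableEquiv.funUnique (Fin 1) ℝ x) := by
      funext x
      have hQ : nestedQ (List.ofFn x) = 1 - x 0 * 1 := by simp [nestedQ, List.ofFn_succ]
      rw [hg, hQ, Fin.prod_univ_one]
      rfl
    rw [heq]
    refine lt_of_eq_of_lt (hmp.lintegral_comp_emb (MeasurableEquiv.measurableEmbedding _) g) ?_
    -- compare with the Beta integrand on `(0,1)`
    have hle : ∀ᵐ t ∂μI, g t ≤ ENNReal.ofReal (t ^ ((a 0 - c₀) - 1) * (1 - t) ^ ((b 0 - a 0 - a₀) - 1)) := by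
      filter_upwards [ae_restrict_mem measurableSet_Ioo] with t ht
      have ht1 : 0 < 1 - t := by linarith [ht.2]
      rw [hg]
      simp only [mul_one, sub_sub_cancel]
      refine le_of_eq (congrArg ENNReal.ofReal ?_)
      rw [show (a 0 - c₀) - 1 = (a 0 - 1) + -c₀ by ring, Real.rpow_add ht.1,
        show (b 0 - a 0 - a₀) - 1 = (b 0 - a 0 - 1) + -a₀ by ring, Real.rpow_add ht1]
      ring
    exact lt_of_le_of_lt (lintegral_mono_ae hle) (lintegral_beta_lt_top (by linarith) (by linarith))
  | k + 1, a₀, c₀, a, b, ha₀, hc₀, hE, hC0, hA, hAodd, hC, hCeven => by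
    set μI : Measure ℝ := (volume : Measure ℝ).restrict (Ioo 0 1) with hμI
    have hE0 := hE 0 (by omega)
    have hE1 := hE 1 (by omega)
    -- (1) the auxiliary exponent `γ`
    have hLA : max (a₀ - (b 0 - a 0)) 0 < a 1 := by
      refine max_lt ?_ hE1.1
      have := hA 0 (by omega)
      simp at this
      linarith
    have hLU : ∀ i, i < k / 2 →
        max (a₀ - (b 0 - a 0)) 0 < (∑ m ∈ Finset.range (i + 1), (b (2 * m + 2) - a (2 * m + 2))) + a (2 * i + 3) := by
      intro i hi
      have hpos : 0 < (∑ m ∈ Finset.range (i + 1), (b (2 * m + 2) - a (2 * m + 2))) + a (2 * i + 3) := by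
        refine add_pos_of_nonneg_of_pos (Finset.sum_nonneg fun m hm => ?_) (hE (2 * i + 3) (by omega)).1
        have := hE (2 * m + 2) (by simp at hm; omega)
        linarith
      refine max_lt ?_ hpos
      have h := hA (i + 1) (by omega)
      have hs := Finset.sum_range_succ' (fun m => b (2 * m) - a (2 * m)) (i + 1)
      simp only [mul_add_one, mul_zero] at hs
      rw [hs, show 2 * (i + 1) + 1 = 2 * i + 3 by ring] at h
      linarith
    have hLV : Even (k + 1) →
        max (a₀ - (b 0 - a 0)) 0 < ∑ m ∈ Finset.range ((k + 1) / 2), (b (2 * m + 2) - a (2 * m + 2)) := by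
      intro hev
      have hpos : 0 < ∑ m ∈ Finset.range ((k + 1) / 2), (b (2 * m + 2) - a (2 * m + 2)) := by
        refine Finset.sum_pos (fun m hm => ?_) ⟨0, by simp; obtain ⟨r, hr⟩ := hev; omega⟩
        have := hE (2 * m + 2) (by simp at hm; omega)
        linarith
      refine max_lt ?_ hpos
      have h := hAodd (by obtain ⟨r, hr⟩ := hev; exact ⟨r, by omega⟩)
      have hs := Finset.sum_range_succ' (fun m => b (2 * m) - a (2 * m)) ((k + 1) / 2)
      simp only [mul_add_one, mul_zero] at hs
      rw [show (k + 1 + 2) / 2 = (k + 1) / 2 + 1 by omega, hs] at h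
      linarith
    -- dummy `V` when `k+1` is odd
    obtain ⟨γ, hγL, hγA, hγV, hγU⟩ := exists_gap (k / 2) (L := max (a₀ - (b 0 - a 0)) 0) (A := a 1)
      (V := if Even (k + 1) then ∑ m ∈ Finset.range ((k + 1) / 2), (b (2 * m + 2) - a (2 * m + 2)) else a 1)
      (U := fun i => (∑ m ∈ Finset.range (i + 1), (b (2 * m + 2) - a (2 * m + 2))) + a (2 * i + 3)) hLA
      (by split_ifs with h; exacts [hLV h, hLA]) hLU
    have hγ0 : 0 ≤ γ := le_trans (le_max_right _ _) hγL.le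
    have hγβ : a₀ - (b 0 - a 0) < γ := lt_of_le_of_lt (le_max_left _ _) hγL
    have hδ : max (a₀ - γ) 0 < b 0 - a 0 := max_lt (by linarith) (by linarith [hE0.2])
    -- (2) the induction hypothesis at `(k, c₀, γ, a(·+1), b(·+1))`
    have IH := lintegral_weight_lt_top k c₀ γ (fun n => a (n + 1)) (fun n => b (n + 1)) hc₀ hγ0
      (fun j hj => hE (j + 1) (by omega)) hγA
      (fun i hi => hC i (by omega))
      (fun hodd => hCeven (by obtain ⟨r, hr⟩ := hodd; exact ⟨r + 1, by omega⟩))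
      (fun i hi => hγU i (by omega))
      (fun hev => by have := hγV; rw [if_pos hev] at this; exact this)
    -- (3) the Beta factor in `x₀`
    have hBeta := lintegral_beta_lt_top (u := a 0 - c₀) (v := b 0 - a 0 - max (a₀ - γ) 0) (by linarith) (by linarith)
    -- (4) the pointwise bound, a.e. on the open cube
    set G : (Fin (k + 2) → ℝ) → ℝ≥0∞ := fun x => ENNReal.ofReal ((∏ j : Fin (k + 2), x j ^ (a j - 1) * (1 - x j) ^ (b j - a j - 1)) *
        nestedQ (List.ofFn x) ^ (-a₀) * (1 - nestedQ (List.ofFn x)) ^ (-c₀)) with hG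
    set g : ℝ → ℝ≥0∞ := fun t => ENNReal.ofReal (t ^ ((a 0 - c₀) - 1) * (1 - t) ^ ((b 0 - a 0 - max (a₀ - γ) 0) - 1)) with hg
    set H : (Fin (k + 1) → ℝ) → ℝ≥0∞ := fun x' => ENNReal.ofReal
      ((∏ j : Fin (k + 1), x' j ^ ((fun n => a (n + 1)) j - 1) * (1 - x' j) ^ ((fun n => b (n + 1)) j - (fun n => a (n + 1)) j - 1)) *
        nestedQ (List.ofFn x') ^ (-c₀) * (1 - nestedQ (List.ofFn x')) ^ (-γ)) with hH
    have hbound : ∀ᵐ x ∂(Measure.pi fun _ : Fin (k + 2) => μI),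
        G x ≤ ENNReal.ofReal ((2 : ℝ) ^ a₀) * (g (x 0) * H (fun j => x j.succ)) := by
      filter_upwards [ae_mem_openCube (k + 2)] with x hx
      obtain ⟨t, x', rfl⟩ : ∃ t x', Fin.cons t x' = x := ⟨x 0, Fin.tail x, Fin.cons_self_tail x⟩
      have ht : t ∈ Ioo (0 : ℝ) 1 := by simpa using hx 0
      have hx' : ∀ j, x' j ∈ Ioo (0 : ℝ) 1 := fun j => by simpa using hx j.succ
      have hw := weight_succ_le (k := k + 1) (by omega) ha₀ hγ0 c₀ a b ht hx'
      have hgt : 0 ≤ t ^ (a 0 - c₀ - 1) * (1 - t) ^ (b 0 - a 0 - max (a₀ - γ) 0 - 1) :=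
        mul_nonneg (Real.rpow_nonneg ht.1.le _) (Real.rpow_nonneg (by linarith [ht.2]) _)
      rw [hG, hg, hH]
      simp only [Fin.cons_zero, Fin.cons_succ]
      calc _ ≤ ENNReal.ofReal ((2 : ℝ) ^ a₀ * (t ^ (a 0 - c₀ - 1) * (1 - t) ^ (b 0 - a 0 - max (a₀ - γ) 0 - 1)) *
            ((∏ j : Fin (k + 1), x' j ^ (a ((j : ℕ) + 1) - 1) * (1 - x' j) ^ (b ((j : ℕ) + 1) - a ((j : ℕ) + 1) - 1)) *
              nestedQ (List.ofFn x') ^ (-c₀) * (1 - nestedQ (List.ofFn x')) ^ (-γ))) := ENNReal.ofReal_le_ofReal hw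
        _ = _ := by
            rw [ENNReal.ofReal_mul (mul_nonneg (by positivity) hgt), ENNReal.ofReal_mul (by positivity : (0 : ℝ) ≤ 2 ^ a₀),
              mul_assoc]
    -- (5) Tonelli
    have hmp := measurePreserving_piFinSuccAbove (fun _ : Fin (k + 2) => μI) 0
    have hgm : Measurable g := by
      rw [hg]
      exact (((measurable_id.pow_const _).mul ((measurable_const.sub measurable_id).pow_const _))).ennreal_ofReal
    have hHm : Measurable H := by
      rw [hH]
      exact (measurable_weight (k + 1) c₀ γ (fun n => a (n + 1)) (fun n => b (n + 1))).ennreal_ofReal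
    have hprod : ∫⁻ x, g (x 0) * H (fun j => x j.succ) ∂(Measure.pi fun _ : Fin (k + 2) => μI) =
        (∫⁻ t, g t ∂μI) * ∫⁻ x', H x' ∂(Measure.pi fun _ : Fin (k + 1) => μI) := by
      have h1 := hmp.lintegral_comp_emb (MeasurableEquiv.measurableEmbedding _) (fun p => g p.1 * H p.2)
      have h2 : (fun x : Fin (k + 2) → ℝ => (fun p : ℝ × (Fin (k + 1) → ℝ) => g p.1 * H p.2)
          (MeasurableEquiv.piFinSuccAbove (fun _ => ℝ) 0 x)) = fun x => g (x 0) * H (fun j => x j.succ) := by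
        funext x
        simp only [MeasurableEquiv.piFinSuccAbove_apply, Fin.insertNthEquiv_symm_apply]
        congr 1
      rw [h2] at h1
      rw [h1, lintegral_prod_mul hgm.aemeasurable hHm.aemeasurable]
    -- (6) assemble
    calc ∫⁻ x, G x ∂(Measure.pi fun _ : Fin (k + 2) => μI)
        ≤ ∫⁻ x, ENNReal.ofReal ((2 : ℝ) ^ a₀) * (g (x 0) * H (fun j => x j.succ)) ∂(Measure.pi fun _ : Fin (k + 2) => μI) :=
          lintegral_mono_ae hbound
      _ = ENNReal.ofReal ((2 : ℝ) ^ a₀) * ((∫⁻ t, g t ∂μI) * ∫⁻ x', H x' ∂(Measure.pi fun _ : Fin (k + 1) => μI)) := by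
          rw [lintegral_const_mul' _ _ ENNReal.ofReal_ne_top, hprod]
      _ < ⊤ := ENNReal.mul_lt_top ENNReal.ofReal_lt_top (ENNReal.mul_lt_top hBeta IH)

/-! ### 3. Integrability of the typed integrand -/

/-- **Convergence of Zudilin's `J_k`** (typed form): for `k ≥ 1`, `a₀ ≥ 0`, edge conditions `0 < a_j < b_j` (`j < k`) and the
corner conditions `a₀ < (b₀−a₀') + (b₂−a₂) + ⋯ + (b_{2i}−a_{2i}) + a_{2i+1}` (`2i+2 ≤ k`) and, for odd `k`,
`a₀ < (b₀−a₀') + (b₂−a₂) + ⋯ + (b_{k−1}−a_{k−1})` (0-indexed parameters `a j`, `b j` as in the typed `sorokinIntegrand`),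
the integrand `∏ x_j^{a_j−1}(1−x_j)^{b_j−a_j−1}/Q_k(x)^{a₀}` is integrable on the closed cube `[0,1]^k` — so the typed
`sorokinIntegral k a₀ a b` is an honest integral there. [Zudilin math/0206177, (2)–(3) with (5)–(6); the corner form is ours]
[cite: Zudilin2004, §4 (supporting lemma)] -/
theorem integrableOn_sorokinIntegrand {k : ℕ} (hk : 1 ≤ k) {a₀ : ℝ} (ha₀ : 0 ≤ a₀) {a b : ℕ → ℝ}
    (hE : ∀ j, j < k → 0 < a j ∧ a j < b j)
    (hA : ∀ i, 2 * i + 2 ≤ k → a₀ < (∑ m ∈ Finset.range (i + 1), (b (2 * m) - a (2 * m))) + a (2 * i + 1))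
    (hAodd : Odd k → a₀ < ∑ m ∈ Finset.range ((k + 1) / 2), (b (2 * m) - a (2 * m))) :
    IntegrableOn (sorokinIntegrand k a₀ a b) (Set.pi univ fun _ : Fin k => Icc (0 : ℝ) 1) volume := by
  obtain ⟨n, rfl⟩ : ∃ n, k = n + 1 := ⟨k - 1, by omega⟩
  set μI : Measure ℝ := (volume : Measure ℝ).restrict (Ioo 0 1) with hμI
  -- the closed cube and the open cube differ by a null set
  have hae : (Set.pi univ fun _ : Fin (n + 1) => Ioo (0 : ℝ) 1) =ᵐ[volume] (Set.pi univ fun _ : Fin (n + 1) => Icc (0 : ℝ) 1) := by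
    rw [volume_pi]; exact Measure.pi_Ioo_ae_eq_pi_Icc
  refine IntegrableOn.congr_set_ae ?_ hae.symm
  -- measurability
  have hQ := (continuous_nestedQ_ofFn (n + 1)).measurable
  have hmeas : Measurable (sorokinIntegrand (n + 1) a₀ a b) := by
    refine Measurable.div (Finset.measurable_prod _ fun j _ => ?_) (hQ.pow_const _)
    exact ((measurable_pi_apply j).pow_const _).mul ((measurable_const.sub (measurable_pi_apply j)).pow_const _)
  refine ⟨hmeas.aestronglyMeasurable, ?_⟩
  -- finiteness of the lintegral on the open cube = the `c₀ = 0` case of the induction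
  rw [HasFiniteIntegral, volume_pi, Measure.restrict_pi_pi]
  have hfin := lintegral_weight_lt_top n a₀ 0 a b ha₀ le_rfl hE (hE 0 (by omega)).1 hA hAodd
    (fun i hi => add_pos_of_nonneg_of_pos (Finset.sum_nonneg fun m hm => by
        have := hE (2 * m + 1) (by simp at hm; omega); linarith) (hE (2 * i + 2) (by omega)).1)
    (fun hev => Finset.sum_pos (fun m hm => by have := hE (2 * m + 1) (by simp at hm; omega); linarith)
        ⟨0, by simp; obtain ⟨r, hr⟩ := hev; omega⟩)
  refine lt_of_le_of_lt (le_of_eq (lintegral_congr_ae ?_)) hfin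
  filter_upwards [ae_mem_openCube (n + 1)] with x hx
  have hxc : ∀ j, x j ∈ Icc (0 : ℝ) 1 := fun j => Ioo_subset_Icc_self (hx j)
  have hnn : 0 ≤ sorokinIntegrand (n + 1) a₀ a b x := by
    unfold sorokinIntegrand
    exact div_nonneg (Finset.prod_nonneg fun j _ => mul_nonneg (Real.rpow_nonneg (hxc j).1 _)
      (Real.rpow_nonneg (by linarith [(hxc j).2]) _)) (Real.rpow_nonneg (nestedQ_ofFn_mem_Icc hxc).1 _)
  rw [Real.enorm_eq_ofReal hnn, sorokinIntegrand_eq (n + 1) a₀ a b hxc]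

end Literature.NumberTheory.Irrationality.Zudilin2004.SorokinConvergence

end Part2

/-!
## Part 3 — port of `Summits/KontsevichZagierPeriods/Zeta5Search/SorokinLastVariable.lean` (2 declarations kept)

# Zudilin's `J_k` at complex parameters: the last integration is an Euler integral

Declarations of this Part (verbatim port; each keeps its own docstring and citation): `norm_integrand`, `measurable_integrand`.

Reference keys (see `references.bib` and the declarations' citations): [Zudilin2004].
-/

section Part3

namespace Literature.NumberTheory.Irrationality.Zudilin2004.SorokinLastVariable

open _root_.MeasureTheory _root_.Set _root_.Filter
open Literature.NumberTheory.Irrationality.Zudilin2002 (nestedQ sorokinIntegrand)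
open Literature.Analysis.SpecialFunctions.Hypergeometric (eulerIntegrand eulerIntegral)
open Literature.NumberTheory.Irrationality.Zudilin2004.SorokinIntegrandBounds
open Literature.NumberTheory.Irrationality.Zudilin2004.SorokinConvergence

/-- On the open cube the norm of the complex-parameter integrand is the typed real integrand at the real parts.
[cite: Zudilin2004, §4 (supporting lemma)] -/
theorem norm_integrand (k : ℕ) (a₀ : ℂ) (a b : ℕ → ℂ) {x : Fin k → ℝ} (hx : ∀ j, x j ∈ Ioo (0 : ℝ) 1) :
    ‖(∏ j : Fin k, ((x j : ℝ) : ℂ) ^ (a j - 1) * (1 - ((x j : ℝ) : ℂ)) ^ (b j - a j - 1)) *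
        ((nestedQ (List.ofFn x) : ℝ) : ℂ) ^ (-a₀)‖ =
      sorokinIntegrand k a₀.re (fun n => (a n).re) (fun n => (b n).re) x := by
  have hxc : ∀ j, x j ∈ Icc (0 : ℝ) 1 := fun j => Ioo_subset_Icc_self (hx j)
  have hQ : 0 ≤ nestedQ (List.ofFn x) := (nestedQ_ofFn_mem_Icc hxc).1
  rw [sorokinIntegrand, norm_mul, norm_prod, div_eq_mul_inv, ← Real.rpow_neg hQ]
  congr 1
  · refine Finset.prod_congr rfl fun j _ => ?_
    have h0 : 0 < x j := (hx j).1
    have h1 : 0 < 1 - x j := by linarith [(hx j).2]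
    rw [norm_mul, Complex.norm_cpow_eq_rpow_re_of_pos h0,
      show (1 : ℂ) - ((x j : ℝ) : ℂ) = ((1 - x j : ℝ) : ℂ) by push_cast; ring, Complex.norm_cpow_eq_rpow_re_of_pos h1]
    simp
  · rcases hQ.eq_or_lt with h | h
    · -- cannot happen on the open cube for `k ≥ 1`, and for `k = 0` the kernel is `1`; treat uniformly via the value
      rcases Nat.eq_zero_or_pos k with rfl | hk
      · simp [nestedQ] at h
      · exact absurd h.symm (nestedQ_ofFn_mem_Ioo hk hx).1.ne'
    · rw [Complex.norm_cpow_eq_rpow_re_of_pos h]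
      simp

/-- Measurability of the complex-parameter integrand. [cite: Zudilin2004, §4 (supporting lemma)] -/
theorem measurable_integrand (k : ℕ) (a₀ : ℂ) (a b : ℕ → ℂ) :
    Measurable fun x : Fin k → ℝ =>
      (∏ j : Fin k, ((x j : ℝ) : ℂ) ^ (a j - 1) * (1 - ((x j : ℝ) : ℂ)) ^ (b j - a j - 1)) *
        ((nestedQ (List.ofFn x) : ℝ) : ℂ) ^ (-a₀) := by
  have hQ := (Complex.measurable_ofReal.comp (continuous_nestedQ_ofFn k).measurable).pow_const (-a₀)
  refine Measurable.mul (Finset.measurable_prod _ fun j _ => ?_) hQ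
  have hj : Measurable fun x : Fin k → ℝ => ((x j : ℝ) : ℂ) := Complex.measurable_ofReal.comp (measurable_pi_apply j)
  exact (hj.pow_const _).mul ((measurable_const.sub hj).pow_const _)

end Literature.NumberTheory.Irrationality.Zudilin2004.SorokinLastVariable

end Part3

/-!
## Part 4 — port of `Summits/KontsevichZagierPeriods/Zeta5Search/BarnesMellinCpow.lean` (13 declarations kept)

# The Mellin–Barnes integral for `(1+w)^{-a}`, complex exponent

Declarations of this Part (verbatim port; each keeps its own docstring and citation): `one_add_ofReal`, `continuousAt_oneAdd_cpow`, `norm_oneAdd_cpow`, `mellinConvergent_oneAdd_cpow`, `subst_integrand_cpow`, `mellin_oneAdd_cpow_neg`, `rpow_le_add_rpow_max`, `norm_Gamma_mul_Gamma_cpow_le`, `continuous_Gamma_vertical_cpow`, `integrable_Gamma_vertical_cpow`, `verticalIntegrable_mellin_oneAdd_cpow`, `mellin_barnes_cpow`, `integrable_Gamma_vertical_cpow'`.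

Reference keys (see `references.bib` and the declarations' citations): [Zudilin2004].
-/

section Part4

namespace Literature.NumberTheory.Irrationality.Zudilin2004.BarnesMellinCpow

open _root_.MeasureTheory _root_.Set _root_.Filter _root_.Asymptotics
open scoped _root_.Topology _root_.Real
open Literature.NumberTheory.Irrationality.BrownZudilin2022.BarnesMellin

/-- `1 + ↑t` is the cast of the real number `1 + t`. [cite: Zudilin2004, §4 (supporting lemma)] -/
theorem one_add_ofReal (t : ℝ) : (1 : ℂ) + (t : ℂ) = ((1 + t : ℝ) : ℂ) := by push_cast; ring

/-- Continuity of `t ↦ (1+t)^{-a}` at every `t > -1` (the base stays in the slit plane).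
[cite: Zudilin2004, §4 (supporting lemma)] -/
theorem continuousAt_oneAdd_cpow (a : ℂ) {t : ℝ} (ht : -1 < t) :
    ContinuousAt (fun t : ℝ => (1 + (t : ℂ)) ^ (-a)) t := by
  have h1 : ContinuousAt (fun t : ℝ => (1 : ℂ) + (t : ℂ)) t :=
    (by fun_prop : Continuous fun t : ℝ => (1 : ℂ) + (t : ℂ)).continuousAt
  have hslit : (1 : ℂ) + (t : ℂ) ∈ Complex.slitPlane := by
    rw [one_add_ofReal]; exact Complex.ofReal_mem_slitPlane.2 (by linarith)
  exact ContinuousAt.comp (f := fun t : ℝ => (1 : ℂ) + (t : ℂ)) (g := fun z : ℂ => z ^ (-a))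
    (continuousAt_cpow_const hslit) h1

/-- Norm of `(1+t)^{-a}` for `t > -1`: `(1+t)^{-Re a}`. [cite: Zudilin2004, §4 (supporting lemma)] -/
theorem norm_oneAdd_cpow (a : ℂ) {t : ℝ} (ht : -1 < t) : ‖(1 + (t : ℂ)) ^ (-a)‖ = (1 + t) ^ (-a.re) := by
  rw [one_add_ofReal, Complex.norm_cpow_eq_rpow_re_of_pos (by linarith), Complex.neg_re]

/-- The Mellin transform of `t ↦ (1+t)^{-a}` converges on `0 < Re s < Re a`.
[cite: Zudilin2004, §4 (supporting lemma)] -/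
theorem mellinConvergent_oneAdd_cpow (a : ℂ) {s : ℂ} (hs : 0 < s.re) (hs' : s.re < a.re) :
    MellinConvergent (fun t : ℝ => (1 + (t : ℂ)) ^ (-a)) s := by
  have hcont : ContinuousOn (fun t : ℝ => (1 + (t : ℂ)) ^ (-a)) (Ioi 0) :=
    continuousOn_of_forall_continuousAt fun t ht => continuousAt_oneAdd_cpow a (by linarith [mem_Ioi.mp ht])
  refine mellinConvergent_of_isBigO_rpow (a := a.re) (b := 0)
    (hcont.locallyIntegrableOn measurableSet_Ioi) ?_ (by simpa using hs') ?_ (by simpa using hs)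
  · refine IsBigO.of_bound 1 ?_
    filter_upwards [eventually_ge_atTop (1 : ℝ)] with x hx
    have hx0 : 0 < x := by linarith
    rw [norm_oneAdd_cpow a (by linarith), one_mul, Real.norm_of_nonneg (Real.rpow_nonneg hx0.le _)]
    exact Real.rpow_le_rpow_of_nonpos hx0 (by linarith) (by linarith)
  · refine IsBigO.of_bound 1 ?_
    filter_upwards [self_mem_nhdsWithin] with x hx
    have hx0 : 0 < x := hx
    rw [norm_oneAdd_cpow a (by linarith), neg_zero, Real.rpow_zero, norm_one, mul_one]
    exact Real.rpow_le_one_of_one_le_of_nonpos (by linarith) (by linarith)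

/-- The substituted Beta integrand: for `x ∈ (0,1)`,
`|1/(1−x)²| · (x/(1−x))^{s−1} · (1 + x/(1−x))^{-a} = x^{s−1}(1−x)^{(a−s)−1}`.
[cite: Zudilin2004, §4 (supporting lemma)] -/
theorem subst_integrand_cpow {x : ℝ} (hx : x ∈ Ioo (0 : ℝ) 1) (s a : ℂ) :
    |1 / (1 - x) ^ 2| • (((x / (1 - x) : ℝ) : ℂ) ^ (s - 1) * (1 + ((x / (1 - x) : ℝ) : ℂ)) ^ (-a)) =
      (x : ℂ) ^ (s - 1) * (1 - (x : ℂ)) ^ (a - s - 1) := by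
  have hx0 : 0 < x := hx.1
  have hx1 : 0 < 1 - x := by linarith [hx.2]
  have hb : ((1 - x : ℝ) : ℂ) ≠ 0 := by exact_mod_cast hx1.ne'
  rw [cpow_ofReal_div hx0.le hx1 (s - 1)]
  have h1 : (1 : ℂ) + ((x / (1 - x) : ℝ) : ℂ) = (((1 - x : ℝ) : ℂ))⁻¹ := by
    rw [Complex.ofReal_div]
    field_simp
    push_cast; ring
  have harg : (((1 - x : ℝ) : ℂ)).arg ≠ π := by
    rw [Complex.arg_ofReal_of_nonneg hx1.le]; exact Real.pi_ne_zero.symm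
  have h2 : ((((1 - x : ℝ) : ℂ))⁻¹) ^ (-a) = ((1 - x : ℝ) : ℂ) ^ a := by
    rw [Complex.inv_cpow _ _ harg, Complex.cpow_neg, inv_inv]
  rw [h1, h2, abs_of_pos (by positivity), Complex.real_smul]
  have e1 : (((1 / (1 - x) ^ 2 : ℝ)) : ℂ) = ((1 - x : ℝ) : ℂ) ^ (-(2 : ℂ)) := by
    rw [Complex.cpow_neg, show (2 : ℂ) = ((2 : ℕ) : ℂ) by norm_num, Complex.cpow_natCast]
    push_cast; ring
  rw [e1]
  have e3 : ((1 - x : ℝ) : ℂ) ^ (-(2 : ℂ)) * ((x : ℂ) ^ (s - 1) * ((1 - x : ℝ) : ℂ) ^ (-(s - 1)) *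
      ((1 - x : ℝ) : ℂ) ^ a) =
      (x : ℂ) ^ (s - 1) * (((1 - x : ℝ) : ℂ) ^ (-(2 : ℂ)) * ((1 - x : ℝ) : ℂ) ^ (-(s - 1)) *
        ((1 - x : ℝ) : ℂ) ^ a) := by ring
  rw [e3, ← Complex.cpow_add _ _ hb, ← Complex.cpow_add _ _ hb,
    show (-(2 : ℂ) + -(s - 1) + a) = a - s - 1 by ring]
  push_cast
  rfl

/-- **The Mellin transform of `(1+t)^{-a}`** is `Γ(s)Γ(a−s)/Γ(a)` on the strip `0 < Re s < Re a` (Euler's Beta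
integral on `(0,∞)`; `(1+t)^{-a}` is Mathlib's principal-branch `cpow` of the positive real base `1+t`, `t > 0`,
i.e. `exp(−a·log(1+t))` with the real logarithm; the Mellin transform `mellin f s = ∫_{(0,∞)} t^{s−1} f(t) dt` is
Mathlib's). [cite: Zudilin2004, §4 (supporting lemma)] -/
theorem mellin_oneAdd_cpow_neg (a : ℂ) {s : ℂ} (hs : 0 < s.re) (hs' : s.re < a.re) :
    mellin (fun t : ℝ => (1 + (t : ℂ)) ^ (-a)) s =
      Complex.Gamma s * Complex.Gamma (a - s) / Complex.Gamma a := by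
  have hcv := integral_image_eq_integral_abs_deriv_smul measurableSet_Ioo
    (fun x hx => hasDerivWithinAt_div_one_sub hx) injOn_div_one_sub
    (fun t : ℝ => (t : ℂ) ^ (s - 1) • (1 + (t : ℂ)) ^ (-a))
  rw [image_div_one_sub] at hcv
  rw [mellin, hcv]
  have hpt : ∀ x ∈ Ioo (0 : ℝ) 1,
      |1 / (1 - x) ^ 2| • (((x / (1 - x) : ℝ) : ℂ) ^ (s - 1) • (1 + ((x / (1 - x) : ℝ) : ℂ)) ^ (-a)) =
        (x : ℂ) ^ (s - 1) * (1 - (x : ℂ)) ^ (a - s - 1) := by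
    intro x hx
    rw [smul_eq_mul]
    exact subst_integrand_cpow hx s a
  rw [setIntegral_congr_fun measurableSet_Ioo hpt]
  have hB : ∫ x in Ioo (0 : ℝ) 1, (x : ℂ) ^ (s - 1) * (1 - (x : ℂ)) ^ (a - s - 1) =
      Complex.betaIntegral s (a - s) := by
    rw [Complex.betaIntegral, intervalIntegral.integral_of_le zero_le_one, integral_Ioc_eq_integral_Ioo]
  rw [hB]
  have hre : 0 < (a - s).re := by simp; linarith
  have ha : 0 < a.re := hs.trans hs'
  have key := Complex.Gamma_mul_Gamma_eq_betaIntegral hs hre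
  rw [show s + (a - s) = a by ring] at key
  rw [eq_div_iff (Complex.Gamma_ne_zero_of_re_pos ha), mul_comm, key]

/-- `y^q ≤ (K+y)^{max q 0}` for `y ≥ 1`, `K ≥ 0`. [cite: Zudilin2004, §4 (supporting lemma)] -/
theorem rpow_le_add_rpow_max {y K q : ℝ} (hy : 1 ≤ y) (hK : 0 ≤ K) : y ^ q ≤ (K + y) ^ (max q 0) := by
  rcases le_or_gt q 0 with hq | hq
  · rw [max_eq_right hq, Real.rpow_zero]
    exact Real.rpow_le_one_of_one_le_of_nonpos hy hq
  · rw [max_eq_left hq.le]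
    exact Real.rpow_le_rpow (by linarith) (by linarith) hq.le

/-- **Exponential tail bound**: for every real `σ` and complex `a` there is `R` with `‖Γ(σ+iy)Γ(a−(σ+iy))‖ ≤ e^{−|y|}`
for `|y| ≥ R` (Stirling on the two vertical lines: the product decays like a power of `|y|` times `e^{−π|y|}`; far out on
the lines there are no poles, so no hypothesis on `σ` is needed). [cite: Zudilin2004, §4 (supporting lemma)] -/
theorem norm_Gamma_mul_Gamma_cpow_le (a : ℂ) (σ : ℝ) :
    ∃ R : ℝ, ∀ y : ℝ, R ≤ |y| →
      ‖Complex.Gamma ((σ : ℂ) + (y : ℂ) * Complex.I) * Complex.Gamma (a - ((σ : ℂ) + (y : ℂ) * Complex.I))‖ ≤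
        1 * Real.exp (-1 * |y|) := by
  obtain ⟨C₁, hC₁, h₁⟩ := Literature.Analysis.SpecialFunctions.GammaStirling.exists_norm_Gamma_vertical_le σ σ
  obtain ⟨C₂, hC₂, h₂⟩ := Literature.Analysis.SpecialFunctions.GammaStirling.exists_norm_Gamma_vertical_le (a.re - σ) (a.re - σ)
  set K : ℝ := 1 + |a.im| with hK
  set p : ℝ := max (σ - 1 / 2) 0 + max (a.re - σ - 1 / 2) 0 with hp
  have hK0 : 0 ≤ K := by positivity
  have hp0 : 0 ≤ p := add_nonneg (le_max_right _ _) (le_max_right _ _)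
  have hpi : 0 < π - 1 := by linarith [Real.pi_gt_three]
  set M : ℝ := C₁ * C₂ * Real.exp (π * |a.im| / 2) with hM
  have hM0 : 0 < M := by positivity
  obtain ⟨T₀, hT₀⟩ := Literature.Analysis.Complex.exists_rpow_mul_exp_neg_le hK0 hp0 hpi (ε := M⁻¹) (inv_pos.2 hM0)
  refine ⟨max T₀ (|a.im| + 2), fun y hy => ?_⟩
  have hyT : T₀ ≤ |y| := le_of_max_le_left hy
  have hy2 : |a.im| + 2 ≤ |y| := le_of_max_le_right hy
  have hy1 : 1 ≤ |y| := by linarith [abs_nonneg a.im]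
  have hu_ge : |y| - |a.im| ≤ |a.im - y| := by
    have := abs_sub_abs_le_abs_sub y a.im
    rw [abs_sub_comm] at this
    linarith [le_abs_self (|y| - |a.im|)]
  have hu1 : 1 ≤ |a.im - y| := by linarith
  have hu_le : |a.im - y| ≤ K + |y| := by
    calc |a.im - y| ≤ |a.im| + |y| := abs_sub _ _
      _ ≤ K + |y| := by rw [hK]; linarith
  -- the two Stirling bounds
  have g1 := h₁ σ (by simp) y hy1
  have g2 := h₂ (a.re - σ) (by simp) (a.im - y) hu1
  have ha_split : a - ((σ : ℂ) + (y : ℂ) * Complex.I) = ((a.re - σ : ℝ) : ℂ) + ((a.im - y : ℝ) : ℂ) * Complex.I := by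
    apply Complex.ext <;> simp
  rw [norm_mul, ha_split]
  -- polynomial factors
  have q1 : |y| ^ (σ - 1 / 2) ≤ (K + |y|) ^ (max (σ - 1 / 2) 0) := rpow_le_add_rpow_max hy1 hK0
  have q2 : |a.im - y| ^ (a.re - σ - 1 / 2) ≤ (K + |y|) ^ (max (a.re - σ - 1 / 2) 0) := by
    rcases le_or_gt (a.re - σ - 1 / 2) 0 with hq | hq
    · rw [max_eq_right hq, Real.rpow_zero]
      exact Real.rpow_le_one_of_one_le_of_nonpos hu1 hq
    · rw [max_eq_left hq.le]
      exact Real.rpow_le_rpow (abs_nonneg _) hu_le hq.le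
  -- exponential factors
  have x2 : Real.exp (-(π * |a.im - y|) / 2) ≤ Real.exp (π * |a.im| / 2) * Real.exp (-(π * |y|) / 2) := by
    rw [← Real.exp_add]
    apply Real.exp_le_exp.2
    nlinarith [Real.pi_pos, hu_ge]
  have hKy : 0 < K + |y| := by linarith
  have prod_rpow : (K + |y|) ^ (max (σ - 1 / 2) 0) * (K + |y|) ^ (max (a.re - σ - 1 / 2) 0) = (K + |y|) ^ p := by
    rw [hp, Real.rpow_add hKy]
  have hexp : Real.exp (-(π * |y|) / 2) * Real.exp (-(π * |y|) / 2) =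
      Real.exp (-((π - 1) * |y|)) * Real.exp (-1 * |y|) := by
    rw [← Real.exp_add, ← Real.exp_add]; ring_nf
  have hTail := hT₀ y hyT
  calc ‖Complex.Gamma ((σ : ℂ) + (y : ℂ) * Complex.I)‖ *
        ‖Complex.Gamma (((a.re - σ : ℝ) : ℂ) + ((a.im - y : ℝ) : ℂ) * Complex.I)‖
      ≤ (C₁ * |y| ^ (σ - 1 / 2) * Real.exp (-(π * |y|) / 2)) *
          (C₂ * |a.im - y| ^ (a.re - σ - 1 / 2) * Real.exp (-(π * |a.im - y|) / 2)) :=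
        mul_le_mul g1 g2 (norm_nonneg _) (by positivity)
    _ ≤ (C₁ * (K + |y|) ^ (max (σ - 1 / 2) 0) * Real.exp (-(π * |y|) / 2)) *
          (C₂ * (K + |y|) ^ (max (a.re - σ - 1 / 2) 0) * (Real.exp (π * |a.im| / 2) * Real.exp (-(π * |y|) / 2))) := by
        gcongr
    _ = M * ((K + |y|) ^ p * Real.exp (-((π - 1) * |y|))) * Real.exp (-1 * |y|) := by
        rw [hM, ← prod_rpow]
        have := hexp
        calc C₁ * (K + |y|) ^ max (σ - 1 / 2) 0 * Real.exp (-(π * |y|) / 2) *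
              (C₂ * (K + |y|) ^ max (a.re - σ - 1 / 2) 0 * (Real.exp (π * |a.im| / 2) * Real.exp (-(π * |y|) / 2)))
            = C₁ * C₂ * Real.exp (π * |a.im| / 2) * ((K + |y|) ^ max (σ - 1 / 2) 0 *
                (K + |y|) ^ max (a.re - σ - 1 / 2) 0) * (Real.exp (-(π * |y|) / 2) * Real.exp (-(π * |y|) / 2)) := by
              ring
          _ = _ := by rw [this]; ring
    _ ≤ 1 * Real.exp (-1 * |y|) := by
        have hX : M * ((K + |y|) ^ p * Real.exp (-((π - 1) * |y|))) ≤ 1 := by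
          calc M * ((K + |y|) ^ p * Real.exp (-((π - 1) * |y|))) ≤ M * M⁻¹ :=
                mul_le_mul_of_nonneg_left hTail hM0.le
            _ = 1 := mul_inv_cancel₀ hM0.ne'
        exact mul_le_mul_of_nonneg_right hX (Real.exp_pos _).le

/-- Continuity of `y ↦ Γ(σ+iy)Γ(a−(σ+iy))` for `0 < σ < Re a` (no poles on either line).
[cite: Zudilin2004, §4 (supporting lemma)] -/
theorem continuous_Gamma_vertical_cpow (a : ℂ) {σ : ℝ} (hσ : 0 < σ) (hσ' : σ < a.re) :
    Continuous fun y : ℝ =>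
      Complex.Gamma ((σ : ℂ) + (y : ℂ) * Complex.I) * Complex.Gamma (a - ((σ : ℂ) + (y : ℂ) * Complex.I)) := by
  have hc1 : Continuous fun y : ℝ => (σ : ℂ) + (y : ℂ) * Complex.I := by fun_prop
  have hc2 : Continuous fun y : ℝ => a - ((σ : ℂ) + (y : ℂ) * Complex.I) := by fun_prop
  refine Continuous.mul ?_ ?_
  · refine continuous_iff_continuousAt.mpr fun y => (Complex.continuousAt_Gamma _ ?_).comp hc1.continuousAt
    exact ne_neg_nat_of_re_pos (by simp [hσ])
  · refine continuous_iff_continuousAt.mpr fun y => (Complex.continuousAt_Gamma _ ?_).comp hc2.continuousAt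
    exact ne_neg_nat_of_re_pos (by simp; linarith)

/-- **Vertical integrability** of `y ↦ Γ(σ+iy)Γ(a−(σ+iy))` for `0 < σ < Re a`.
[cite: Zudilin2004, §4 (supporting lemma)] -/
theorem integrable_Gamma_vertical_cpow (a : ℂ) {σ : ℝ} (hσ : 0 < σ) (hσ' : σ < a.re) :
    Integrable fun y : ℝ =>
      Complex.Gamma ((σ : ℂ) + (y : ℂ) * Complex.I) * Complex.Gamma (a - ((σ : ℂ) + (y : ℂ) * Complex.I)) := by
  obtain ⟨R, hR⟩ := norm_Gamma_mul_Gamma_cpow_le a σ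
  exact integrable_of_norm_le_exp (continuous_Gamma_vertical_cpow a hσ hσ') one_pos (R := R) hR

/-- Vertical integrability of the Mellin transform of `(1+t)^{-a}` on `Re s = σ ∈ (0, Re a)`.
[cite: Zudilin2004, §4 (supporting lemma)] -/
theorem verticalIntegrable_mellin_oneAdd_cpow (a : ℂ) {σ : ℝ} (hσ : 0 < σ) (hσ' : σ < a.re) :
    Complex.VerticalIntegrable (mellin fun t : ℝ => (1 + (t : ℂ)) ^ (-a)) σ := by
  unfold Complex.VerticalIntegrable
  have heq : (fun y : ℝ => mellin (fun t : ℝ => (1 + (t : ℂ)) ^ (-a)) ((σ : ℂ) + (y : ℂ) * Complex.I)) =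
      fun y : ℝ => Complex.Gamma ((σ : ℂ) + (y : ℂ) * Complex.I) *
        Complex.Gamma (a - ((σ : ℂ) + (y : ℂ) * Complex.I)) / Complex.Gamma a := by
    funext y
    exact mellin_oneAdd_cpow_neg a (by simpa using hσ) (by simpa using hσ')
  rw [heq]
  exact (integrable_Gamma_vertical_cpow a hσ hσ').div_const _

/-- **Mellin–Barnes integral for `(1+w)^{-a}`, complex exponent** [BrownZudilin2022, Sect. 5, "Barnes integral
representation"; Nesterenko 2003, Sect. 3.2, the `₁F₀` case of Lemma 2 of Zudilin math/0206177]: for real `w > 0`,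
`a : ℂ` and `0 < σ < Re a`,
`(1+w)^{-a} = (1/2π) ∫_ℝ w^{s} Γ(a+s)Γ(−s)/Γ(a) dy` with `s = −σ+iy` (the line `Re s = −σ` separates the poles of `Γ(−s)` from
those of `Γ(a+s)`; both `(1+w)^{−a}` and `w^{s}` are principal-branch `cpow`s of positive real bases; the integral is the
Bochner integral over `ℝ`, absolutely convergent by `integrable_Gamma_vertical_cpow'`).
[cite: Zudilin2004, §4 (supporting lemma)] -/
theorem mellin_barnes_cpow (a : ℂ) {w σ : ℝ} (hw : 0 < w) (hσ : 0 < σ) (hσ' : σ < a.re) :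
    (1 + (w : ℂ)) ^ (-a) =
      (1 / (2 * π) : ℂ) * ∫ y : ℝ, (w : ℂ) ^ (-(σ : ℂ) + (y : ℂ) * Complex.I) *
        (Complex.Gamma (a + (-(σ : ℂ) + (y : ℂ) * Complex.I)) *
          Complex.Gamma (-(-(σ : ℂ) + (y : ℂ) * Complex.I)) / Complex.Gamma a) := by
  set f : ℝ → ℂ := fun t => (1 + (t : ℂ)) ^ (-a) with hf
  have hinv := mellinInv_mellin_eq σ f hw (mellinConvergent_oneAdd_cpow a (by simpa using hσ) (by simpa using hσ'))
    (verticalIntegrable_mellin_oneAdd_cpow a hσ hσ') (continuousAt_oneAdd_cpow a (by linarith))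
  rw [show (1 + (w : ℂ)) ^ (-a) = f w from rfl, ← hinv, mellinInv, Complex.real_smul]
  push_cast
  congr 1
  set B : ℝ → ℂ := fun y => (w : ℂ) ^ (-(σ : ℂ) + (y : ℂ) * Complex.I) *
        (Complex.Gamma (a + (-(σ : ℂ) + (y : ℂ) * Complex.I)) *
          Complex.Gamma (-(-(σ : ℂ) + (y : ℂ) * Complex.I)) / Complex.Gamma a) with hB
  have hA : ∀ y : ℝ, (w : ℂ) ^ (-((σ : ℂ) + (y : ℂ) * Complex.I)) • mellin f ((σ : ℂ) + (y : ℂ) * Complex.I) = B (-y) := by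
    intro y
    rw [mellin_oneAdd_cpow_neg a (by simpa using hσ) (by simpa using hσ'), smul_eq_mul, hB]
    simp only [Complex.ofReal_neg]
    rw [show -(σ : ℂ) + -(y : ℂ) * Complex.I = -((σ : ℂ) + (y : ℂ) * Complex.I) by ring,
      show a + -((σ : ℂ) + (y : ℂ) * Complex.I) = a - ((σ : ℂ) + (y : ℂ) * Complex.I) by ring, neg_neg]
    ring
  calc ∫ y : ℝ, (w : ℂ) ^ (-((σ : ℂ) + (y : ℂ) * Complex.I)) • mellin f ((σ : ℂ) + (y : ℂ) * Complex.I)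
      = ∫ y : ℝ, B (-y) := by congr 1; funext y; exact hA y
    _ = ∫ y : ℝ, B y := integral_neg_eq_self B volume

/-- The weight `Γ(a+s)Γ(−s)`, `s = −σ+iy`, is integrable in `y` (for the Fubini steps of Nesterenko's Lemmas 2–3).
[cite: Zudilin2004, §4 (supporting lemma)] -/
theorem integrable_Gamma_vertical_cpow' (a : ℂ) {σ : ℝ} (hσ : 0 < σ) (hσ' : σ < a.re) :
    Integrable fun y : ℝ => Complex.Gamma (a + (-(σ : ℂ) + (y : ℂ) * Complex.I)) *
      Complex.Gamma (-(-(σ : ℂ) + (y : ℂ) * Complex.I)) := by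
  have h := (integrable_Gamma_vertical_cpow a hσ hσ').comp_neg
  refine h.congr (Eventually.of_forall fun y => ?_)
  simp only [Complex.ofReal_neg]
  rw [show a + (-(σ : ℂ) + (y : ℂ) * Complex.I) = a - ((σ : ℂ) + -(y : ℂ) * Complex.I) by ring,
    show -(-(σ : ℂ) + (y : ℂ) * Complex.I) = (σ : ℂ) + -(y : ℂ) * Complex.I by ring, mul_comm]

end Literature.NumberTheory.Irrationality.Zudilin2004.BarnesMellinCpow

end Part4

/-!
## Part 5 — port of `Summits/KontsevichZagierPeriods/Zeta5Search/BarnesEulerIntegral.lean` (6 declarations kept)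

# Nesterenko's Barnes integral for Euler's `₂F₁` integral, real argument `z < 0`

Declarations of this Part (verbatim port; each keeps its own docstring and citation): `integrand_eq_integral`, `continuous_weight`, `norm_integrand`, `integrable_joint`, `inner_integral`, `eulerIntegral_neg_eq_barnes`.

Reference keys (see `references.bib` and the declarations' citations): [Zudilin2004].
-/

section Part5

namespace Literature.NumberTheory.Irrationality.Zudilin2004.BarnesEulerIntegral

open _root_.MeasureTheory _root_.Set _root_.Filter
open scoped _root_.Real
open Literature.NumberTheory.Irrationality.Zudilin2004.BarnesMellinCpow
open Literature.NumberTheory.Irrationality.BrownZudilin2022.BarnesCube (integral_beta_Ioo integrableOn_beta_Ioo)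
open Literature.Analysis.SpecialFunctions.Hypergeometric (eulerIntegrand eulerIntegral)

variable {ζ t₀ : ℝ} {a₀ a b : ℂ}

/-- The joint integrand on `(0,1) × ℝ` after opening `(1+ζt)^{−a₀}` by the Mellin–Barnes integral:
`F(t,y) = t^{a−1}(1−t)^{b−a−1} · (ζt)^{s} Γ(a₀+s)Γ(−s)/Γ(a₀)`, `s = −t₀+iy` (an abbreviation inside statements only).
[cite: Zudilin2004, §4 (supporting lemma)] -/
theorem integrand_eq_integral (hζ : 0 < ζ) (ht₀ : 0 < t₀) (ht₀' : t₀ < a₀.re) (a b : ℂ) {t : ℝ} (ht : t ∈ Ioo (0 : ℝ) 1) :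
    eulerIntegrand a₀ a b (-(ζ : ℂ)) t =
      (1 / (2 * π) : ℂ) * ∫ y : ℝ, (t : ℂ) ^ (a - 1) * (1 - (t : ℂ)) ^ (b - a - 1) *
        ((((ζ * t : ℝ)) : ℂ) ^ (-(t₀ : ℂ) + (y : ℂ) * Complex.I) *
          (Complex.Gamma (a₀ + (-(t₀ : ℂ) + (y : ℂ) * Complex.I)) *
            Complex.Gamma (-(-(t₀ : ℂ) + (y : ℂ) * Complex.I)) / Complex.Gamma a₀)) := by
  have hw : 0 < ζ * t := mul_pos hζ ht.1
  unfold eulerIntegrand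
  rw [show (1 : ℂ) - -(ζ : ℂ) * (t : ℂ) = 1 + (((ζ * t : ℝ)) : ℂ) by push_cast; ring,
    mellin_barnes_cpow a₀ hw ht₀ ht₀', mul_left_comm, ← integral_const_mul]

/-- The Mellin–Barnes weight `y ↦ Γ(a₀+s)Γ(−s)/Γ(a₀)`, `s = −t₀+iy`, is continuous for `0 < t₀ < Re a₀`
(neither Gamma factor meets a pole on the line). [cite: Zudilin2004, §4 (supporting lemma)] -/
theorem continuous_weight (ht₀ : 0 < t₀) (ht₀' : t₀ < a₀.re) :
    Continuous fun y : ℝ => Complex.Gamma (a₀ + (-(t₀ : ℂ) + (y : ℂ) * Complex.I)) *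
      Complex.Gamma (-(-(t₀ : ℂ) + (y : ℂ) * Complex.I)) / Complex.Gamma a₀ := by
  have hc1 : Continuous fun y : ℝ => a₀ + (-(t₀ : ℂ) + (y : ℂ) * Complex.I) := by fun_prop
  have hc2 : Continuous fun y : ℝ => -(-(t₀ : ℂ) + (y : ℂ) * Complex.I) := by fun_prop
  refine (Continuous.mul ?_ ?_).div_const _
  · refine continuous_iff_continuousAt.mpr fun y => (Complex.continuousAt_Gamma _ ?_).comp hc1.continuousAt
    exact Literature.NumberTheory.Irrationality.BrownZudilin2022.BarnesMellin.ne_neg_nat_of_re_pos (by simp; linarith)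
  · refine continuous_iff_continuousAt.mpr fun y => (Complex.continuousAt_Gamma _ ?_).comp hc2.continuousAt
    exact Literature.NumberTheory.Irrationality.BrownZudilin2022.BarnesMellin.ne_neg_nat_of_re_pos (by simp [ht₀])

/-- Norm of the joint integrand on the open square: for `t ∈ (0,1)`,
`‖F(t,y)‖ = (t^{Re a−t₀−1}(1−t)^{Re(b−a)−1} · ζ^{−t₀}) · ‖Γ(a₀+s)Γ(−s)/Γ(a₀)‖`.
[cite: Zudilin2004, §4 (supporting lemma)] -/
theorem norm_integrand (hζ : 0 < ζ) (a₀ a b : ℂ) (t₀ : ℝ) {t : ℝ} (ht : t ∈ Ioo (0 : ℝ) 1) (y : ℝ) :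
    ‖(t : ℂ) ^ (a - 1) * (1 - (t : ℂ)) ^ (b - a - 1) *
        ((((ζ * t : ℝ)) : ℂ) ^ (-(t₀ : ℂ) + (y : ℂ) * Complex.I) *
          (Complex.Gamma (a₀ + (-(t₀ : ℂ) + (y : ℂ) * Complex.I)) *
            Complex.Gamma (-(-(t₀ : ℂ) + (y : ℂ) * Complex.I)) / Complex.Gamma a₀))‖ =
      (‖(t : ℂ) ^ ((a - t₀) - 1) * (1 - (t : ℂ)) ^ ((b - a) - 1)‖ * ζ ^ (-t₀)) *
        ‖Complex.Gamma (a₀ + (-(t₀ : ℂ) + (y : ℂ) * Complex.I)) *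
            Complex.Gamma (-(-(t₀ : ℂ) + (y : ℂ) * Complex.I)) / Complex.Gamma a₀‖ := by
  have ht0 : 0 < t := ht.1
  have ht1 : 0 < 1 - t := by linarith [ht.2]
  have hw : 0 < ζ * t := mul_pos hζ ht0
  have e1 : ‖(t : ℂ) ^ (a - 1)‖ = t ^ (a.re - 1) := by
    rw [Complex.norm_cpow_eq_rpow_re_of_pos ht0]; simp
  have e2 : ‖(1 - (t : ℂ)) ^ (b - a - 1)‖ = (1 - t) ^ (b.re - a.re - 1) := by
    rw [show (1 : ℂ) - (t : ℂ) = ((1 - t : ℝ) : ℂ) by push_cast; ring, Complex.norm_cpow_eq_rpow_re_of_pos ht1]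
    simp
  have e3 : ‖(((ζ * t : ℝ)) : ℂ) ^ (-(t₀ : ℂ) + (y : ℂ) * Complex.I)‖ = ζ ^ (-t₀) * t ^ (-t₀) := by
    rw [Complex.norm_cpow_eq_rpow_re_of_pos hw]
    simp [Real.mul_rpow hζ.le ht0.le]
  have e4 : ‖(t : ℂ) ^ ((a - t₀) - 1)‖ = t ^ (a.re - t₀ - 1) := by
    rw [Complex.norm_cpow_eq_rpow_re_of_pos ht0]; simp
  have e6 : t ^ (a.re - 1) * t ^ (-t₀) = t ^ (a.re - t₀ - 1) := by
    rw [← Real.rpow_add ht0]; ring_nf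
  rw [norm_mul, norm_mul, norm_mul, norm_mul, e1, e2, e3, e4, ← e6]
  ring

/-- **Fubini input**: the joint integrand is integrable on `(0,1) × ℝ` (its norm is the Beta integrand
`t^{Re a−t₀−1}(1−t)^{Re(b−a)−1}` times `ζ^{−t₀}` times the integrable weight `‖Γ(a₀+s)Γ(−s)/Γ(a₀)‖`).
[cite: Zudilin2004, §4 (supporting lemma)] -/
theorem integrable_joint (hζ : 0 < ζ) (ht₀ : 0 < t₀) (ht₀' : t₀ < a₀.re) (hta : t₀ < a.re) (hab : a.re < b.re) :
    Integrable (Function.uncurry fun (t : ℝ) (y : ℝ) => (t : ℂ) ^ (a - 1) * (1 - (t : ℂ)) ^ (b - a - 1) *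
        ((((ζ * t : ℝ)) : ℂ) ^ (-(t₀ : ℂ) + (y : ℂ) * Complex.I) *
          (Complex.Gamma (a₀ + (-(t₀ : ℂ) + (y : ℂ) * Complex.I)) *
            Complex.Gamma (-(-(t₀ : ℂ) + (y : ℂ) * Complex.I)) / Complex.Gamma a₀)))
      (((volume : Measure ℝ).restrict (Ioo 0 1)).prod (volume : Measure ℝ)) := by
  -- (a) measurability
  have hGm : Measurable fun y : ℝ => Complex.Gamma (a₀ + (-(t₀ : ℂ) + (y : ℂ) * Complex.I)) *
      Complex.Gamma (-(-(t₀ : ℂ) + (y : ℂ) * Complex.I)) / Complex.Gamma a₀ := (continuous_weight ht₀ ht₀').measurable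
  have h1m : Measurable fun t : ℝ => (t : ℂ) ^ (a - 1) * (1 - (t : ℂ)) ^ (b - a - 1) := by fun_prop
  have hwm : Measurable fun t : ℝ => (((ζ * t : ℝ)) : ℂ) := by fun_prop
  have hsm : Measurable fun z : ℝ × ℝ => -(t₀ : ℂ) + (z.2 : ℂ) * Complex.I := by fun_prop
  have hmeas : Measurable (Function.uncurry fun (t : ℝ) (y : ℝ) => (t : ℂ) ^ (a - 1) * (1 - (t : ℂ)) ^ (b - a - 1) *
        ((((ζ * t : ℝ)) : ℂ) ^ (-(t₀ : ℂ) + (y : ℂ) * Complex.I) *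
          (Complex.Gamma (a₀ + (-(t₀ : ℂ) + (y : ℂ) * Complex.I)) *
            Complex.Gamma (-(-(t₀ : ℂ) + (y : ℂ) * Complex.I)) / Complex.Gamma a₀))) :=
    (h1m.comp measurable_fst).mul (((hwm.comp measurable_fst).pow hsm).mul (hGm.comp measurable_snd))
  -- (b) domination by a product of integrable functions
  have hΦ : Integrable (fun t : ℝ => ‖(t : ℂ) ^ ((a - t₀) - 1) * (1 - (t : ℂ)) ^ ((b - a) - 1)‖ * ζ ^ (-t₀))
      ((volume : Measure ℝ).restrict (Ioo 0 1)) :=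
    ((integrableOn_beta_Ioo (u := a - t₀) (v := b - a) (by simp; linarith) (by simp; linarith)).norm.mul_const _)
  have hΨ : Integrable (fun y : ℝ => ‖Complex.Gamma (a₀ + (-(t₀ : ℂ) + (y : ℂ) * Complex.I)) *
      Complex.Gamma (-(-(t₀ : ℂ) + (y : ℂ) * Complex.I)) / Complex.Gamma a₀‖) :=
    ((integrable_Gamma_vertical_cpow' a₀ ht₀ ht₀').div_const _).norm
  refine Integrable.mono' (hΦ.mul_prod hΨ) hmeas.aestronglyMeasurable ?_
  have hμ : (((volume : Measure ℝ).restrict (Ioo 0 1)).prod (volume : Measure ℝ)) =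
      ((volume : Measure ℝ).prod (volume : Measure ℝ)).restrict (Ioo 0 1 ×ˢ univ) := by
    rw [← Measure.prod_restrict, Measure.restrict_univ]
  rw [hμ]
  refine ae_restrict_of_forall_mem (measurableSet_Ioo.prod MeasurableSet.univ) ?_
  rintro ⟨t, y⟩ ⟨ht, -⟩
  simp only [Function.uncurry_apply_pair]
  exact (norm_integrand hζ a₀ a b t₀ ht y).le

/-- **The inner `t`-integral** for fixed `y`: with `s = −t₀+iy`,
`∫₀¹ F(t,y) dt = ζ^{s} · Γ(a+s)Γ(b−a)/Γ(b+s) · Γ(a₀+s)Γ(−s)/Γ(a₀)` (the Beta integral `B(a+s, b−a)`).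
[cite: Zudilin2004, §4 (supporting lemma)] -/
theorem inner_integral (hζ : 0 < ζ) (hta : t₀ < a.re) (hab : a.re < b.re) (a₀ : ℂ) (y : ℝ) :
    ∫ t in Ioo (0 : ℝ) 1, (t : ℂ) ^ (a - 1) * (1 - (t : ℂ)) ^ (b - a - 1) *
        ((((ζ * t : ℝ)) : ℂ) ^ (-(t₀ : ℂ) + (y : ℂ) * Complex.I) *
          (Complex.Gamma (a₀ + (-(t₀ : ℂ) + (y : ℂ) * Complex.I)) *
            Complex.Gamma (-(-(t₀ : ℂ) + (y : ℂ) * Complex.I)) / Complex.Gamma a₀)) =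
      (ζ : ℂ) ^ (-(t₀ : ℂ) + (y : ℂ) * Complex.I) *
        (Complex.Gamma (a + (-(t₀ : ℂ) + (y : ℂ) * Complex.I)) * Complex.Gamma (b - a) /
          Complex.Gamma (b + (-(t₀ : ℂ) + (y : ℂ) * Complex.I))) *
        (Complex.Gamma (a₀ + (-(t₀ : ℂ) + (y : ℂ) * Complex.I)) *
          Complex.Gamma (-(-(t₀ : ℂ) + (y : ℂ) * Complex.I)) / Complex.Gamma a₀) := by
  set s : ℂ := -(t₀ : ℂ) + (y : ℂ) * Complex.I with hs
  have hpt : ∀ t ∈ Ioo (0 : ℝ) 1, (t : ℂ) ^ (a - 1) * (1 - (t : ℂ)) ^ (b - a - 1) *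
        ((((ζ * t : ℝ)) : ℂ) ^ s * (Complex.Gamma (a₀ + s) * Complex.Gamma (-s) / Complex.Gamma a₀)) =
      ((t : ℂ) ^ ((a + s) - 1) * (1 - (t : ℂ)) ^ ((b - a) - 1)) *
        ((ζ : ℂ) ^ s * (Complex.Gamma (a₀ + s) * Complex.Gamma (-s) / Complex.Gamma a₀)) := by
    intro t ht
    have ht0 : 0 < t := ht.1
    have htc : (t : ℂ) ≠ 0 := by exact_mod_cast ht0.ne'
    rw [Complex.ofReal_mul, Complex.mul_cpow_ofReal_nonneg hζ.le ht0.le,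
      show (a + s) - 1 = (a - 1) + s by ring, Complex.cpow_add (a - 1) s htc]
    ring
  rw [setIntegral_congr_fun measurableSet_Ioo hpt, integral_mul_const,
    integral_beta_Ioo (u := a + s) (v := b - a) (by simp [hs]; linarith) (by simp; linarith),
    show a + s + (b - a) = b + s by ring]
  ring

/-- **Nesterenko's Lemma 2 for a negative real argument** [Zudilin, math/0206177, Lemma 2; Nesterenko 2003, §3.2]:
for real `ζ > 0`, complex `a₀, a, b` and a real `t₀` with `0 < t₀ < Re a₀`, `t₀ < Re a`, `Re a < Re b`,
`eulerIntegral a₀ a b (−ζ) = ∫₀¹ t^{a−1}(1−t)^{b−a−1}(1+ζt)^{−a₀} dt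
  = Γ(b−a)/Γ(a₀) · (1/2π) ∫_ℝ Γ(a₀+s)Γ(a+s)Γ(−s)/Γ(b+s) · ζ^{s} dy`, `s = −t₀+iy`
(principal-branch complex powers of the positive reals `t`, `1−t`, `1+ζt`, `ζ`; Bochner integral over `ℝ`).
[cite: Zudilin2004, §4 (supporting lemma)] -/
theorem eulerIntegral_neg_eq_barnes (hζ : 0 < ζ) (ht₀ : 0 < t₀) (ht₀' : t₀ < a₀.re) (hta : t₀ < a.re)
    (hab : a.re < b.re) :
    eulerIntegral a₀ a b (-(ζ : ℂ)) =
      Complex.Gamma (b - a) / Complex.Gamma a₀ *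
        ((1 / (2 * π) : ℂ) * ∫ y : ℝ,
          Complex.Gamma (a₀ + (-(t₀ : ℂ) + (y : ℂ) * Complex.I)) * Complex.Gamma (a + (-(t₀ : ℂ) + (y : ℂ) * Complex.I)) *
              Complex.Gamma (-(-(t₀ : ℂ) + (y : ℂ) * Complex.I)) /
              Complex.Gamma (b + (-(t₀ : ℂ) + (y : ℂ) * Complex.I)) *
            (ζ : ℂ) ^ (-(t₀ : ℂ) + (y : ℂ) * Complex.I)) := by
  unfold eulerIntegral
  rw [intervalIntegral.integral_of_le zero_le_one, integral_Ioc_eq_integral_Ioo,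
    setIntegral_congr_fun measurableSet_Ioo (fun t ht => integrand_eq_integral hζ ht₀ ht₀' a b ht),
    integral_const_mul, integral_integral_swap (integrable_joint hζ ht₀ ht₀' hta hab)]
  have hin : ∀ y : ℝ, ∫ t in Ioo (0 : ℝ) 1, (t : ℂ) ^ (a - 1) * (1 - (t : ℂ)) ^ (b - a - 1) *
        ((((ζ * t : ℝ)) : ℂ) ^ (-(t₀ : ℂ) + (y : ℂ) * Complex.I) *
          (Complex.Gamma (a₀ + (-(t₀ : ℂ) + (y : ℂ) * Complex.I)) *
            Complex.Gamma (-(-(t₀ : ℂ) + (y : ℂ) * Complex.I)) / Complex.Gamma a₀)) =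
      Complex.Gamma (b - a) / Complex.Gamma a₀ *
        (Complex.Gamma (a₀ + (-(t₀ : ℂ) + (y : ℂ) * Complex.I)) * Complex.Gamma (a + (-(t₀ : ℂ) + (y : ℂ) * Complex.I)) *
            Complex.Gamma (-(-(t₀ : ℂ) + (y : ℂ) * Complex.I)) /
            Complex.Gamma (b + (-(t₀ : ℂ) + (y : ℂ) * Complex.I)) *
          (ζ : ℂ) ^ (-(t₀ : ℂ) + (y : ℂ) * Complex.I)) := by
    intro y
    rw [inner_integral hζ hta hab a₀ y]
    ring
  rw [show (∫ y : ℝ, ∫ t in Ioo (0 : ℝ) 1, (t : ℂ) ^ (a - 1) * (1 - (t : ℂ)) ^ (b - a - 1) *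
        ((((ζ * t : ℝ)) : ℂ) ^ (-(t₀ : ℂ) + (y : ℂ) * Complex.I) *
          (Complex.Gamma (a₀ + (-(t₀ : ℂ) + (y : ℂ) * Complex.I)) *
            Complex.Gamma (-(-(t₀ : ℂ) + (y : ℂ) * Complex.I)) / Complex.Gamma a₀))) =
      ∫ y : ℝ, Complex.Gamma (b - a) / Complex.Gamma a₀ *
        (Complex.Gamma (a₀ + (-(t₀ : ℂ) + (y : ℂ) * Complex.I)) * Complex.Gamma (a + (-(t₀ : ℂ) + (y : ℂ) * Complex.I)) *
            Complex.Gamma (-(-(t₀ : ℂ) + (y : ℂ) * Complex.I)) /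
            Complex.Gamma (b + (-(t₀ : ℂ) + (y : ℂ) * Complex.I)) *
          (ζ : ℂ) ^ (-(t₀ : ℂ) + (y : ℂ) * Complex.I)) from integral_congr_ae (Eventually.of_forall hin),
    integral_const_mul]
  ring

end Literature.NumberTheory.Irrationality.Zudilin2004.BarnesEulerIntegral

end Part5

/-!
## Part 6 — port of `Summits/KontsevichZagierPeriods/Zeta5Search/BarnesKernelBounds.lean` (9 declarations kept)

# Decay of the Barnes kernel `Γ(a₀+s)Γ(a+s)Γ(−s)/Γ(b+s)` on a vertical line

Declarations of this Part (verbatim port; each keeps its own docstring and citation): `abs_add_rpow_le`, `add_line_eq`, `norm_Gamma_shift_le`, `norm_Gamma_shift_inv_le`, `norm_Gamma_neg_line_le`, `norm_kernel_le`, `continuous_kernel`, `integrable_kernel_mul_exp`, `integrable_norm_kernel_mul_exp_pi`.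

Reference keys (see `references.bib` and the declarations' citations): [Zudilin2004].
-/

section Part6

namespace Literature.NumberTheory.Irrationality.Zudilin2004.BarnesKernelBounds

open _root_.MeasureTheory _root_.Set _root_.Filter
open scoped _root_.Real
open Literature.Analysis.SpecialFunctions.GammaStirling (exists_norm_Gamma_vertical_le exists_norm_Gamma_vertical_ge)
open Literature.NumberTheory.Irrationality.BrownZudilin2022.BarnesMellin (ne_neg_nat_of_re_pos integrable_of_norm_le_exp)

variable {t₀ : ℝ} {a₀ a b : ℂ}

/-! ### 1. Shifted Stirling bounds on the line `s = −t₀ + iy` -/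

/-- Elementary: for `|y| ≥ 2|β| + 2` the shifted ordinate satisfies `1 ≤ |β + y|` and
`|β + y|^q ≤ 2^{|q|} |y|^q` for every real exponent `q` (both signs). [cite: Zudilin2004, §4 (supporting lemma)] -/
theorem abs_add_rpow_le (β q : ℝ) {y : ℝ} (hy : 2 * |β| + 2 ≤ |y|) :
    1 ≤ |β + y| ∧ |β + y| ^ q ≤ (2 : ℝ) ^ |q| * |y| ^ q := by
  have hβ := abs_nonneg β
  have h1 : |y| - |β| ≤ |β + y| := by
    have h := abs_sub (β + y) β
    rw [add_sub_cancel_left] at h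
    linarith
  have h2 : |β + y| ≤ |β| + |y| := abs_add_le β y
  have hlow : |y| / 2 ≤ |β + y| := by linarith
  have hup : |β + y| ≤ 2 * |y| := by linarith
  have hy0 : 0 < |y| := by linarith
  refine ⟨by linarith, ?_⟩
  rcases le_or_gt 0 q with hq | hq
  · rw [abs_of_nonneg hq]
    calc |β + y| ^ q ≤ (2 * |y|) ^ q := Real.rpow_le_rpow (abs_nonneg _) hup hq
      _ = (2 : ℝ) ^ q * |y| ^ q := Real.mul_rpow (by norm_num) (abs_nonneg y)
  · rw [abs_of_neg hq]
    calc |β + y| ^ q ≤ (|y| / 2) ^ q := Real.rpow_le_rpow_of_nonpos (by positivity) hlow hq.le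
      _ = |y| ^ q / (2 : ℝ) ^ q := Real.div_rpow (abs_nonneg y) (by norm_num) q
      _ = (2 : ℝ) ^ (-q) * |y| ^ q := by
          rw [Real.rpow_neg (by norm_num : (0 : ℝ) ≤ 2), div_eq_mul_inv, mul_comm]

/-- The point `c + s`, `s = −t₀ + iy`, in the form `x + iu` with real `x = Re c − t₀`, `u = Im c + y`.
[cite: Zudilin2004, §4 (supporting lemma)] -/
theorem add_line_eq (c : ℂ) (t₀ y : ℝ) :
    c + (-(t₀ : ℂ) + (y : ℂ) * Complex.I) = ((c.re - t₀ : ℝ) : ℂ) + ((c.im + y : ℝ) : ℂ) * Complex.I := by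
  apply Complex.ext <;> simp [sub_eq_add_neg]

/-- **Shifted upper Stirling bound**: for every complex `c` and real `t₀` there are `C > 0`, `R ≥ 1` with
`‖Γ(c + s)‖ ≤ C |y|^{Re c − t₀ − 1/2} e^{−π|y|/2}` for `|y| ≥ R`, `s = −t₀ + iy`.
[cite: Zudilin2004, §4 (supporting lemma)] -/
theorem norm_Gamma_shift_le (c : ℂ) (t₀ : ℝ) :
    ∃ C : ℝ, 0 < C ∧ ∃ R : ℝ, 1 ≤ R ∧ ∀ y : ℝ, R ≤ |y| →
      ‖Complex.Gamma (c + (-(t₀ : ℂ) + (y : ℂ) * Complex.I))‖ ≤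
        C * |y| ^ (c.re - t₀ - 1 / 2) * Real.exp (-(π * |y|) / 2) := by
  obtain ⟨C₁, hC₁, h₁⟩ := exists_norm_Gamma_vertical_le (c.re - t₀) (c.re - t₀)
  refine ⟨C₁ * (2 : ℝ) ^ |c.re - t₀ - 1 / 2| * Real.exp (π * |c.im| / 2), by positivity, 2 * |c.im| + 2,
    by linarith [abs_nonneg c.im], fun y hy => ?_⟩
  obtain ⟨hu1, hpow⟩ := abs_add_rpow_le c.im (c.re - t₀ - 1 / 2) hy
  have hlow : |y| - |c.im| ≤ |c.im + y| := by
    have h := abs_sub (c.im + y) c.im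
    rw [add_sub_cancel_left] at h
    linarith
  have hΓ := h₁ (c.re - t₀) (by simp) (c.im + y) hu1
  have hexp : Real.exp (-(π * |c.im + y|) / 2) ≤ Real.exp (π * |c.im| / 2) * Real.exp (-(π * |y|) / 2) := by
    rw [← Real.exp_add]
    apply Real.exp_le_exp.2
    have := mul_le_mul_of_nonneg_left hlow Real.pi_pos.le
    linarith
  rw [add_line_eq]
  calc ‖Complex.Gamma (((c.re - t₀ : ℝ) : ℂ) + ((c.im + y : ℝ) : ℂ) * Complex.I)‖
      ≤ C₁ * |c.im + y| ^ (c.re - t₀ - 1 / 2) * Real.exp (-(π * |c.im + y|) / 2) := hΓ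
    _ ≤ C₁ * ((2 : ℝ) ^ |c.re - t₀ - 1 / 2| * |y| ^ (c.re - t₀ - 1 / 2)) *
          (Real.exp (π * |c.im| / 2) * Real.exp (-(π * |y|) / 2)) := by gcongr
    _ = _ := by ring

/-- **Shifted lower Stirling bound, reciprocal form**: for every complex `c` and real `t₀` there are `C > 0`, `R ≥ 1` with
`‖Γ(c + s)‖⁻¹ ≤ C |y|^{−(Re c − t₀ − 1/2)} e^{π|y|/2}` for `|y| ≥ R`, `s = −t₀ + iy` (far out on the line `Γ` has no zeros
and no poles, and `1/Γ` grows at most like the reciprocal of Stirling's lower bound).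
[cite: Zudilin2004, §4 (supporting lemma)] -/
theorem norm_Gamma_shift_inv_le (c : ℂ) (t₀ : ℝ) :
    ∃ C : ℝ, 0 < C ∧ ∃ R : ℝ, 1 ≤ R ∧ ∀ y : ℝ, R ≤ |y| →
      ‖Complex.Gamma (c + (-(t₀ : ℂ) + (y : ℂ) * Complex.I))‖⁻¹ ≤
        C * |y| ^ (-(c.re - t₀ - 1 / 2)) * Real.exp (π * |y| / 2) := by
  obtain ⟨c₁, hc₁, h₁⟩ := exists_norm_Gamma_vertical_ge (c.re - t₀) (c.re - t₀)
  refine ⟨c₁⁻¹ * (2 : ℝ) ^ |-(c.re - t₀ - 1 / 2)| * Real.exp (π * |c.im| / 2), by positivity, 2 * |c.im| + 2,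
    by linarith [abs_nonneg c.im], fun y hy => ?_⟩
  obtain ⟨hu1, hpow⟩ := abs_add_rpow_le c.im (-(c.re - t₀ - 1 / 2)) hy
  have hup : |c.im + y| ≤ |c.im| + |y| := abs_add_le _ _
  have hu0 : 0 < |c.im + y| := by linarith
  have hΓ := h₁ (c.re - t₀) (by simp) (c.im + y) hu1
  have hpos : 0 < c₁ * |c.im + y| ^ (c.re - t₀ - 1 / 2) * Real.exp (-(π * |c.im + y|) / 2) :=
    mul_pos (mul_pos hc₁ (Real.rpow_pos_of_pos hu0 _)) (Real.exp_pos _)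
  have hinv := inv_anti₀ hpos hΓ
  have hrew : (c₁ * |c.im + y| ^ (c.re - t₀ - 1 / 2) * Real.exp (-(π * |c.im + y|) / 2))⁻¹ =
      c₁⁻¹ * |c.im + y| ^ (-(c.re - t₀ - 1 / 2)) * Real.exp (π * |c.im + y| / 2) := by
    rw [mul_inv, mul_inv, Real.rpow_neg hu0.le, ← Real.exp_neg]
    congr 2
    ring
  have hexp : Real.exp (π * |c.im + y| / 2) ≤ Real.exp (π * |c.im| / 2) * Real.exp (π * |y| / 2) := by
    rw [← Real.exp_add]
    apply Real.exp_le_exp.2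
    have := mul_le_mul_of_nonneg_left hup Real.pi_pos.le
    linarith
  rw [add_line_eq]
  calc ‖Complex.Gamma (((c.re - t₀ : ℝ) : ℂ) + ((c.im + y : ℝ) : ℂ) * Complex.I)‖⁻¹
      ≤ (c₁ * |c.im + y| ^ (c.re - t₀ - 1 / 2) * Real.exp (-(π * |c.im + y|) / 2))⁻¹ := hinv
    _ = c₁⁻¹ * |c.im + y| ^ (-(c.re - t₀ - 1 / 2)) * Real.exp (π * |c.im + y| / 2) := hrew
    _ ≤ c₁⁻¹ * ((2 : ℝ) ^ |-(c.re - t₀ - 1 / 2)| * |y| ^ (-(c.re - t₀ - 1 / 2))) *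
          (Real.exp (π * |c.im| / 2) * Real.exp (π * |y| / 2)) := by gcongr
    _ = _ := by ring

/-- Stirling for the factor `Γ(−s) = Γ(t₀ − iy)`: `‖Γ(−s)‖ ≤ C |y|^{t₀ − 1/2} e^{−π|y|/2}` for `|y| ≥ 1`.
[cite: Zudilin2004, §4 (supporting lemma)] -/
theorem norm_Gamma_neg_line_le (t₀ : ℝ) :
    ∃ C : ℝ, 0 < C ∧ ∀ y : ℝ, 1 ≤ |y| →
      ‖Complex.Gamma (-(-(t₀ : ℂ) + (y : ℂ) * Complex.I))‖ ≤ C * |y| ^ (t₀ - 1 / 2) * Real.exp (-(π * |y|) / 2) := by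
  obtain ⟨C, hC, h⟩ := exists_norm_Gamma_vertical_le t₀ t₀
  refine ⟨C, hC, fun y hy => ?_⟩
  have hrew : -(-(t₀ : ℂ) + (y : ℂ) * Complex.I) = (t₀ : ℂ) + ((-y : ℝ) : ℂ) * Complex.I := by
    push_cast; ring
  have := h t₀ (by simp) (-y) (by simpa using hy)
  rw [hrew]
  simpa [abs_neg] using this

/-! ### 2. The kernel: decay, continuity, majorants -/

/-- **Decay of the Barnes kernel on the line** `s = −t₀ + iy`: there are `C > 0`, `R ≥ 1` with
`‖Γ(a₀+s)Γ(a+s)Γ(−s)/Γ(b+s)‖ ≤ C |y|^{Re a₀ + Re a − Re b − 1} e^{−π|y|}` for `|y| ≥ R` (four vertical Stirling bounds;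
the exponents `(Re a₀−t₀−½) + (Re a−t₀−½) + (t₀−½) − (Re b−t₀−½)` add up to `Re a₀ + Re a − Re b − 1`).
[cite: Zudilin2004, §4 (supporting lemma)] -/
theorem norm_kernel_le (a₀ a b : ℂ) (t₀ : ℝ) :
    ∃ C : ℝ, 0 < C ∧ ∃ R : ℝ, 1 ≤ R ∧ ∀ y : ℝ, R ≤ |y| →
      ‖Complex.Gamma (a₀ + (-(t₀ : ℂ) + (y : ℂ) * Complex.I)) * Complex.Gamma (a + (-(t₀ : ℂ) + (y : ℂ) * Complex.I)) *
            Complex.Gamma (-(-(t₀ : ℂ) + (y : ℂ) * Complex.I)) /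
          Complex.Gamma (b + (-(t₀ : ℂ) + (y : ℂ) * Complex.I))‖ ≤
        C * |y| ^ (a₀.re + a.re - b.re - 1) * Real.exp (-(π * |y|)) := by
  obtain ⟨C₁, hC₁, R₁, hR₁, h₁⟩ := norm_Gamma_shift_le a₀ t₀
  obtain ⟨C₂, hC₂, R₂, hR₂, h₂⟩ := norm_Gamma_shift_le a t₀
  obtain ⟨C₃, hC₃, h₃⟩ := norm_Gamma_neg_line_le t₀
  obtain ⟨C₄, hC₄, R₄, hR₄, h₄⟩ := norm_Gamma_shift_inv_le b t₀
  refine ⟨C₁ * C₂ * C₃ * C₄, by positivity, max (max R₁ R₂) R₄,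
    le_max_of_le_left (le_max_of_le_left hR₁), fun y hy => ?_⟩
  have hy₁ : R₁ ≤ |y| := le_trans (le_max_of_le_left (le_max_left _ _)) hy
  have hy₂ : R₂ ≤ |y| := le_trans (le_max_of_le_left (le_max_right _ _)) hy
  have hy₄ : R₄ ≤ |y| := le_trans (le_max_right _ _) hy
  have hy1 : 1 ≤ |y| := le_trans hR₁ hy₁
  have hy0 : 0 < |y| := by linarith
  have g1 := h₁ y hy₁
  have g2 := h₂ y hy₂
  have g3 := h₃ y hy1
  have g4 := h₄ y hy₄
  set E : ℝ := Real.exp (-(π * |y|) / 2) with hE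
  have hP : |y| ^ (a₀.re - t₀ - 1 / 2) * |y| ^ (a.re - t₀ - 1 / 2) * |y| ^ (t₀ - 1 / 2) *
      |y| ^ (-(b.re - t₀ - 1 / 2)) = |y| ^ (a₀.re + a.re - b.re - 1) := by
    rw [← Real.rpow_add hy0, ← Real.rpow_add hy0, ← Real.rpow_add hy0]
    congr 1
    ring
  have hEE : E * E * E * Real.exp (π * |y| / 2) = Real.exp (-(π * |y|)) := by
    rw [hE, ← Real.exp_add, ← Real.exp_add, ← Real.exp_add]
    congr 1
    ring
  rw [norm_div, norm_mul, norm_mul, div_eq_mul_inv]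
  calc ‖Complex.Gamma (a₀ + (-(t₀ : ℂ) + (y : ℂ) * Complex.I))‖ * ‖Complex.Gamma (a + (-(t₀ : ℂ) + (y : ℂ) * Complex.I))‖ *
          ‖Complex.Gamma (-(-(t₀ : ℂ) + (y : ℂ) * Complex.I))‖ * ‖Complex.Gamma (b + (-(t₀ : ℂ) + (y : ℂ) * Complex.I))‖⁻¹
      ≤ (C₁ * |y| ^ (a₀.re - t₀ - 1 / 2) * E) * (C₂ * |y| ^ (a.re - t₀ - 1 / 2) * E) * (C₃ * |y| ^ (t₀ - 1 / 2) * E) *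
          (C₄ * |y| ^ (-(b.re - t₀ - 1 / 2)) * Real.exp (π * |y| / 2)) :=
        mul_le_mul (mul_le_mul (mul_le_mul g1 g2 (norm_nonneg _) (by positivity)) g3 (norm_nonneg _) (by positivity))
          g4 (by positivity) (by positivity)
    _ = (C₁ * C₂ * C₃ * C₄) * (|y| ^ (a₀.re - t₀ - 1 / 2) * |y| ^ (a.re - t₀ - 1 / 2) * |y| ^ (t₀ - 1 / 2) *
          |y| ^ (-(b.re - t₀ - 1 / 2))) * (E * E * E * Real.exp (π * |y| / 2)) := by ring
    _ = (C₁ * C₂ * C₃ * C₄) * |y| ^ (a₀.re + a.re - b.re - 1) * Real.exp (-(π * |y|)) := by rw [hP, hEE]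

/-- **Continuity of the kernel** on the line: for `0 < t₀ < Re a₀`, `t₀ < Re a`, `t₀ < Re b` no Gamma factor meets a pole
and the denominator does not vanish. [cite: Zudilin2004, §4 (supporting lemma)] -/
theorem continuous_kernel (ht₀ : 0 < t₀) (ht₀' : t₀ < a₀.re) (hta : t₀ < a.re) (htb : t₀ < b.re) :
    Continuous fun y : ℝ =>
      Complex.Gamma (a₀ + (-(t₀ : ℂ) + (y : ℂ) * Complex.I)) * Complex.Gamma (a + (-(t₀ : ℂ) + (y : ℂ) * Complex.I)) *
          Complex.Gamma (-(-(t₀ : ℂ) + (y : ℂ) * Complex.I)) /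
        Complex.Gamma (b + (-(t₀ : ℂ) + (y : ℂ) * Complex.I)) := by
  have hΓ : ∀ (f : ℝ → ℂ), Continuous f → (∀ y, 0 < (f y).re) → Continuous fun y => Complex.Gamma (f y) := by
    intro f hf hpos
    refine continuous_iff_continuousAt.mpr fun y => (Complex.continuousAt_Gamma _ ?_).comp hf.continuousAt
    exact ne_neg_nat_of_re_pos (hpos y)
  have h1 := hΓ (fun y : ℝ => a₀ + (-(t₀ : ℂ) + (y : ℂ) * Complex.I)) (by fun_prop) (fun y => by simp; linarith)
  have h2 := hΓ (fun y : ℝ => a + (-(t₀ : ℂ) + (y : ℂ) * Complex.I)) (by fun_prop) (fun y => by simp; linarith)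
  have h3 := hΓ (fun y : ℝ => -(-(t₀ : ℂ) + (y : ℂ) * Complex.I)) (by fun_prop) (fun y => by simp [ht₀])
  have h4 := hΓ (fun y : ℝ => b + (-(t₀ : ℂ) + (y : ℂ) * Complex.I)) (by fun_prop) (fun y => by simp; linarith)
  refine ((h1.mul h2).mul h3).div h4 fun y => ?_
  exact Complex.Gamma_ne_zero_of_re_pos (by simp; linarith)

/-- **Majorant off the cut**: for `θ < π` and any constant `M`, the function `y ↦ K(y)·((1+|y|)·M·e^{θ|y|})` (complex-valued,
the real weight cast into `ℂ`) is integrable on `ℝ` — the kernel's `e^{−π|y|}` beats `e^{θ|y|}` times any polynomial.  Its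
norm dominates both `K(y) w^{s}` and the `w`-derivative `K(y)·s·w^{s−1}` for `|arg w| ≤ θ`, `‖w‖` bounded below.
[cite: Zudilin2004, §4 (supporting lemma)] -/
theorem integrable_kernel_mul_exp (ht₀ : 0 < t₀) (ht₀' : t₀ < a₀.re) (hta : t₀ < a.re) (htb : t₀ < b.re) {θ : ℝ}
    (hθ : θ < π) (M : ℝ) :
    Integrable fun y : ℝ =>
      Complex.Gamma (a₀ + (-(t₀ : ℂ) + (y : ℂ) * Complex.I)) * Complex.Gamma (a + (-(t₀ : ℂ) + (y : ℂ) * Complex.I)) *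
            Complex.Gamma (-(-(t₀ : ℂ) + (y : ℂ) * Complex.I)) /
          Complex.Gamma (b + (-(t₀ : ℂ) + (y : ℂ) * Complex.I)) *
        (((1 + |y|) * (M * Real.exp (θ * |y|)) : ℝ) : ℂ) := by
  obtain ⟨C, hC, R, hR, hK⟩ := norm_kernel_le a₀ a b t₀
  -- polynomial × e^{-(π-θ)|y|/2} is eventually ≤ 1/(C(|M|+1))
  set p : ℝ := max (a₀.re + a.re - b.re - 1) 0 + 1 with hp
  have hp0 : 0 ≤ p := by positivity
  have hδ : 0 < (π - θ) / 2 := by linarith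
  obtain ⟨T₀, hT₀⟩ := Literature.Analysis.Complex.exists_rpow_mul_exp_neg_le (K := 1) zero_le_one hp0 hδ
    (ε := (C * (|M| + 1))⁻¹) (by positivity)
  refine integrable_of_norm_le_exp ((continuous_kernel ht₀ ht₀' hta htb).mul (by fun_prop)) hδ (C := 1)
    (R := max R T₀) fun y hy => ?_
  have hyR : R ≤ |y| := le_trans (le_max_left _ _) hy
  have hyT : T₀ ≤ |y| := le_trans (le_max_right _ _) hy
  have hy1 : 1 ≤ |y| := le_trans hR hyR
  have hy0 : 0 < |y| := by linarith
  have hKy := hK y hyR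
  have hTy := hT₀ y hyT
  -- the real weight
  have hw : ‖((((1 + |y|) * (M * Real.exp (θ * |y|)) : ℝ) : ℂ))‖ ≤ (1 + |y|) * ((|M| + 1) * Real.exp (θ * |y|)) := by
    rw [Complex.norm_real, Real.norm_eq_abs, abs_mul, abs_mul, abs_of_nonneg (by positivity : (0 : ℝ) ≤ 1 + |y|),
      Real.abs_exp]
    gcongr
    linarith
  -- |y|^q ≤ (1+|y|)^{max q 0}
  have hq : |y| ^ (a₀.re + a.re - b.re - 1) ≤ (1 + |y|) ^ (max (a₀.re + a.re - b.re - 1) 0) :=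
    BarnesMellinCpow.rpow_le_add_rpow_max hy1 zero_le_one
  have hpoly : (1 + |y|) ^ (max (a₀.re + a.re - b.re - 1) 0) * (1 + |y|) = (1 + |y|) ^ p := by
    rw [hp, Real.rpow_add (by linarith), Real.rpow_one]
  have hexp : Real.exp (-(π * |y|)) * Real.exp (θ * |y|) =
      Real.exp (-((π - θ) / 2 * |y|)) * Real.exp (-((π - θ) / 2) * |y|) := by
    rw [← Real.exp_add, ← Real.exp_add]; ring_nf
  rw [norm_mul]
  calc ‖Complex.Gamma (a₀ + (-(t₀ : ℂ) + (y : ℂ) * Complex.I)) * Complex.Gamma (a + (-(t₀ : ℂ) + (y : ℂ) * Complex.I)) *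
            Complex.Gamma (-(-(t₀ : ℂ) + (y : ℂ) * Complex.I)) /
          Complex.Gamma (b + (-(t₀ : ℂ) + (y : ℂ) * Complex.I))‖ *
        ‖((((1 + |y|) * (M * Real.exp (θ * |y|)) : ℝ) : ℂ))‖
      ≤ (C * |y| ^ (a₀.re + a.re - b.re - 1) * Real.exp (-(π * |y|))) *
          ((1 + |y|) * ((|M| + 1) * Real.exp (θ * |y|))) :=
        mul_le_mul hKy hw (norm_nonneg _) (by positivity)
    _ ≤ (C * (1 + |y|) ^ (max (a₀.re + a.re - b.re - 1) 0) * Real.exp (-(π * |y|))) *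
          ((1 + |y|) * ((|M| + 1) * Real.exp (θ * |y|))) := by gcongr
    _ = (C * (|M| + 1)) * (((1 + |y|) ^ (max (a₀.re + a.re - b.re - 1) 0) * (1 + |y|)) *
          (Real.exp (-(π * |y|)) * Real.exp (θ * |y|))) := by ring
    _ = (C * (|M| + 1)) * ((1 + |y|) ^ p * Real.exp (-((π - θ) / 2 * |y|))) * Real.exp (-((π - θ) / 2) * |y|) := by
        rw [hpoly, hexp]; ring
    _ ≤ (C * (|M| + 1)) * (C * (|M| + 1))⁻¹ * Real.exp (-((π - θ) / 2) * |y|) := by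
        gcongr
    _ = 1 * Real.exp (-((π - θ) / 2) * |y|) := by rw [mul_inv_cancel₀ (by positivity)]

/-- **Majorant on the cut**: if moreover `Re a₀ + Re a < Re b`, then `y ↦ ‖K(y)‖ e^{π|y|}` is integrable on `ℝ`
(tail `≍ |y|^{Re a₀ + Re a − Re b − 1}`, an integrable power exactly under this hypothesis; compare Mathlib's
`integrable_one_add_norm`).  This dominates `K(y)·x^{s}e^{±iπs}` for `0 < x ≤ 1` and the approach to the cut.
[cite: Zudilin2004, §4 (supporting lemma)] -/
theorem integrable_norm_kernel_mul_exp_pi (ht₀ : 0 < t₀) (ht₀' : t₀ < a₀.re) (hta : t₀ < a.re) (htb : t₀ < b.re)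
    (hb : a₀.re + a.re < b.re) :
    Integrable fun y : ℝ =>
      ‖Complex.Gamma (a₀ + (-(t₀ : ℂ) + (y : ℂ) * Complex.I)) * Complex.Gamma (a + (-(t₀ : ℂ) + (y : ℂ) * Complex.I)) *
            Complex.Gamma (-(-(t₀ : ℂ) + (y : ℂ) * Complex.I)) /
          Complex.Gamma (b + (-(t₀ : ℂ) + (y : ℂ) * Complex.I))‖ * Real.exp (π * |y|) := by
  obtain ⟨C, hC, R, hR, hK⟩ := norm_kernel_le a₀ a b t₀
  set q : ℝ := a₀.re + a.re - b.re - 1 with hq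
  have hq1 : q < -1 := by rw [hq]; linarith
  have hcont : Continuous fun y : ℝ =>
      ‖Complex.Gamma (a₀ + (-(t₀ : ℂ) + (y : ℂ) * Complex.I)) * Complex.Gamma (a + (-(t₀ : ℂ) + (y : ℂ) * Complex.I)) *
            Complex.Gamma (-(-(t₀ : ℂ) + (y : ℂ) * Complex.I)) /
          Complex.Gamma (b + (-(t₀ : ℂ) + (y : ℂ) * Complex.I))‖ * Real.exp (π * |y|) :=
    (continuous_kernel ht₀ ht₀' hta htb).norm.mul (by fun_prop)
  -- a bound on the compact middle part
  obtain ⟨M, hM⟩ := (isCompact_Icc : IsCompact (Icc (-R) R)).exists_bound_of_continuousOn hcont.continuousOn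
  have hM0 : 0 ≤ M := le_trans (norm_nonneg _) (hM 0 (by constructor <;> linarith))
  -- the integrable majorant `C' (1+|y|)^q`
  set C' : ℝ := C * (2 : ℝ) ^ (-q) + M * (1 + R) ^ (-q) with hC'
  have hmaj : Integrable fun y : ℝ => C' * (1 + ‖y‖) ^ (-(-q)) :=
    (integrable_one_add_norm (E := ℝ) (μ := volume) (by simp; linarith)).const_mul C'
  refine hmaj.mono' hcont.aestronglyMeasurable (Eventually.of_forall fun y => ?_)
  rw [Real.norm_eq_abs, abs_of_nonneg (by positivity), neg_neg, Real.norm_eq_abs]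
  have h1y : 0 < 1 + |y| := by positivity
  by_cases hy : R ≤ |y|
  · -- tail: ‖K‖ e^{π|y|} ≤ C|y|^q ≤ C 2^{-q} (1+|y|)^q
    have hy1 : 1 ≤ |y| := le_trans hR hy
    have hy0 : 0 < |y| := by linarith
    have hKy := hK y hy
    have hpow : |y| ^ q ≤ (2 : ℝ) ^ (-q) * (1 + |y|) ^ q := by
      have h2 : 1 + |y| ≤ 2 * |y| := by linarith
      have := Real.rpow_le_rpow_of_nonpos h1y h2 (by linarith : q ≤ 0)
      rw [Real.mul_rpow (by norm_num) (abs_nonneg y)] at this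
      have h2q : (0 : ℝ) < 2 ^ q := Real.rpow_pos_of_pos (by norm_num) q
      rw [Real.rpow_neg (by norm_num : (0 : ℝ) ≤ 2)]
      calc |y| ^ q = (2 ^ q)⁻¹ * (2 ^ q * |y| ^ q) := by field_simp
        _ ≤ (2 ^ q)⁻¹ * (1 + |y|) ^ q := mul_le_mul_of_nonneg_left this (by positivity)
    calc ‖Complex.Gamma (a₀ + (-(t₀ : ℂ) + (y : ℂ) * Complex.I)) * Complex.Gamma (a + (-(t₀ : ℂ) + (y : ℂ) * Complex.I)) *
              Complex.Gamma (-(-(t₀ : ℂ) + (y : ℂ) * Complex.I)) /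
            Complex.Gamma (b + (-(t₀ : ℂ) + (y : ℂ) * Complex.I))‖ * Real.exp (π * |y|)
        ≤ (C * |y| ^ q * Real.exp (-(π * |y|))) * Real.exp (π * |y|) :=
          mul_le_mul_of_nonneg_right hKy (Real.exp_pos _).le
      _ = C * |y| ^ q := by
          rw [mul_assoc, ← Real.exp_add, show -(π * |y|) + π * |y| = 0 by ring, Real.exp_zero, mul_one]
      _ ≤ C * ((2 : ℝ) ^ (-q) * (1 + |y|) ^ q) := mul_le_mul_of_nonneg_left hpow hC.le
      _ ≤ C' * (1 + |y|) ^ q := by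
          rw [hC', add_mul, ← mul_assoc]
          have : 0 ≤ M * (1 + R) ^ (-q) * (1 + |y|) ^ q := by positivity
          linarith
  · -- middle: ≤ M ≤ M (1+R)^{-q} (1+|y|)^q since (1+|y|)^q ≥ (1+R)^q
    rw [not_le] at hy
    have hyI : y ∈ Icc (-R) R := by
      constructor <;> linarith [neg_abs_le y, le_abs_self y]
    have hMy := hM y hyI
    rw [Real.norm_eq_abs, abs_of_nonneg (by positivity)] at hMy
    have hpow : (1 + R) ^ q ≤ (1 + |y|) ^ q := Real.rpow_le_rpow_of_nonpos h1y (by linarith) (by linarith)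
    have hR0 : 0 < 1 + R := by linarith
    calc ‖Complex.Gamma (a₀ + (-(t₀ : ℂ) + (y : ℂ) * Complex.I)) * Complex.Gamma (a + (-(t₀ : ℂ) + (y : ℂ) * Complex.I)) *
              Complex.Gamma (-(-(t₀ : ℂ) + (y : ℂ) * Complex.I)) /
            Complex.Gamma (b + (-(t₀ : ℂ) + (y : ℂ) * Complex.I))‖ * Real.exp (π * |y|)
        ≤ M := hMy
      _ = M * (1 + R) ^ (-q) * (1 + R) ^ q := by
          rw [mul_assoc, Real.rpow_neg hR0.le, inv_mul_cancel₀ (Real.rpow_pos_of_pos hR0 q).ne', mul_one]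
      _ ≤ M * (1 + R) ^ (-q) * (1 + |y|) ^ q := mul_le_mul_of_nonneg_left hpow (by positivity)
      _ ≤ C' * (1 + |y|) ^ q := by
          rw [hC', add_mul]
          have : 0 ≤ C * (2 : ℝ) ^ (-q) * (1 + |y|) ^ q := by positivity
          linarith

end Literature.NumberTheory.Irrationality.Zudilin2004.BarnesKernelBounds

end Part6

/-!
## Part 7 — port of `Summits/KontsevichZagierPeriods/Zeta5Search/BarnesEulerContinuation.lean` (11 declarations kept)

# Nesterenko's Barnes integral continued off the negative axis

Declarations of this Part (verbatim port; each keeps its own docstring and citation): `exists_ball_bounds`, `norm_cpow_line_le`, `line_sub_one`, `norm_line_le`, `continuous_integrand`, `hasDerivAt_barnes`, `differentiableOn_barnes`, `differentiableOn_euler_neg`, `isOpen_domain`, `isPreconnected_domain`, `eulerIntegral_neg_eq_barnes_of_mem`.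

Reference keys (see `references.bib` and the declarations' citations): [Zudilin2004].
-/

section Part7

namespace Literature.NumberTheory.Irrationality.Zudilin2004.BarnesEulerContinuation

open _root_.MeasureTheory _root_.Set _root_.Filter _root_.Metric
open scoped _root_.Real _root_.Topology
open Literature.Analysis.SpecialFunctions.Hypergeometric (eulerIntegral hasDerivAt_eulerIntegral)
open Literature.NumberTheory.Irrationality.Zudilin2004.BarnesKernelBounds

variable {t₀ : ℝ} {a₀ a b : ℂ}

/-! ### 1. Geometry of the slit plane: uniform bounds on small closed balls -/

/-- Around every point of the slit plane there is a closed ball inside the slit plane on which `|arg w| ≤ θ` for some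
`θ < π` and `‖w‖ ≥ m` for some `m > 0` (compactness and continuity of `arg`, `‖·‖` on the slit plane).
[cite: Zudilin2004, §4 (supporting lemma)] -/
theorem exists_ball_bounds {w₀ : ℂ} (hw₀ : w₀ ∈ Complex.slitPlane) :
    ∃ ρ : ℝ, 0 < ρ ∧ closedBall w₀ ρ ⊆ Complex.slitPlane ∧
      ∃ θ : ℝ, θ < π ∧ ∃ m : ℝ, 0 < m ∧ ∀ w ∈ closedBall w₀ ρ, |Complex.arg w| ≤ θ ∧ m ≤ ‖w‖ := by
  obtain ⟨ε, hε, hball⟩ := Metric.isOpen_iff.1 Complex.isOpen_slitPlane w₀ hw₀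
  have hsub : closedBall w₀ (ε / 2) ⊆ Complex.slitPlane :=
    (closedBall_subset_ball (by linarith)).trans hball
  have hK : IsCompact (closedBall w₀ (ε / 2)) := isCompact_closedBall _ _
  have hne : (closedBall w₀ (ε / 2)).Nonempty := ⟨w₀, mem_closedBall_self (by linarith)⟩
  -- maximum of |arg|
  have harg : ContinuousOn (fun w : ℂ => |Complex.arg w|) (closedBall w₀ (ε / 2)) := fun w hw =>
    ((Complex.continuousAt_arg (hsub hw)).abs).continuousWithinAt
  obtain ⟨w₁, hw₁, hmax⟩ := hK.exists_isMaxOn hne harg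
  -- minimum of the norm
  obtain ⟨w₂, hw₂, hmin⟩ := hK.exists_isMinOn hne (continuous_norm.continuousOn)
  have hθ : |Complex.arg w₁| < π := by
    have h1 := Complex.mem_slitPlane_iff_arg.1 (hsub hw₁)
    exact abs_lt.2 ⟨Complex.neg_pi_lt_arg _, lt_of_le_of_ne (Complex.arg_le_pi _) h1.1⟩
  have hm : 0 < ‖w₂‖ := norm_pos_iff.2 (Complex.slitPlane_ne_zero (hsub hw₂))
  exact ⟨ε / 2, by linarith, hsub, |Complex.arg w₁|, hθ, ‖w₂‖, hm, fun w hw => ⟨hmax hw, hmin hw⟩⟩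

/-- Norm of `w^{s}` on the line `s = −t₀ + iy` (`t₀ ≥ 0`): if `‖w‖ ≥ m > 0` and `|arg w| ≤ θ` then
`‖w^{−t₀+iy}‖ ≤ m^{−t₀} e^{θ|y|}` (`‖w^{s}‖ = ‖w‖^{Re s} e^{−arg w · Im s}`).
[cite: Zudilin2004, §4 (supporting lemma)] -/
theorem norm_cpow_line_le {w : ℂ} {m θ : ℝ} (hm : 0 < m) (hmw : m ≤ ‖w‖) (hθ : |Complex.arg w| ≤ θ) (ht₀ : 0 ≤ t₀)
    (y : ℝ) : ‖w ^ (-(t₀ : ℂ) + (y : ℂ) * Complex.I)‖ ≤ m ^ (-t₀) * Real.exp (θ * |y|) := by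
  have hw : w ≠ 0 := norm_pos_iff.1 (lt_of_lt_of_le hm hmw)
  rw [Complex.norm_cpow_of_ne_zero hw]
  have hre : (-(t₀ : ℂ) + (y : ℂ) * Complex.I).re = -t₀ := by simp
  have him : (-(t₀ : ℂ) + (y : ℂ) * Complex.I).im = y := by simp
  rw [hre, him, div_eq_mul_inv, ← Real.exp_neg]
  have h1 : ‖w‖ ^ (-t₀) ≤ m ^ (-t₀) := Real.rpow_le_rpow_of_nonpos hm hmw (by linarith)
  have h2 : Real.exp (-(Complex.arg w * y)) ≤ Real.exp (θ * |y|) := by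
    apply Real.exp_le_exp.2
    calc -(Complex.arg w * y) ≤ |Complex.arg w * y| := neg_le_abs _
      _ = |Complex.arg w| * |y| := abs_mul _ _
      _ ≤ θ * |y| := mul_le_mul_of_nonneg_right hθ (abs_nonneg _)
  exact mul_le_mul h1 h2 (Real.exp_pos _).le (Real.rpow_nonneg hm.le _)

/-- The shifted exponent: `s − 1 = −(t₀+1) + iy`. [cite: Zudilin2004, §4 (supporting lemma)] -/
theorem line_sub_one (t₀ y : ℝ) :
    (-(t₀ : ℂ) + (y : ℂ) * Complex.I) - 1 = -((t₀ + 1 : ℝ) : ℂ) + (y : ℂ) * Complex.I := by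
  push_cast; ring

/-- `‖s‖ ≤ t₀ + |y|` for `s = −t₀ + iy`, `t₀ ≥ 0`. [cite: Zudilin2004, §4 (supporting lemma)] -/
theorem norm_line_le (ht₀ : 0 ≤ t₀) (y : ℝ) : ‖(-(t₀ : ℂ) + (y : ℂ) * Complex.I)‖ ≤ t₀ + |y| := by
  calc ‖(-(t₀ : ℂ) + (y : ℂ) * Complex.I)‖ ≤ ‖-(t₀ : ℂ)‖ + ‖(y : ℂ) * Complex.I‖ := norm_add_le _ _
    _ = t₀ + |y| := by
        rw [norm_neg, Complex.norm_real, norm_mul, Complex.norm_I, mul_one, Complex.norm_real,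
          Real.norm_eq_abs, Real.norm_eq_abs, abs_of_nonneg ht₀]

/-! ### 2. Holomorphy of the Barnes side on the slit plane -/

/-- For `w ≠ 0` the integrand `y ↦ K(y) w^{s}` is continuous, hence a.e.-strongly measurable.
[cite: Zudilin2004, §4 (supporting lemma)] -/
theorem continuous_integrand (ht₀ : 0 < t₀) (ht₀' : t₀ < a₀.re) (hta : t₀ < a.re) (htb : t₀ < b.re) {w : ℂ}
    (hw : w ≠ 0) :
    Continuous fun y : ℝ =>
      Complex.Gamma (a₀ + (-(t₀ : ℂ) + (y : ℂ) * Complex.I)) * Complex.Gamma (a + (-(t₀ : ℂ) + (y : ℂ) * Complex.I)) *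
            Complex.Gamma (-(-(t₀ : ℂ) + (y : ℂ) * Complex.I)) /
          Complex.Gamma (b + (-(t₀ : ℂ) + (y : ℂ) * Complex.I)) *
        w ^ (-(t₀ : ℂ) + (y : ℂ) * Complex.I) :=
  (continuous_kernel ht₀ ht₀' hta htb).mul ((by fun_prop : Continuous fun y : ℝ => -(t₀ : ℂ) + (y : ℂ) * Complex.I).const_cpow
    (Or.inl hw))

/-- **Differentiation under the integral sign**: at every point `w₀` of the slit plane,
`d/dw ∫_ℝ K(y) w^{s} dy = ∫_ℝ K(y) s w₀^{s−1} dy` (`0 < t₀ < Re a₀`, `t₀ < Re a`, `t₀ < Re b`).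
[cite: Zudilin2004, §4 (supporting lemma)] -/
theorem hasDerivAt_barnes (ht₀ : 0 < t₀) (ht₀' : t₀ < a₀.re) (hta : t₀ < a.re) (htb : t₀ < b.re) {w₀ : ℂ}
    (hw₀ : w₀ ∈ Complex.slitPlane) :
    HasDerivAt (fun w : ℂ => ∫ y : ℝ,
        Complex.Gamma (a₀ + (-(t₀ : ℂ) + (y : ℂ) * Complex.I)) * Complex.Gamma (a + (-(t₀ : ℂ) + (y : ℂ) * Complex.I)) *
              Complex.Gamma (-(-(t₀ : ℂ) + (y : ℂ) * Complex.I)) /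
            Complex.Gamma (b + (-(t₀ : ℂ) + (y : ℂ) * Complex.I)) *
          w ^ (-(t₀ : ℂ) + (y : ℂ) * Complex.I))
      (∫ y : ℝ,
        Complex.Gamma (a₀ + (-(t₀ : ℂ) + (y : ℂ) * Complex.I)) * Complex.Gamma (a + (-(t₀ : ℂ) + (y : ℂ) * Complex.I)) *
              Complex.Gamma (-(-(t₀ : ℂ) + (y : ℂ) * Complex.I)) /
            Complex.Gamma (b + (-(t₀ : ℂ) + (y : ℂ) * Complex.I)) *
          ((-(t₀ : ℂ) + (y : ℂ) * Complex.I) * w₀ ^ ((-(t₀ : ℂ) + (y : ℂ) * Complex.I) - 1))) w₀ := by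
  obtain ⟨ρ, hρ, hsub, θ, hθ, m, hm, hbd⟩ := exists_ball_bounds hw₀
  -- names for kernel, integrand and derivative
  set K : ℝ → ℂ := fun y =>
    Complex.Gamma (a₀ + (-(t₀ : ℂ) + (y : ℂ) * Complex.I)) * Complex.Gamma (a + (-(t₀ : ℂ) + (y : ℂ) * Complex.I)) *
        Complex.Gamma (-(-(t₀ : ℂ) + (y : ℂ) * Complex.I)) /
      Complex.Gamma (b + (-(t₀ : ℂ) + (y : ℂ) * Complex.I)) with hK
  set F : ℂ → ℝ → ℂ := fun w y => K y * w ^ (-(t₀ : ℂ) + (y : ℂ) * Complex.I) with hF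
  set F' : ℂ → ℝ → ℂ := fun w y =>
    K y * ((-(t₀ : ℂ) + (y : ℂ) * Complex.I) * w ^ ((-(t₀ : ℂ) + (y : ℂ) * Complex.I) - 1)) with hF'
  -- the majorant
  set M : ℝ := (t₀ + 1) * m ^ (-(t₀ + 1)) with hM
  have hM0 : 0 < M := by positivity
  set bound : ℝ → ℝ := fun y => ‖K y * ((((1 + |y|) * (M * Real.exp (θ * |y|)) : ℝ) : ℂ))‖ with hbound
  have hbound_int : Integrable bound := (integrable_kernel_mul_exp ht₀ ht₀' hta htb hθ M).norm
  -- measurability of `F w` near `w₀`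
  have hF_meas : ∀ᶠ w in 𝓝 w₀, AEStronglyMeasurable (F w) volume := by
    filter_upwards [Complex.isOpen_slitPlane.mem_nhds hw₀] with w hw
    exact (continuous_integrand ht₀ ht₀' hta htb (Complex.slitPlane_ne_zero hw)).aestronglyMeasurable
  -- integrability of `F w₀`
  have hw₀0 : w₀ ≠ 0 := Complex.slitPlane_ne_zero hw₀
  have hbd₀ := hbd w₀ (mem_closedBall_self hρ.le)
  have hF_int : Integrable (F w₀) := by
    refine (integrable_kernel_mul_exp ht₀ ht₀' hta htb hθ (m ^ (-t₀))).norm.mono'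
      (continuous_integrand ht₀ ht₀' hta htb hw₀0).aestronglyMeasurable (Eventually.of_forall fun y => ?_)
    have hw := norm_cpow_line_le hm hbd₀.2 hbd₀.1 ht₀.le y
    have hreal : ‖((((1 + |y|) * (m ^ (-t₀) * Real.exp (θ * |y|)) : ℝ) : ℂ))‖ =
        (1 + |y|) * (m ^ (-t₀) * Real.exp (θ * |y|)) := by
      rw [Complex.norm_real, Real.norm_eq_abs, abs_of_nonneg (by positivity)]
    rw [hF]
    simp only
    rw [norm_mul, norm_mul, hreal]
    refine mul_le_mul_of_nonneg_left ?_ (norm_nonneg _)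
    calc ‖w₀ ^ (-(t₀ : ℂ) + (y : ℂ) * Complex.I)‖ ≤ m ^ (-t₀) * Real.exp (θ * |y|) := hw
      _ = 1 * (m ^ (-t₀) * Real.exp (θ * |y|)) := (one_mul _).symm
      _ ≤ (1 + |y|) * (m ^ (-t₀) * Real.exp (θ * |y|)) := by gcongr; linarith [abs_nonneg y]
  -- measurability of `F' w₀`
  have hF'_meas : AEStronglyMeasurable (F' w₀) volume := by
    refine ((continuous_kernel ht₀ ht₀' hta htb).mul (Continuous.mul (by fun_prop) ?_)).aestronglyMeasurable
    exact (by fun_prop : Continuous fun y : ℝ => (-(t₀ : ℂ) + (y : ℂ) * Complex.I) - 1).const_cpow (Or.inl hw₀0)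
  -- the bound on the ball
  have h_bound : ∀ᵐ y ∂volume, ∀ w ∈ closedBall w₀ ρ, ‖F' w y‖ ≤ bound y := by
    refine Eventually.of_forall fun y w hw => ?_
    obtain ⟨hargw, hmw⟩ := hbd w hw
    have hcp : ‖w ^ ((-(t₀ : ℂ) + (y : ℂ) * Complex.I) - 1)‖ ≤ m ^ (-(t₀ + 1)) * Real.exp (θ * |y|) := by
      rw [line_sub_one]
      exact norm_cpow_line_le hm hmw hargw (by linarith) y
    have hs := norm_line_le ht₀.le y
    have hreal : ‖((((1 + |y|) * (M * Real.exp (θ * |y|)) : ℝ) : ℂ))‖ = (1 + |y|) * (M * Real.exp (θ * |y|)) := by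
      rw [Complex.norm_real, Real.norm_eq_abs, abs_of_nonneg (by positivity)]
    rw [hbound, hF']
    simp only
    rw [norm_mul, norm_mul, norm_mul, hreal]
    refine mul_le_mul_of_nonneg_left ?_ (norm_nonneg _)
    calc ‖(-(t₀ : ℂ) + (y : ℂ) * Complex.I)‖ * ‖w ^ ((-(t₀ : ℂ) + (y : ℂ) * Complex.I) - 1)‖
        ≤ (t₀ + |y|) * (m ^ (-(t₀ + 1)) * Real.exp (θ * |y|)) := mul_le_mul hs hcp (norm_nonneg _) (by positivity)
      _ ≤ ((t₀ + 1) * (1 + |y|)) * (m ^ (-(t₀ + 1)) * Real.exp (θ * |y|)) := by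
          gcongr; nlinarith [abs_nonneg y, ht₀.le]
      _ = (1 + |y|) * (M * Real.exp (θ * |y|)) := by rw [hM]; ring
  -- differentiability of the integrand in `w`
  have h_diff : ∀ᵐ y ∂volume, ∀ w ∈ closedBall w₀ ρ, HasDerivAt (fun w => F w y) (F' w y) w := by
    refine Eventually.of_forall fun y w hw => ?_
    have h := ((hasDerivAt_id w).cpow_const (c := -(t₀ : ℂ) + (y : ℂ) * Complex.I) (hsub hw)).const_mul (K y)
    rw [hF, hF']
    simpa using h
  exact (hasDerivAt_integral_of_dominated_loc_of_deriv_le (closedBall_mem_nhds w₀ hρ) hF_meas hF_int hF'_meas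
    h_bound hbound_int h_diff).2

/-- **Holomorphy of the Barnes side**: `w ↦ ∫_ℝ K(y) w^{s} dy` is complex-differentiable on the slit plane.
[cite: Zudilin2004, §4 (supporting lemma)] -/
theorem differentiableOn_barnes (ht₀ : 0 < t₀) (ht₀' : t₀ < a₀.re) (hta : t₀ < a.re) (htb : t₀ < b.re) :
    DifferentiableOn ℂ (fun w : ℂ => ∫ y : ℝ,
        Complex.Gamma (a₀ + (-(t₀ : ℂ) + (y : ℂ) * Complex.I)) * Complex.Gamma (a + (-(t₀ : ℂ) + (y : ℂ) * Complex.I)) *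
              Complex.Gamma (-(-(t₀ : ℂ) + (y : ℂ) * Complex.I)) /
            Complex.Gamma (b + (-(t₀ : ℂ) + (y : ℂ) * Complex.I)) *
          w ^ (-(t₀ : ℂ) + (y : ℂ) * Complex.I)) Complex.slitPlane := fun _ hw =>
  (hasDerivAt_barnes ht₀ ht₀' hta htb hw).differentiableAt.differentiableWithinAt

/-! ### 3. Holomorphy of the Euler side and the continuation domain -/

/-- **Holomorphy of the Euler side** in `w = −z`: `w ↦ eulerIntegral a₀ a b (−w)` is complex-differentiable on
`{Re w > −1}` (the half-plane `Re z < 1` of `Hypergeometric.hasDerivAt_eulerIntegral`; needs `0 < Re a < Re b`).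
[cite: Zudilin2004, §4 (supporting lemma)] -/
theorem differentiableOn_euler_neg (a₀ : ℂ) (ha : 0 < a.re) (hab : a.re < b.re) :
    DifferentiableOn ℂ (fun w : ℂ => eulerIntegral a₀ a b (-w)) {w : ℂ | -1 < w.re} := by
  intro w hw
  have hz : (-w).re < 1 := by simp at hw ⊢; linarith
  exact ((hasDerivAt_eulerIntegral a₀ ha hab hz).differentiableAt.comp w differentiable_neg.differentiableAt)
    |>.differentiableWithinAt

/-- The continuation domain `U = slitPlane ∩ {Re w > −1}` is open. [cite: Zudilin2004, §4 (supporting lemma)] -/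
theorem isOpen_domain : IsOpen (Complex.slitPlane ∩ {w : ℂ | -1 < w.re}) :=
  Complex.isOpen_slitPlane.inter (isOpen_lt continuous_const Complex.continuous_re)

/-- The continuation domain `U = slitPlane ∩ {Re w > −1}` is star-convex at `1`, hence preconnected.
[cite: Zudilin2004, §4 (supporting lemma)] -/
theorem isPreconnected_domain : IsPreconnected (Complex.slitPlane ∩ {w : ℂ | -1 < w.re}) := by
  have h1 : (1 : ℂ) ∈ Complex.slitPlane ∩ {w : ℂ | -1 < w.re} := ⟨Complex.one_mem_slitPlane, by simp⟩
  have hstar : StarConvex ℝ (1 : ℂ) (Complex.slitPlane ∩ {w : ℂ | -1 < w.re}) :=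
    Complex.starConvex_one_slitPlane.inter ((convex_halfSpace_re_gt (-1)).starConvex h1.2)
  exact (hstar.isPathConnected h1).isConnected.isPreconnected

/-! ### 4. The continued identity -/

/-- **Zudilin's Lemma 2 continued off the negative axis** [Zudilin math/0206177, Lemma 2; Nesterenko 2003, §3.2]:
for complex `a₀, a, b` and real `t₀` with `0 < t₀ < Re a₀`, `t₀ < Re a`, `Re a < Re b`, and every `w` in the slit plane
with `Re w > −1`,
`eulerIntegral a₀ a b (−w) = ∫₀¹ t^{a−1}(1−t)^{b−a−1}(1+wt)^{−a₀} dt = Γ(b−a)/Γ(a₀) · (1/2π) ∫_ℝ Γ(a₀+s)Γ(a+s)Γ(−s)/Γ(b+s)·w^{s} dy`,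
`s = −t₀+iy` (principal-branch `w^{s}`; both sides holomorphic on `U = slitPlane ∩ {Re w > −1}`, equal at its real points
`w = ζ > 0` by `BarnesEulerIntegral.eulerIntegral_neg_eq_barnes`, hence equal on `U` by the identity theorem).
[cite: Zudilin2004, §4 (supporting lemma)] -/
theorem eulerIntegral_neg_eq_barnes_of_mem (ht₀ : 0 < t₀) (ht₀' : t₀ < a₀.re) (hta : t₀ < a.re) (hab : a.re < b.re)
    {w : ℂ} (hw : w ∈ Complex.slitPlane) (hw' : -1 < w.re) :
    eulerIntegral a₀ a b (-w) =
      Complex.Gamma (b - a) / Complex.Gamma a₀ *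
        ((1 / (2 * π) : ℂ) * ∫ y : ℝ,
          Complex.Gamma (a₀ + (-(t₀ : ℂ) + (y : ℂ) * Complex.I)) * Complex.Gamma (a + (-(t₀ : ℂ) + (y : ℂ) * Complex.I)) *
              Complex.Gamma (-(-(t₀ : ℂ) + (y : ℂ) * Complex.I)) /
              Complex.Gamma (b + (-(t₀ : ℂ) + (y : ℂ) * Complex.I)) *
            w ^ (-(t₀ : ℂ) + (y : ℂ) * Complex.I)) := by
  have ha : 0 < a.re := lt_trans ht₀ hta
  have htb : t₀ < b.re := lt_trans hta hab
  have hf : DifferentiableOn ℂ (fun w : ℂ => eulerIntegral a₀ a b (-w)) (Complex.slitPlane ∩ {w : ℂ | -1 < w.re}) :=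
    (differentiableOn_euler_neg a₀ ha hab).mono inter_subset_right
  have hg : DifferentiableOn ℂ (fun w : ℂ => Complex.Gamma (b - a) / Complex.Gamma a₀ *
        ((1 / (2 * π) : ℂ) * ∫ y : ℝ,
          Complex.Gamma (a₀ + (-(t₀ : ℂ) + (y : ℂ) * Complex.I)) * Complex.Gamma (a + (-(t₀ : ℂ) + (y : ℂ) * Complex.I)) *
              Complex.Gamma (-(-(t₀ : ℂ) + (y : ℂ) * Complex.I)) /
              Complex.Gamma (b + (-(t₀ : ℂ) + (y : ℂ) * Complex.I)) *
            w ^ (-(t₀ : ℂ) + (y : ℂ) * Complex.I)))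
      (Complex.slitPlane ∩ {w : ℂ | -1 < w.re}) :=
    (((differentiableOn_barnes ht₀ ht₀' hta htb).mono inter_subset_left).const_mul _).const_mul _
  have hreal : ∀ t : ℝ, (t : ℂ) ∈ Complex.slitPlane ∩ {w : ℂ | -1 < w.re} →
      eulerIntegral a₀ a b (-(t : ℂ)) =
        Complex.Gamma (b - a) / Complex.Gamma a₀ *
          ((1 / (2 * π) : ℂ) * ∫ y : ℝ,
            Complex.Gamma (a₀ + (-(t₀ : ℂ) + (y : ℂ) * Complex.I)) * Complex.Gamma (a + (-(t₀ : ℂ) + (y : ℂ) * Complex.I)) *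
                Complex.Gamma (-(-(t₀ : ℂ) + (y : ℂ) * Complex.I)) /
                Complex.Gamma (b + (-(t₀ : ℂ) + (y : ℂ) * Complex.I)) *
              (t : ℂ) ^ (-(t₀ : ℂ) + (y : ℂ) * Complex.I)) := by
    intro t ht
    exact BarnesEulerIntegral.eulerIntegral_neg_eq_barnes (Complex.ofReal_mem_slitPlane.1 ht.1) ht₀ ht₀' hta hab
  have h1 : ((1 : ℝ) : ℂ) ∈ Complex.slitPlane ∩ {w : ℂ | -1 < w.re} := by
    refine ⟨Complex.ofReal_mem_slitPlane.2 one_pos, ?_⟩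
    simp
  exact Literature.Analysis.Complex.eqOn_of_isPreconnected_of_eq_ofReal isOpen_domain isPreconnected_domain h1 hf hg
    hreal ⟨hw, hw'⟩

end Literature.NumberTheory.Irrationality.Zudilin2004.BarnesEulerContinuation

end Part7

/-!
## Part 8 — port of `Summits/KontsevichZagierPeriods/Zeta5Search/BarnesEulerIntegralCut.lean` (7 declarations kept)

# Nesterenko's Lemma 2 on the cut `0 < z ≤ 1`, both branches `e^{±iπs}`

Declarations of this Part (verbatim port; each keeps its own docstring and citation): `tendsto_barnes_integral`, `norm_one_sub_mul_cpow_le`, `ae_ne_one`, `tendsto_eulerIntegral`, `tendsto_log_approach`, `eulerIntegral_pos_eq_barnes`, `barnes_exp_eq_Gamma`.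

Reference keys (see `references.bib` and the declarations' citations): [Zudilin2004].
-/

section Part8

namespace Literature.NumberTheory.Irrationality.Zudilin2004.BarnesEulerIntegralCut

open _root_.MeasureTheory _root_.Set _root_.Filter _root_.Metric
open scoped _root_.Real _root_.Topology
open Literature.Analysis.SpecialFunctions.Hypergeometric (eulerIntegrand eulerIntegral intervalIntegrable_eulerIntegrand
  intervalIntegrable_norm_betaIntegrand)
open Literature.NumberTheory.Irrationality.Zudilin2004.BarnesKernelBounds
open Literature.NumberTheory.Irrationality.Zudilin2004.BarnesEulerContinuation

variable {t₀ : ℝ} {a₀ a b : ℂ}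

/-! ### 1. The Barnes side: dominated convergence towards the cut -/

/-- **Barnes side, limit**: if `‖w_n‖ ≥ m > 0` and `log w_n → L`, then
`∫_ℝ K(y) w_n^{s} dy → ∫_ℝ K(y) e^{L s} dy` (`Re b > Re a₀ + Re a`; dominated by `‖K(y)‖e^{π|y|}m^{−t₀}`).
[cite: Zudilin2004, §4 (supporting lemma)] -/
theorem tendsto_barnes_integral (ht₀ : 0 < t₀) (ht₀' : t₀ < a₀.re) (hta : t₀ < a.re) (htb : t₀ < b.re)
    (hb : a₀.re + a.re < b.re) {m : ℝ} (hm : 0 < m) {w : ℕ → ℂ} (hwm : ∀ n, m ≤ ‖w n‖) {L : ℂ}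
    (hL : Tendsto (fun n => Complex.log (w n)) atTop (𝓝 L)) :
    Tendsto (fun n => ∫ y : ℝ,
        Complex.Gamma (a₀ + (-(t₀ : ℂ) + (y : ℂ) * Complex.I)) * Complex.Gamma (a + (-(t₀ : ℂ) + (y : ℂ) * Complex.I)) *
              Complex.Gamma (-(-(t₀ : ℂ) + (y : ℂ) * Complex.I)) /
            Complex.Gamma (b + (-(t₀ : ℂ) + (y : ℂ) * Complex.I)) *
          w n ^ (-(t₀ : ℂ) + (y : ℂ) * Complex.I))
      atTop (𝓝 (∫ y : ℝ,
        Complex.Gamma (a₀ + (-(t₀ : ℂ) + (y : ℂ) * Complex.I)) * Complex.Gamma (a + (-(t₀ : ℂ) + (y : ℂ) * Complex.I)) *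
              Complex.Gamma (-(-(t₀ : ℂ) + (y : ℂ) * Complex.I)) /
            Complex.Gamma (b + (-(t₀ : ℂ) + (y : ℂ) * Complex.I)) *
          Complex.exp (L * (-(t₀ : ℂ) + (y : ℂ) * Complex.I)))) := by
  have hw0 : ∀ n, w n ≠ 0 := fun n => norm_pos_iff.1 (lt_of_lt_of_le hm (hwm n))
  refine tendsto_integral_filter_of_dominated_convergence
    (fun y => ‖Complex.Gamma (a₀ + (-(t₀ : ℂ) + (y : ℂ) * Complex.I)) * Complex.Gamma (a + (-(t₀ : ℂ) + (y : ℂ) * Complex.I)) *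
              Complex.Gamma (-(-(t₀ : ℂ) + (y : ℂ) * Complex.I)) /
            Complex.Gamma (b + (-(t₀ : ℂ) + (y : ℂ) * Complex.I))‖ * Real.exp (π * |y|) * m ^ (-t₀))
    (Eventually.of_forall fun n => (continuous_integrand ht₀ ht₀' hta htb (hw0 n)).aestronglyMeasurable)
    (Eventually.of_forall fun n => Eventually.of_forall fun y => ?_)
    ((integrable_norm_kernel_mul_exp_pi ht₀ ht₀' hta htb hb).mul_const _) (Eventually.of_forall fun y => ?_)
  · have h := norm_cpow_line_le hm (hwm n) (Complex.abs_arg_le_pi _) ht₀.le y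
    rw [norm_mul]
    calc _ ≤ ‖Complex.Gamma (a₀ + (-(t₀ : ℂ) + (y : ℂ) * Complex.I)) * Complex.Gamma (a + (-(t₀ : ℂ) + (y : ℂ) * Complex.I)) *
              Complex.Gamma (-(-(t₀ : ℂ) + (y : ℂ) * Complex.I)) /
            Complex.Gamma (b + (-(t₀ : ℂ) + (y : ℂ) * Complex.I))‖ * (m ^ (-t₀) * Real.exp (π * |y|)) :=
          mul_le_mul_of_nonneg_left h (norm_nonneg _)
      _ = _ := by ring
  · have hcp : ∀ n, w n ^ (-(t₀ : ℂ) + (y : ℂ) * Complex.I) =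
        Complex.exp (Complex.log (w n) * (-(t₀ : ℂ) + (y : ℂ) * Complex.I)) := fun n =>
      Complex.cpow_def_of_ne_zero (hw0 n) _
    simp_rw [hcp]
    exact ((Complex.continuous_exp.tendsto _).comp (hL.mul tendsto_const_nhds)).const_mul _

/-! ### 2. The Euler side: dominated convergence towards the cut -/

/-- For `Re z ≤ 1`, `Re a₀ ≥ 0` and `t ∈ (0,1)`: `‖(1 − zt)^{−a₀}‖ ≤ e^{π|Im a₀|}(1 − t)^{−Re a₀}` (`|1 − zt| ≥ Re(1 − zt) ≥ 1 − t`).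
[cite: Zudilin2004, §4 (supporting lemma)] -/
theorem norm_one_sub_mul_cpow_le (ha₀ : 0 ≤ a₀.re) {z : ℂ} (hz : z.re ≤ 1) {t : ℝ} (ht : t ∈ Ioo (0 : ℝ) 1) :
    ‖(1 - z * (t : ℂ)) ^ (-a₀)‖ ≤ Real.exp (π * |a₀.im|) * (1 - t) ^ (-a₀.re) := by
  have ht1 : 0 < 1 - t := by linarith [ht.2]
  have hre : 1 - t ≤ (1 - z * (t : ℂ)).re := by
    have e : (1 - z * (t : ℂ)).re = 1 - z.re * t := by simp [Complex.mul_re]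
    rw [e]; nlinarith [ht.1]
  have hnorm : 1 - t ≤ ‖1 - z * (t : ℂ)‖ := le_trans hre (Complex.re_le_norm _)
  have hu : 1 - z * (t : ℂ) ≠ 0 := norm_pos_iff.1 (lt_of_lt_of_le ht1 hnorm)
  rw [Complex.norm_cpow_of_ne_zero hu, Complex.neg_re, Complex.neg_im, div_eq_mul_inv, ← Real.exp_neg, mul_comm]
  refine mul_le_mul ?_ (Real.rpow_le_rpow_of_nonpos ht1 hnorm (by linarith)) (Real.rpow_nonneg (norm_nonneg _) _)
    (Real.exp_pos _).le
  apply Real.exp_le_exp.2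
  calc -(Complex.arg (1 - z * (t : ℂ)) * -a₀.im) = Complex.arg (1 - z * (t : ℂ)) * a₀.im := by ring
    _ ≤ |Complex.arg (1 - z * (t : ℂ)) * a₀.im| := le_abs_self _
    _ = |Complex.arg (1 - z * (t : ℂ))| * |a₀.im| := abs_mul _ _
    _ ≤ π * |a₀.im| := mul_le_mul_of_nonneg_right (Complex.abs_arg_le_pi _) (abs_nonneg _)

/-- Off the endpoint `t = 1`: almost every real `t` is `≠ 1`. [cite: Zudilin2004, §4 (supporting lemma)] -/
theorem ae_ne_one : ∀ᵐ t : ℝ ∂volume, t ≠ 1 := by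
  rw [ae_iff]
  have h : {t : ℝ | ¬ t ≠ 1} = {1} := by ext t; simp
  rw [h, measure_singleton]

/-- **Euler side, limit**: if `z_n → x ∈ (0,1]` with `Re z_n < 1`, then `eulerIntegral a₀ a b z_n → eulerIntegral a₀ a b x`
(`Re a₀, Re a > 0`, `Re b > Re a₀ + Re a`; dominated by `e^{π|Im a₀|} t^{Re a−1}(1−t)^{Re(b−a₀−a)−1}`).
[cite: Zudilin2004, §4 (supporting lemma)] -/
theorem tendsto_eulerIntegral (ha₀ : 0 < a₀.re) (ha : 0 < a.re) (hb : a₀.re + a.re < b.re) {x : ℝ} (hx1 : x ≤ 1)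
    {z : ℕ → ℂ} (hz : Tendsto z atTop (𝓝 (x : ℂ))) (hz1 : ∀ n, (z n).re < 1) :
    Tendsto (fun n => eulerIntegral a₀ a b (z n)) atTop (𝓝 (eulerIntegral a₀ a b x)) := by
  have hab : a.re < b.re := by linarith
  unfold eulerIntegral
  refine intervalIntegral.tendsto_integral_filter_of_dominated_convergence
    (fun t => Real.exp (π * |a₀.im|) * ‖(t : ℂ) ^ (a - 1) * (1 - (t : ℂ)) ^ ((b - a₀) - a - 1)‖)
    (Eventually.of_forall fun n => (intervalIntegrable_eulerIntegrand a₀ ha hab (hz1 n)).def'.aestronglyMeasurable)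
    (Eventually.of_forall fun n => ?_) ((intervalIntegrable_norm_betaIntegrand ha (by simp; linarith)).const_mul _) ?_
  · filter_upwards [ae_ne_one] with t ht1 htI
    rw [uIoc_of_le zero_le_one] at htI
    have ht : t ∈ Ioo (0 : ℝ) 1 := ⟨htI.1, lt_of_le_of_ne htI.2 ht1⟩
    have ht1' : 0 < 1 - t := by linarith [ht.2]
    have hc := norm_one_sub_mul_cpow_le ha₀.le (hz1 n).le ht
    have e1 : ‖(1 - (t : ℂ)) ^ ((b - a₀) - a - 1)‖ = ‖(1 - (t : ℂ)) ^ (b - a - 1)‖ * (1 - t) ^ (-a₀.re) := by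
      rw [show (1 : ℂ) - (t : ℂ) = ((1 - t : ℝ) : ℂ) by push_cast; ring,
        Complex.norm_cpow_eq_rpow_re_of_pos ht1', Complex.norm_cpow_eq_rpow_re_of_pos ht1', ← Real.rpow_add ht1']
      congr 1; simp; ring
    unfold eulerIntegrand
    rw [norm_mul, norm_mul, norm_mul, e1]
    calc ‖(t : ℂ) ^ (a - 1)‖ * ‖(1 - (t : ℂ)) ^ (b - a - 1)‖ * ‖(1 - z n * (t : ℂ)) ^ (-a₀)‖
        ≤ ‖(t : ℂ) ^ (a - 1)‖ * ‖(1 - (t : ℂ)) ^ (b - a - 1)‖ * (Real.exp (π * |a₀.im|) * (1 - t) ^ (-a₀.re)) :=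
          mul_le_mul_of_nonneg_left hc (by positivity)
      _ = _ := by ring
  · filter_upwards [ae_ne_one] with t ht1 htI
    rw [uIoc_of_le zero_le_one] at htI
    have ht : t < 1 := lt_of_le_of_ne htI.2 ht1
    have hslit : (1 : ℂ) - (x : ℂ) * (t : ℂ) ∈ Complex.slitPlane := by
      rw [show (1 : ℂ) - (x : ℂ) * (t : ℂ) = ((1 - x * t : ℝ) : ℂ) by push_cast; ring]
      refine Complex.ofReal_mem_slitPlane.2 ?_
      nlinarith [htI.1]
    have hcont : Tendsto (fun n => (1 - z n * (t : ℂ)) ^ (-a₀)) atTop (𝓝 ((1 - (x : ℂ) * (t : ℂ)) ^ (-a₀))) :=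
      ((continuousAt_cpow_const (b := -a₀) hslit).tendsto).comp
        (tendsto_const_nhds.sub (hz.mul tendsto_const_nhds))
    unfold eulerIntegrand
    exact hcont.const_mul _

/-! ### 3. The approach `w_n → −x` from the side `sign ε` -/

/-- **The logarithm along the approach**: if `w_n → −x` (`x > 0`) with `ε · Im w_n ≥ 0` … precisely, with `Im w_n ≥ 0` for
`ε = 1` and `Im w_n < 0` for `ε = −1`, then `log w_n → log x + iεπ`. [cite: Zudilin2004, §4 (supporting lemma)] -/
theorem tendsto_log_approach {x : ℝ} (hx : 0 < x) {ε : ℝ} (hε : ε = 1 ∨ ε = -1) {w : ℕ → ℂ}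
    (hw : Tendsto w atTop (𝓝 (-(x : ℂ)))) (hside : ∀ n, (ε = 1 → 0 ≤ (w n).im) ∧ (ε = -1 → (w n).im < 0)) :
    Tendsto (fun n => Complex.log (w n)) atTop (𝓝 ((Real.log x : ℂ) + ε * π * Complex.I)) := by
  have hre : (-(x : ℂ)).re < 0 := by simp [hx]
  have him : (-(x : ℂ)).im = 0 := by simp
  -- the modulus
  have hnorm : Tendsto (fun n => Real.log ‖w n‖) atTop (𝓝 (Real.log x)) := by
    have h1 : Tendsto (fun n => ‖w n‖) atTop (𝓝 x) := by
      have := hw.norm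
      rwa [norm_neg, Complex.norm_real, Real.norm_eq_abs, abs_of_pos hx] at this
    exact (Real.continuousAt_log hx.ne').tendsto.comp h1
  -- the argument
  have harg : Tendsto (fun n => Complex.arg (w n)) atTop (𝓝 (ε * π)) := by
    rcases hε with h | h
    · subst h
      have hin : Tendsto w atTop (𝓝[{z : ℂ | 0 ≤ z.im}] (-(x : ℂ))) :=
        tendsto_nhdsWithin_iff.2 ⟨hw, Eventually.of_forall fun n => (hside n).1 rfl⟩
      have := (Complex.tendsto_arg_nhdsWithin_im_nonneg_of_re_neg_of_im_zero hre him).comp hin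
      rw [one_mul]
      exact this
    · subst h
      have hin : Tendsto w atTop (𝓝[{z : ℂ | z.im < 0}] (-(x : ℂ))) :=
        tendsto_nhdsWithin_iff.2 ⟨hw, Eventually.of_forall fun n => (hside n).2 rfl⟩
      have := (Complex.tendsto_arg_nhdsWithin_im_neg_of_re_neg_of_im_zero hre him).comp hin
      rw [neg_one_mul]
      exact this
  have hlog : ∀ n, Complex.log (w n) = ((Real.log ‖w n‖ : ℝ) : ℂ) + ((Complex.arg (w n) : ℝ) : ℂ) * Complex.I := by
    intro n
    apply Complex.ext <;> simp [Complex.log_re, Complex.log_im]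
  simp_rw [hlog]
  have h2 : Tendsto (fun n => ((Complex.arg (w n) : ℝ) : ℂ) * Complex.I) atTop (𝓝 (((ε * π : ℝ) : ℂ) * Complex.I)) :=
    ((Complex.continuous_ofReal.tendsto _).comp harg).mul tendsto_const_nhds
  have h1 : Tendsto (fun n => ((Real.log ‖w n‖ : ℝ) : ℂ)) atTop (𝓝 ((Real.log x : ℝ) : ℂ)) :=
    (Complex.continuous_ofReal.tendsto _).comp hnorm
  have := h1.add h2
  push_cast at this
  exact this

/-! ### 4. Lemma 2 on the cut -/

/-- **Nesterenko's Lemma 2 on the cut** [Zudilin math/0206177, Lemma 2; Nesterenko 2003, §3.2]: for real `0 < x ≤ 1`,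
complex `a₀, a, b`, a real `t₀` with `0 < t₀ < Re a₀`, `t₀ < Re a`, `Re a₀ + Re a < Re b`, and a sign `ε = ±1`,
`eulerIntegral a₀ a b x = ∫₀¹ t^{a−1}(1−t)^{b−a−1}(1−xt)^{−a₀} dt
  = Γ(b−a)/Γ(a₀) · (1/2π) ∫_ℝ Γ(a₀+s)Γ(a+s)Γ(−s)/Γ(b+s) · x^{s} e^{iεπs} dy`, `s = −t₀+iy`
(principal `cpow` of the positive real base `x`; the printed `(−z)^{s}` with `arg(−z) = επ`; both branches hold).
[cite: Zudilin2004, §4 (supporting lemma)] -/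
theorem eulerIntegral_pos_eq_barnes (ht₀ : 0 < t₀) (ht₀' : t₀ < a₀.re) (hta : t₀ < a.re) (hb : a₀.re + a.re < b.re)
    {x : ℝ} (hx : 0 < x) (hx1 : x ≤ 1) {ε : ℝ} (hε : ε = 1 ∨ ε = -1) :
    eulerIntegral a₀ a b x =
      Complex.Gamma (b - a) / Complex.Gamma a₀ *
        ((1 / (2 * π) : ℂ) * ∫ y : ℝ,
          Complex.Gamma (a₀ + (-(t₀ : ℂ) + (y : ℂ) * Complex.I)) * Complex.Gamma (a + (-(t₀ : ℂ) + (y : ℂ) * Complex.I)) *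
              Complex.Gamma (-(-(t₀ : ℂ) + (y : ℂ) * Complex.I)) /
              Complex.Gamma (b + (-(t₀ : ℂ) + (y : ℂ) * Complex.I)) *
            ((x : ℂ) ^ (-(t₀ : ℂ) + (y : ℂ) * Complex.I) * Complex.exp (ε * π * Complex.I * (-(t₀ : ℂ) + (y : ℂ) * Complex.I)))) := by
  have ha₀ : 0 < a₀.re := lt_trans ht₀ ht₀'
  have ha : 0 < a.re := lt_trans ht₀ hta
  have hab : a.re < b.re := by linarith
  have htb : t₀ < b.re := lt_trans hta hab
  have hε2 : ε ^ 2 = 1 := by rcases hε with h | h <;> simp [h]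
  -- the approach sequence
  set r : ℕ → ℝ := fun n => 1 / ((n : ℝ) + 1) with hr
  set w : ℕ → ℂ := fun n => ((-(x * (1 - r n)) : ℝ) : ℂ) + ((x * ε * r n : ℝ) : ℂ) * Complex.I with hw
  have hr0 : ∀ n, 0 < r n := fun n => by rw [hr]; positivity
  have hr1 : ∀ n, r n ≤ 1 := fun n => by
    rw [hr]; simp only; rw [div_le_one (by positivity)]; linarith [n.cast_nonneg (α := ℝ)]
  have hwre : ∀ n, (w n).re = -(x * (1 - r n)) := fun n => by simp [hw]
  have hwim : ∀ n, (w n).im = x * ε * r n := fun n => by simp [hw]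
  have hr_lim : Tendsto r atTop (𝓝 0) := tendsto_one_div_add_atTop_nhds_zero_nat
  have hw_lim : Tendsto w atTop (𝓝 (-(x : ℂ))) := by
    have h1 : Tendsto (fun n => ((-(x * (1 - r n)) : ℝ) : ℂ)) atTop (𝓝 (((-(x * (1 - 0))) : ℝ) : ℂ)) :=
      (Complex.continuous_ofReal.tendsto _).comp ((tendsto_const_nhds.sub hr_lim).const_mul x).neg
    have h2 : Tendsto (fun n => ((x * ε * r n : ℝ) : ℂ) * Complex.I) atTop (𝓝 (((x * ε * 0 : ℝ) : ℂ) * Complex.I)) :=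
      ((Complex.continuous_ofReal.tendsto _).comp (hr_lim.const_mul (x * ε))).mul tendsto_const_nhds
    have := h1.add h2
    simpa [hw] using this
  have hwnorm : ∀ n, x / 2 ≤ ‖w n‖ := by
    intro n
    have hsq : (x / 2) ^ 2 ≤ ‖w n‖ ^ 2 := by
      rw [Complex.sq_norm, Complex.normSq_apply, hwre, hwim]
      have key : -(x * (1 - r n)) * -(x * (1 - r n)) + x * ε * r n * (x * ε * r n) =
          x ^ 2 * ((1 - r n) ^ 2 + ε ^ 2 * r n ^ 2) := by ring
      have h2 : 1 / 2 ≤ (1 - r n) ^ 2 + ε ^ 2 * r n ^ 2 := by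
        rw [hε2]; nlinarith [sq_nonneg (r n - 1 / 2)]
      rw [key]
      nlinarith [mul_le_mul_of_nonneg_left h2 (sq_nonneg x)]
    exact (pow_le_pow_iff_left₀ (by positivity) (norm_nonneg _) two_ne_zero).1 hsq
  have hwslit : ∀ n, w n ∈ Complex.slitPlane := fun n => by
    refine Complex.mem_slitPlane_iff.2 (Or.inr ?_)
    rw [hwim]
    have : ε ≠ 0 := by rcases hε with h | h <;> simp [h]
    exact mul_ne_zero (mul_ne_zero hx.ne' this) (hr0 n).ne'
  have hwre' : ∀ n, -1 < (w n).re := fun n => by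
    rw [hwre]; nlinarith [hr0 n, hr1 n, hx, hx1]
  have hside : ∀ n, (ε = 1 → 0 ≤ (w n).im) ∧ (ε = -1 → (w n).im < 0) := fun n => by
    refine ⟨fun h => ?_, fun h => ?_⟩ <;> rw [hwim, h]
    · positivity
    · have := mul_pos hx (hr0 n); linarith
  -- the identity along the sequence
  have hid : ∀ n, eulerIntegral a₀ a b (-(w n)) =
      Complex.Gamma (b - a) / Complex.Gamma a₀ *
        ((1 / (2 * π) : ℂ) * ∫ y : ℝ,
          Complex.Gamma (a₀ + (-(t₀ : ℂ) + (y : ℂ) * Complex.I)) * Complex.Gamma (a + (-(t₀ : ℂ) + (y : ℂ) * Complex.I)) *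
              Complex.Gamma (-(-(t₀ : ℂ) + (y : ℂ) * Complex.I)) /
              Complex.Gamma (b + (-(t₀ : ℂ) + (y : ℂ) * Complex.I)) *
            w n ^ (-(t₀ : ℂ) + (y : ℂ) * Complex.I)) := fun n =>
    eulerIntegral_neg_eq_barnes_of_mem ht₀ ht₀' hta hab (hwslit n) (hwre' n)
  -- the two limits
  have hE : Tendsto (fun n => eulerIntegral a₀ a b (-(w n))) atTop (𝓝 (eulerIntegral a₀ a b x)) := by
    refine tendsto_eulerIntegral ha₀ ha hb hx1 (by simpa using hw_lim.neg) fun n => ?_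
    simp only [Complex.neg_re, hwre, neg_neg]
    nlinarith [hr0 n, hx]
  set L : ℂ := (Real.log x : ℂ) + ε * π * Complex.I with hL
  have hlog : Tendsto (fun n => Complex.log (w n)) atTop (𝓝 L) := tendsto_log_approach hx hε hw_lim hside
  have hB := ((tendsto_barnes_integral ht₀ ht₀' hta htb hb (by positivity : 0 < x / 2) hwnorm hlog).const_mul
    ((1 / (2 * π) : ℂ))).const_mul (Complex.Gamma (b - a) / Complex.Gamma a₀)
  have heq := tendsto_nhds_unique hE (by simpa only [hid] using hB)
  have hxc : (x : ℂ) ≠ 0 := by exact_mod_cast hx.ne'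
  have hint : (∫ y : ℝ,
        Complex.Gamma (a₀ + (-(t₀ : ℂ) + (y : ℂ) * Complex.I)) * Complex.Gamma (a + (-(t₀ : ℂ) + (y : ℂ) * Complex.I)) *
              Complex.Gamma (-(-(t₀ : ℂ) + (y : ℂ) * Complex.I)) /
            Complex.Gamma (b + (-(t₀ : ℂ) + (y : ℂ) * Complex.I)) *
          Complex.exp (L * (-(t₀ : ℂ) + (y : ℂ) * Complex.I))) =
      ∫ y : ℝ,
        Complex.Gamma (a₀ + (-(t₀ : ℂ) + (y : ℂ) * Complex.I)) * Complex.Gamma (a + (-(t₀ : ℂ) + (y : ℂ) * Complex.I)) *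
              Complex.Gamma (-(-(t₀ : ℂ) + (y : ℂ) * Complex.I)) /
            Complex.Gamma (b + (-(t₀ : ℂ) + (y : ℂ) * Complex.I)) *
          ((x : ℂ) ^ (-(t₀ : ℂ) + (y : ℂ) * Complex.I) *
            Complex.exp (ε * π * Complex.I * (-(t₀ : ℂ) + (y : ℂ) * Complex.I))) := by
    refine integral_congr_ae (Eventually.of_forall fun y => ?_)
    simp only
    rw [Complex.cpow_def_of_ne_zero hxc, ← Complex.ofReal_log hx.le, ← Complex.exp_add, hL]
    congr 2
    ring
  rw [heq, hint]

/-- **The Barnes integral at `z = 1` in closed form** (the inner `t`-integral of Zudilin's (14)): for complex `a₀, a, b`,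
real `0 < t₀ < Re a₀`, `t₀ < Re a`, `Re a₀ + Re a < Re b` and `ε = ±1`,
`(1/2π) ∫_ℝ Γ(a₀+s)Γ(a+s)Γ(−s)/Γ(b+s) e^{iεπs} dy = Γ(a₀)Γ(a)Γ(b−a−a₀)/(Γ(b−a)Γ(b−a₀))`, `s = −t₀+iy`
(Lemma 2 at `x = 1`, where the Euler integral is the Beta integral `B(a, b−a−a₀)`).
[cite: Zudilin2004, §4 (supporting lemma)] -/
theorem barnes_exp_eq_Gamma (ht₀ : 0 < t₀) (ht₀' : t₀ < a₀.re) (hta : t₀ < a.re) (hb : a₀.re + a.re < b.re)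
    {ε : ℝ} (hε : ε = 1 ∨ ε = -1) :
    (1 / (2 * π) : ℂ) * ∫ y : ℝ,
        Complex.Gamma (a₀ + (-(t₀ : ℂ) + (y : ℂ) * Complex.I)) * Complex.Gamma (a + (-(t₀ : ℂ) + (y : ℂ) * Complex.I)) *
            Complex.Gamma (-(-(t₀ : ℂ) + (y : ℂ) * Complex.I)) /
            Complex.Gamma (b + (-(t₀ : ℂ) + (y : ℂ) * Complex.I)) *
          Complex.exp (ε * π * Complex.I * (-(t₀ : ℂ) + (y : ℂ) * Complex.I)) =
      Complex.Gamma a₀ * Complex.Gamma a * Complex.Gamma (b - a - a₀) / (Complex.Gamma (b - a) * Complex.Gamma (b - a₀)) := by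
  have ha₀ : 0 < a₀.re := lt_trans ht₀ ht₀'
  have ha : 0 < a.re := lt_trans ht₀ hta
  have h := eulerIntegral_pos_eq_barnes ht₀ ht₀' hta hb one_pos le_rfl hε
  simp only [Complex.ofReal_one, Complex.one_cpow, one_mul] at h
  -- the Euler integral at `x = 1` is a Beta integral
  have hE : eulerIntegral a₀ a b 1 = Complex.Gamma a * Complex.Gamma (b - a - a₀) / Complex.Gamma (b - a₀) := by
    unfold eulerIntegral
    rw [intervalIntegral.integral_of_le zero_le_one, integral_Ioc_eq_integral_Ioo]
    have hpt : ∀ t ∈ Ioo (0 : ℝ) 1, eulerIntegrand a₀ a b 1 t = (t : ℂ) ^ (a - 1) * (1 - (t : ℂ)) ^ ((b - a - a₀) - 1) := by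
      intro t ht
      have ht1 : (1 : ℂ) - (t : ℂ) ≠ 0 := by
        rw [show (1 : ℂ) - (t : ℂ) = ((1 - t : ℝ) : ℂ) by push_cast; ring]
        exact_mod_cast (by linarith [ht.2] : (1 - t : ℝ) ≠ 0)
      unfold eulerIntegrand
      rw [one_mul, mul_assoc, ← Complex.cpow_add _ _ ht1]
      congr 2; ring
    rw [setIntegral_congr_fun measurableSet_Ioo hpt,
      Literature.NumberTheory.Irrationality.BrownZudilin2022.BarnesCube.integral_beta_Ioo (u := a) (v := b - a - a₀) ha (by simp; linarith)]
    congr 2; ring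
  have hc : Complex.Gamma (b - a) / Complex.Gamma a₀ ≠ 0 :=
    div_ne_zero (Complex.Gamma_ne_zero_of_re_pos (by simp; linarith)) (Complex.Gamma_ne_zero_of_re_pos ha₀)
  have hΓ₁ : Complex.Gamma (b - a) ≠ 0 := Complex.Gamma_ne_zero_of_re_pos (by simp; linarith)
  have hΓ₂ : Complex.Gamma a₀ ≠ 0 := Complex.Gamma_ne_zero_of_re_pos ha₀
  have hΓ₃ : Complex.Gamma (b - a₀) ≠ 0 := Complex.Gamma_ne_zero_of_re_pos (by simp; linarith)
  rw [hE] at h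
  rw [← mul_right_inj' hc, ← h]
  field_simp

end Literature.NumberTheory.Irrationality.Zudilin2004.BarnesEulerIntegralCut

end Part8

/-!
## Part 9 — port of `Summits/KontsevichZagierPeriods/Zeta5Search/SorokinFirstVariable.lean` (6 declarations kept)

# Zudilin's `J_{k+1}` at complex parameters: peeling the first variable

Declarations of this Part (verbatim port; each keeps its own docstring and citation): `cube_eq_preimage_zero`, `piFinSuccAbove_zero_symm`, `integrand_cons`, `setIntegral_succ_eq_first`, `norm_bracket`, `fibre_eq_first`.

Reference keys (see `references.bib` and the declarations' citations): [Zudilin2004].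
-/

section Part9

namespace Literature.NumberTheory.Irrationality.Zudilin2004.SorokinFirstVariable

open _root_.MeasureTheory _root_.Set _root_.Filter
open scoped _root_.Real
open Literature.NumberTheory.Irrationality.Zudilin2002 (nestedQ sorokinIntegrand)
open Literature.Analysis.SpecialFunctions.Hypergeometric (eulerIntegrand eulerIntegral)
open Literature.NumberTheory.Irrationality.Zudilin2004.SorokinIntegrandBounds

variable {t₀ : ℝ} {a₀ : ℂ} {a b : ℕ → ℂ}

/-! ### 1. Splitting off the first variable -/

/-- The closed cube `[0,1]^{k+1}` is the preimage of `[0,1] × [0,1]^k` under `x ↦ (x_0, (x_1,…,x_k))`.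
[cite: Zudilin2004, §4 (supporting lemma)] -/
theorem cube_eq_preimage_zero (k : ℕ) :
    (Set.pi univ fun _ : Fin (k + 1) => Icc (0 : ℝ) 1) =
      MeasurableEquiv.piFinSuccAbove (fun _ => ℝ) 0 ⁻¹'
        (Icc (0 : ℝ) 1 ×ˢ Set.pi univ fun _ : Fin k => Icc (0 : ℝ) 1) := by
  ext x
  simp only [Set.mem_preimage, Set.mem_prod, Set.mem_univ_pi]
  rw [Fin.forall_fin_succ]
  simp [MeasurableEquiv.piFinSuccAbove_apply, Fin.tail]

/-- The inverse of that equivalence is `Fin.cons`. [cite: Zudilin2004, §4 (supporting lemma)] -/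
theorem piFinSuccAbove_zero_symm (k : ℕ) (t : ℝ) (x' : Fin k → ℝ) :
    (MeasurableEquiv.piFinSuccAbove (fun _ => ℝ) (0 : Fin (k + 1))).symm (t, x') = Fin.cons t x' := by
  simp [MeasurableEquiv.piFinSuccAbove_symm_apply, Fin.consEquiv]

/-- **Pointwise, on a fibre**: the integrand of `J_{k+1}(a₀; a | b)` at `Fin.cons t x'` is
`[∏_{j<k} x'_j^{a_{j+1}−1}(1−x'_j)^{b_{j+1}−a_{j+1}−1}] · t^{a_0−1}(1−t)^{b_0−a_0−1}(1 − Q_k(x')·t)^{−a₀}`, i.e. that product times the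
tree's `eulerIntegrand a₀ a_0 b_0 (Q_k x') t` (first recursion of (3): `Q_{k+1}(t,x') = 1 − t·Q_k(x')`).
[cite: Zudilin2004, §4 (supporting lemma)] -/
theorem integrand_cons (k : ℕ) (a₀ : ℂ) (a b : ℕ → ℂ) (x' : Fin k → ℝ) (t : ℝ) :
    (∏ j : Fin (k + 1), (((Fin.cons t x' : Fin (k + 1) → ℝ) j : ℝ) : ℂ) ^ (a j - 1) *
          (1 - (((Fin.cons t x' : Fin (k + 1) → ℝ) j : ℝ) : ℂ)) ^ (b j - a j - 1)) *
        ((nestedQ (List.ofFn (Fin.cons t x' : Fin (k + 1) → ℝ)) : ℝ) : ℂ) ^ (-a₀) =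
      (∏ j : Fin k, ((x' j : ℝ) : ℂ) ^ (a (j + 1) - 1) * (1 - ((x' j : ℝ) : ℂ)) ^ (b (j + 1) - a (j + 1) - 1)) *
        eulerIntegrand a₀ (a 0) (b 0) ((nestedQ (List.ofFn x') : ℝ) : ℂ) t := by
  rw [Fin.prod_univ_succ, nestedQ_ofFn_cons, eulerIntegrand]
  simp only [Fin.cons_zero, Fin.cons_succ, Fin.val_zero, Fin.val_succ]
  push_cast
  ring

/-- **`J_{k+1}` as a `k`-fold integral of an Euler integral, first variable**: if the integrand `F` of `J_{k+1}(a₀; a | b)` is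
integrable on `[0,1]^{k+1}`, then
`∫_{[0,1]^{k+1}} F = ∫_{[0,1]^k} ∏_{j<k} x'_j^{a_{j+1}−1}(1−x'_j)^{b_{j+1}−a_{j+1}−1} · eulerIntegral a₀ a_0 b_0 (Q_k x') dx'`
(transfer along `x ↦ (x_0, tail x)`, Fubini, `integrand_cons`). [cite: Zudilin2004, §4 (supporting lemma)] -/
theorem setIntegral_succ_eq_first (k : ℕ) (a₀ : ℂ) (a b : ℕ → ℂ)
    (hF : IntegrableOn (fun x : Fin (k + 1) → ℝ =>
      (∏ j : Fin (k + 1), ((x j : ℝ) : ℂ) ^ (a j - 1) * (1 - ((x j : ℝ) : ℂ)) ^ (b j - a j - 1)) *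
        ((nestedQ (List.ofFn x) : ℝ) : ℂ) ^ (-a₀)) (Set.pi univ fun _ : Fin (k + 1) => Icc (0 : ℝ) 1) volume) :
    ∫ x in Set.pi univ (fun _ : Fin (k + 1) => Icc (0 : ℝ) 1),
        (∏ j : Fin (k + 1), ((x j : ℝ) : ℂ) ^ (a j - 1) * (1 - ((x j : ℝ) : ℂ)) ^ (b j - a j - 1)) *
          ((nestedQ (List.ofFn x) : ℝ) : ℂ) ^ (-a₀) =
      ∫ x' in Set.pi univ (fun _ : Fin k => Icc (0 : ℝ) 1),
        (∏ j : Fin k, ((x' j : ℝ) : ℂ) ^ (a (j + 1) - 1) * (1 - ((x' j : ℝ) : ℂ)) ^ (b (j + 1) - a (j + 1) - 1)) *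
          eulerIntegral a₀ (a 0) (b 0) ((nestedQ (List.ofFn x') : ℝ) : ℂ) := by
  set F : (Fin (k + 1) → ℝ) → ℂ := fun x =>
    (∏ j : Fin (k + 1), ((x j : ℝ) : ℂ) ^ (a j - 1) * (1 - ((x j : ℝ) : ℂ)) ^ (b j - a j - 1)) *
      ((nestedQ (List.ofFn x) : ℝ) : ℂ) ^ (-a₀) with hFdef
  set e := MeasurableEquiv.piFinSuccAbove (fun _ : Fin (k + 1) => ℝ) 0 with hedef
  set S : Set (ℝ × (Fin k → ℝ)) := Icc (0 : ℝ) 1 ×ˢ Set.pi univ fun _ : Fin k => Icc (0 : ℝ) 1 with hSdef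
  set G : ℝ × (Fin k → ℝ) → ℂ := fun p => F (e.symm p) with hGdef
  have hmp : MeasurePreserving e volume volume := volume_preserving_piFinSuccAbove (fun _ : Fin (k + 1) => ℝ) 0
  have hcube := cube_eq_preimage_zero k
  -- (1) transfer the integral and the integrability along `e`
  have key := hmp.setIntegral_preimage_emb e.measurableEmbedding G S
  have hGe : (fun x => G (e x)) = F := by funext x; simp [hGdef]
  rw [hGe, ← hcube] at key
  change ∫ x in Set.pi univ (fun _ : Fin (k + 1) => Icc (0 : ℝ) 1), F x = _
  rw [key]
  have hGint : Integrable G ((volume : Measure (ℝ × (Fin k → ℝ))).restrict S) := by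
    have h := (hmp.restrict_preimage_emb e.measurableEmbedding S).integrable_comp_emb e.measurableEmbedding (g := G)
    rw [← hcube] at h
    have hGF : G ∘ e = F := by funext x; simp [hGdef]
    rw [hGF] at h
    exact h.1 hF
  rw [Measure.volume_eq_prod, ← Measure.prod_restrict] at hGint ⊢
  -- (2) Fubini, integrating over `t` first
  rw [integral_prod_symm G hGint]
  refine integral_congr_ae (Eventually.of_forall fun x' => ?_)
  simp only
  have hGx : (fun t => G (t, x')) = fun t => F (Fin.cons t x') := by
    funext t; rw [hGdef]; simp only [hedef, piFinSuccAbove_zero_symm]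
  rw [hGx]
  have hpt : ∀ t ∈ Icc (0 : ℝ) 1, F (Fin.cons t x') =
      (∏ j : Fin k, ((x' j : ℝ) : ℂ) ^ (a (j + 1) - 1) * (1 - ((x' j : ℝ) : ℂ)) ^ (b (j + 1) - a (j + 1) - 1)) *
        eulerIntegrand a₀ (a 0) (b 0) ((nestedQ (List.ofFn x') : ℝ) : ℂ) t := fun t _ => by
    rw [hFdef]
    exact integrand_cons k a₀ a b x' t
  rw [setIntegral_congr_fun measurableSet_Icc hpt, integral_const_mul, eulerIntegral,
    intervalIntegral.integral_of_le zero_le_one, integral_Icc_eq_integral_Ioc]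

/-! ### 2. The fibre identity (Lemma 2 on the cut) -/

/-- On the open cube, the norm of the bracket `∏'(x')·Q_k(x')^{−(−s)}` is the TYPED real `J_k`-integrand at
`(t₀; Re a_{j+1} | Re b_{j+1})` (`s = −t₀ + iy`). [cite: Zudilin2004, §4 (supporting lemma)] -/
theorem norm_bracket {k : ℕ} (a b : ℕ → ℂ) (t₀ y : ℝ) {x : Fin k → ℝ} (hx : ∀ j, x j ∈ Ioo (0 : ℝ) 1) :
    ‖(∏ j : Fin k, ((x j : ℝ) : ℂ) ^ (a (j + 1) - 1) * (1 - ((x j : ℝ) : ℂ)) ^ (b (j + 1) - a (j + 1) - 1)) *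
        ((nestedQ (List.ofFn x) : ℝ) : ℂ) ^ (-(-(-(t₀ : ℂ) + (y : ℂ) * Complex.I)))‖ =
      sorokinIntegrand k t₀ (fun n => (a (n + 1)).re) (fun n => (b (n + 1)).re) x := by
  have h := SorokinLastVariable.norm_integrand k (-(-(t₀ : ℂ) + (y : ℂ) * Complex.I)) (fun n => a (n + 1)) (fun n => b (n + 1)) hx
  have e0 : (-(-(t₀ : ℂ) + (y : ℂ) * Complex.I)).re = t₀ := by simp
  rw [e0] at h
  exact h

/-- **The fibre identity, first variable** [Zudilin math/0206177, Lemma 2 = Nesterenko's, on the cut]: for `k ≥ 1`, `x'` in the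
open cube, complex `a₀, a_j, b_j`, real `t₀` `0 < t₀ < Re a₀`, `t₀ < Re a_0`, CUT CONDITION `Re a₀ + Re a_0 < Re b_0`,
`ε = ±1`:
`∏'(x') · eulerIntegral a₀ a_0 b_0 (Q_k x') = Γ(b_0−a_0)/Γ(a₀) · (1/2π) ∫ Γ(a₀+s)Γ(a_0+s)Γ(−s)/Γ(b_0+s) · e^{iεπs} · [∏'(x')·Q_k(x')^{−(−s)}] dy`.
[cite: Zudilin2004, §4 (supporting lemma)] -/
theorem fibre_eq_first {k : ℕ} (hk : 1 ≤ k) (ht₀ : 0 < t₀) (ht₀' : t₀ < a₀.re) (hta : t₀ < (a 0).re)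
    (hb : a₀.re + (a 0).re < (b 0).re) {x : Fin k → ℝ} (hx : ∀ j, x j ∈ Ioo (0 : ℝ) 1) {ε : ℝ} (hε : ε = 1 ∨ ε = -1) :
    (∏ j : Fin k, ((x j : ℝ) : ℂ) ^ (a (j + 1) - 1) * (1 - ((x j : ℝ) : ℂ)) ^ (b (j + 1) - a (j + 1) - 1)) *
        eulerIntegral a₀ (a 0) (b 0) ((nestedQ (List.ofFn x) : ℝ) : ℂ) =
      Complex.Gamma (b 0 - a 0) / Complex.Gamma a₀ *
        ((1 / (2 * π) : ℂ) * ∫ y : ℝ,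
          Complex.Gamma (a₀ + (-(t₀ : ℂ) + (y : ℂ) * Complex.I)) * Complex.Gamma (a 0 + (-(t₀ : ℂ) + (y : ℂ) * Complex.I)) *
                Complex.Gamma (-(-(t₀ : ℂ) + (y : ℂ) * Complex.I)) /
                Complex.Gamma (b 0 + (-(t₀ : ℂ) + (y : ℂ) * Complex.I)) *
              Complex.exp (ε * π * Complex.I * (-(t₀ : ℂ) + (y : ℂ) * Complex.I)) *
            ((∏ j : Fin k, ((x j : ℝ) : ℂ) ^ (a (j + 1) - 1) * (1 - ((x j : ℝ) : ℂ)) ^ (b (j + 1) - a (j + 1) - 1)) *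
              ((nestedQ (List.ofFn x) : ℝ) : ℂ) ^ (-(-(-(t₀ : ℂ) + (y : ℂ) * Complex.I))))) := by
  have hQ := nestedQ_ofFn_mem_Ioo hk hx
  rw [BarnesEulerIntegralCut.eulerIntegral_pos_eq_barnes ht₀ ht₀' hta hb hQ.1 hQ.2.le hε, ← mul_assoc,
    mul_comm _ (Complex.Gamma (b 0 - a 0) / Complex.Gamma a₀), mul_assoc, ← mul_assoc _ (1 / (2 * π) : ℂ),
    mul_comm _ (1 / (2 * π) : ℂ), mul_assoc, ← integral_const_mul]
  congr 2
  refine integral_congr_ae (Eventually.of_forall fun y => ?_)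
  simp only [neg_neg]
  ring

end Literature.NumberTheory.Irrationality.Zudilin2004.SorokinFirstVariable

end Part9

/-!
## Part 10 — port of `Summits/KontsevichZagierPeriods/Zeta5Search/SorokinLemma3.lean` (1 declarations kept)

# Zudilin's Lemma 3: `J_{k+1}` as a Barnes integral of `J_k` at shifted complex parameters

Declarations of this Part (verbatim port; each keeps its own docstring and citation): `norm_phase_le`.

Reference keys (see `references.bib` and the declarations' citations): [Zudilin2004].
-/

section Part10

namespace Literature.NumberTheory.Irrationality.Zudilin2004.SorokinLemma3

open _root_.MeasureTheory _root_.Set _root_.Filter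
open scoped _root_.Real
open Literature.NumberTheory.Irrationality.Zudilin2002 (nestedQ sorokinIntegrand)
open Literature.Analysis.SpecialFunctions.Hypergeometric (eulerIntegral)
open Literature.NumberTheory.Irrationality.Zudilin2004.SorokinIntegrandBounds
open Literature.NumberTheory.Irrationality.Zudilin2004.BarnesKernelBounds
open Literature.NumberTheory.Irrationality.Zudilin2004.SorokinLastVariable

variable {t₀ : ℝ} {a₀ : ℂ} {a b : ℕ → ℂ}

/-- The phase `e^{iεπs}`, `s = −t₀+iy`, `|ε| ≤ 1`, has modulus `e^{−επy} ≤ e^{π|y|}`.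
[cite: Zudilin2004, §4 (supporting lemma)] -/
theorem norm_phase_le {ε : ℝ} (hε : |ε| ≤ 1) (t₀ y : ℝ) :
    ‖Complex.exp (ε * π * Complex.I * (-(t₀ : ℂ) + (y : ℂ) * Complex.I))‖ ≤ Real.exp (π * |y|) := by
  rw [Complex.norm_exp]
  apply Real.exp_le_exp.2
  have hre : ((ε : ℂ) * π * Complex.I * (-(t₀ : ℂ) + (y : ℂ) * Complex.I)).re = -(ε * (π * y)) := by
    simp [Complex.mul_re, Complex.mul_im]; ring
  rw [hre]
  calc -(ε * (π * y)) ≤ |ε * (π * y)| := neg_le_abs _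
    _ = |ε| * (π * |y|) := by rw [abs_mul, abs_mul, abs_of_pos Real.pi_pos]
    _ ≤ 1 * (π * |y|) := mul_le_mul_of_nonneg_right hε (by positivity)
    _ = π * |y| := one_mul _

end Literature.NumberTheory.Irrationality.Zudilin2004.SorokinLemma3

end Part10

/-!
## Part 11 — port of `Summits/KontsevichZagierPeriods/Zeta5Search/SorokinLemma3First.lean` (3 declarations kept)

# Lemma 3' : the first-variable recursion for Zudilin's `J_k` as a Barnes integral

Declarations of this Part (verbatim port; each keeps its own docstring and citation): `measurable_joint_first`, `integrable_joint_first`, `lemma3_first`.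

Reference keys (see `references.bib` and the declarations' citations): [Zudilin2004].
-/

section Part11

namespace Literature.NumberTheory.Irrationality.Zudilin2004.SorokinLemma3First

open _root_.MeasureTheory _root_.Set _root_.Filter
open scoped _root_.Real
open Literature.NumberTheory.Irrationality.Zudilin2002 (nestedQ sorokinIntegrand)
open Literature.Analysis.SpecialFunctions.Hypergeometric (eulerIntegral)
open Literature.NumberTheory.Irrationality.Zudilin2004.SorokinIntegrandBounds
open Literature.NumberTheory.Irrationality.Zudilin2004.BarnesKernelBounds
open Literature.NumberTheory.Irrationality.Zudilin2004.SorokinFirstVariable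

variable {t₀ : ℝ} {a₀ : ℂ} {a b : ℕ → ℂ}

/-! ### 1. The joint integrand on `[0,1]^k × ℝ` -/

/-- Measurability of the joint integrand `(x', y) ↦ K(y) e^{iεπs} · [∏'(x') · Q_k(x')^{−(−s)}]`.
[cite: Zudilin2004, §4 (supporting lemma)] -/
theorem measurable_joint_first (k : ℕ) (ht₀ : 0 < t₀) (ht₀' : t₀ < a₀.re) (hta : t₀ < (a 0).re) (htb : t₀ < (b 0).re) (ε : ℝ) :
    Measurable fun p : (Fin k → ℝ) × ℝ =>
      Complex.Gamma (a₀ + (-(t₀ : ℂ) + (p.2 : ℂ) * Complex.I)) * Complex.Gamma (a 0 + (-(t₀ : ℂ) + (p.2 : ℂ) * Complex.I)) *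
            Complex.Gamma (-(-(t₀ : ℂ) + (p.2 : ℂ) * Complex.I)) /
            Complex.Gamma (b 0 + (-(t₀ : ℂ) + (p.2 : ℂ) * Complex.I)) *
          Complex.exp (ε * π * Complex.I * (-(t₀ : ℂ) + (p.2 : ℂ) * Complex.I)) *
        ((∏ j : Fin k, ((p.1 j : ℝ) : ℂ) ^ (a (j + 1) - 1) * (1 - ((p.1 j : ℝ) : ℂ)) ^ (b (j + 1) - a (j + 1) - 1)) *
          ((nestedQ (List.ofFn p.1) : ℝ) : ℂ) ^ (-(-(-(t₀ : ℂ) + (p.2 : ℂ) * Complex.I)))) := by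
  have hK : Measurable fun p : (Fin k → ℝ) × ℝ =>
      Complex.Gamma (a₀ + (-(t₀ : ℂ) + (p.2 : ℂ) * Complex.I)) * Complex.Gamma (a 0 + (-(t₀ : ℂ) + (p.2 : ℂ) * Complex.I)) *
          Complex.Gamma (-(-(t₀ : ℂ) + (p.2 : ℂ) * Complex.I)) /
          Complex.Gamma (b 0 + (-(t₀ : ℂ) + (p.2 : ℂ) * Complex.I)) :=
    (continuous_kernel (a₀ := a₀) (a := a 0) (b := b 0) ht₀ ht₀' hta htb).measurable.comp measurable_snd
  have hs : Measurable fun p : (Fin k → ℝ) × ℝ => -(t₀ : ℂ) + (p.2 : ℂ) * Complex.I := by fun_prop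
  have hE : Measurable fun p : (Fin k → ℝ) × ℝ => Complex.exp (ε * π * Complex.I * (-(t₀ : ℂ) + (p.2 : ℂ) * Complex.I)) := by
    fun_prop
  have hQ : Measurable fun p : (Fin k → ℝ) × ℝ => ((nestedQ (List.ofFn p.1) : ℝ) : ℂ) :=
    Complex.measurable_ofReal.comp ((continuous_nestedQ_ofFn k).measurable.comp measurable_fst)
  refine (hK.mul hE).mul (Measurable.mul (Finset.measurable_prod _ fun j _ => ?_) (hQ.pow hs.neg.neg))
  have hj : Measurable fun p : (Fin k → ℝ) × ℝ => ((p.1 j : ℝ) : ℂ) :=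
    Complex.measurable_ofReal.comp ((measurable_pi_apply j).comp measurable_fst)
  exact (hj.pow_const _).mul ((measurable_const.sub hj).pow_const _)

/-- **Integrability of the joint integrand** on `[0,1]^k × ℝ`: dominated by the typed real `J_k`-integrand at
`(t₀; Re a_{j+1} | Re b_{j+1})` (assumed integrable on `[0,1]^k`) times `‖K(y)‖e^{π|y|}` (integrable under the cut condition
`Re a₀ + Re a_0 < Re b_0`). [cite: Zudilin2004, §4 (supporting lemma)] -/
theorem integrable_joint_first {k : ℕ} (ht₀ : 0 < t₀) (ht₀' : t₀ < a₀.re) (hta : t₀ < (a 0).re)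
    (hb : a₀.re + (a 0).re < (b 0).re) {ε : ℝ} (hε : |ε| ≤ 1)
    (hJ : IntegrableOn (sorokinIntegrand k t₀ (fun n => (a (n + 1)).re) (fun n => (b (n + 1)).re))
      (Set.pi univ fun _ : Fin k => Icc (0 : ℝ) 1) volume) :
    Integrable (fun p : (Fin k → ℝ) × ℝ =>
      Complex.Gamma (a₀ + (-(t₀ : ℂ) + (p.2 : ℂ) * Complex.I)) * Complex.Gamma (a 0 + (-(t₀ : ℂ) + (p.2 : ℂ) * Complex.I)) *
            Complex.Gamma (-(-(t₀ : ℂ) + (p.2 : ℂ) * Complex.I)) /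
            Complex.Gamma (b 0 + (-(t₀ : ℂ) + (p.2 : ℂ) * Complex.I)) *
          Complex.exp (ε * π * Complex.I * (-(t₀ : ℂ) + (p.2 : ℂ) * Complex.I)) *
        ((∏ j : Fin k, ((p.1 j : ℝ) : ℂ) ^ (a (j + 1) - 1) * (1 - ((p.1 j : ℝ) : ℂ)) ^ (b (j + 1) - a (j + 1) - 1)) *
          ((nestedQ (List.ofFn p.1) : ℝ) : ℂ) ^ (-(-(-(t₀ : ℂ) + (p.2 : ℂ) * Complex.I)))))
      (((volume : Measure (Fin k → ℝ)).restrict (Set.pi univ fun _ : Fin k => Icc (0 : ℝ) 1)).prod (volume : Measure ℝ)) := by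
  have htb : t₀ < (b 0).re := by linarith [lt_trans ht₀ hta]
  have hΨ : Integrable (fun y : ℝ => ‖Complex.Gamma (a₀ + (-(t₀ : ℂ) + (y : ℂ) * Complex.I)) *
        Complex.Gamma (a 0 + (-(t₀ : ℂ) + (y : ℂ) * Complex.I)) * Complex.Gamma (-(-(t₀ : ℂ) + (y : ℂ) * Complex.I)) /
        Complex.Gamma (b 0 + (-(t₀ : ℂ) + (y : ℂ) * Complex.I))‖ * Real.exp (π * |y|)) :=
    integrable_norm_kernel_mul_exp_pi (a₀ := a₀) (a := a 0) (b := b 0) ht₀ ht₀' hta htb hb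
  have hmaj := hJ.mul_prod hΨ
  have hae : (Set.pi univ fun _ : Fin k => Icc (0 : ℝ) 1) =ᵐ[volume] (Set.pi univ fun _ : Fin k => Ioo (0 : ℝ) 1) := by
    rw [volume_pi]; exact Measure.pi_Ioo_ae_eq_pi_Icc.symm
  refine hmaj.mono' (measurable_joint_first k ht₀ ht₀' hta htb ε).aestronglyMeasurable ?_
  rw [IntegrableOn, Measure.restrict_congr_set hae] at hJ
  rw [Measure.restrict_congr_set hae, ← Measure.restrict_univ (μ := (volume : Measure ℝ)), Measure.prod_restrict]
  filter_upwards [ae_restrict_mem ((MeasurableSet.univ_pi fun _ => measurableSet_Ioo).prod MeasurableSet.univ)] with p hp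
  have hx : ∀ j, p.1 j ∈ Ioo (0 : ℝ) 1 := fun j => (mem_prod.1 hp).1 j (mem_univ _)
  have hS := norm_bracket a b t₀ p.2 hx
  have hnn : 0 ≤ sorokinIntegrand k t₀ (fun n => (a (n + 1)).re) (fun n => (b (n + 1)).re) p.1 := by
    rw [← hS]; exact norm_nonneg _
  rw [norm_mul, norm_mul, hS]
  calc _ ≤ ‖Complex.Gamma (a₀ + (-(t₀ : ℂ) + (p.2 : ℂ) * Complex.I)) * Complex.Gamma (a 0 + (-(t₀ : ℂ) + (p.2 : ℂ) * Complex.I)) *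
            Complex.Gamma (-(-(t₀ : ℂ) + (p.2 : ℂ) * Complex.I)) /
            Complex.Gamma (b 0 + (-(t₀ : ℂ) + (p.2 : ℂ) * Complex.I))‖ * Real.exp (π * |p.2|) *
          sorokinIntegrand k t₀ (fun n => (a (n + 1)).re) (fun n => (b (n + 1)).re) p.1 :=
        mul_le_mul_of_nonneg_right (mul_le_mul_of_nonneg_left (SorokinLemma3.norm_phase_le hε t₀ p.2) (norm_nonneg _)) hnn
    _ = _ := by ring

/-! ### 2. Lemma 3' -/

/-- **Lemma 3' (first-variable recursion)** [Zudilin math/0206177, Lemmas 2–3],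
complex parameters, 0-indexed with `k+1 ≥ 2` variables: for `0 < t₀ < Re a₀`, `t₀ < Re a_0`, `Re a₀ + Re a_0 < Re b_0`, `ε = ±1`, and
provided the `J_{k+1}`-integrand is integrable on `[0,1]^{k+1}` and the typed `J_k`-integrand at `(t₀; Re a_{j+1} | Re b_{j+1})` is
integrable on `[0,1]^k`,
`∫_{[0,1]^{k+1}} ∏ x_j^{a_j−1}(1−x_j)^{b_j−a_j−1} Q_{k+1}^{−a₀} dx
   = Γ(b_0−a_0)/Γ(a₀) · (1/2π) ∫_ℝ Γ(a₀+s)Γ(a_0+s)Γ(−s)/Γ(b_0+s) · e^{iεπs} ·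
       (∫_{[0,1]^k} ∏_{j<k} x_j^{a_{j+1}−1}(1−x_j)^{b_{j+1}−a_{j+1}−1} Q_k^{−(−s)} dx') dy`, `s = −t₀+iy`.
[cite: Zudilin2004, §4 (supporting lemma)] -/
theorem lemma3_first {k : ℕ} (hk : 1 ≤ k) (ht₀ : 0 < t₀) (ht₀' : t₀ < a₀.re) (hta : t₀ < (a 0).re)
    (hb : a₀.re + (a 0).re < (b 0).re) {ε : ℝ} (hε : ε = 1 ∨ ε = -1)
    (hF : IntegrableOn (fun x : Fin (k + 1) → ℝ =>
      (∏ j : Fin (k + 1), ((x j : ℝ) : ℂ) ^ (a j - 1) * (1 - ((x j : ℝ) : ℂ)) ^ (b j - a j - 1)) *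
        ((nestedQ (List.ofFn x) : ℝ) : ℂ) ^ (-a₀)) (Set.pi univ fun _ : Fin (k + 1) => Icc (0 : ℝ) 1) volume)
    (hJ : IntegrableOn (sorokinIntegrand k t₀ (fun n => (a (n + 1)).re) (fun n => (b (n + 1)).re))
      (Set.pi univ fun _ : Fin k => Icc (0 : ℝ) 1) volume) :
    ∫ x in Set.pi univ (fun _ : Fin (k + 1) => Icc (0 : ℝ) 1),
        (∏ j : Fin (k + 1), ((x j : ℝ) : ℂ) ^ (a j - 1) * (1 - ((x j : ℝ) : ℂ)) ^ (b j - a j - 1)) *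
          ((nestedQ (List.ofFn x) : ℝ) : ℂ) ^ (-a₀) =
      Complex.Gamma (b 0 - a 0) / Complex.Gamma a₀ *
        ((1 / (2 * π) : ℂ) * ∫ y : ℝ,
          Complex.Gamma (a₀ + (-(t₀ : ℂ) + (y : ℂ) * Complex.I)) * Complex.Gamma (a 0 + (-(t₀ : ℂ) + (y : ℂ) * Complex.I)) *
                Complex.Gamma (-(-(t₀ : ℂ) + (y : ℂ) * Complex.I)) /
                Complex.Gamma (b 0 + (-(t₀ : ℂ) + (y : ℂ) * Complex.I)) *
              Complex.exp (ε * π * Complex.I * (-(t₀ : ℂ) + (y : ℂ) * Complex.I)) *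
            ∫ x' in Set.pi univ (fun _ : Fin k => Icc (0 : ℝ) 1),
              (∏ j : Fin k, ((x' j : ℝ) : ℂ) ^ (a (j + 1) - 1) * (1 - ((x' j : ℝ) : ℂ)) ^ (b (j + 1) - a (j + 1) - 1)) *
                ((nestedQ (List.ofFn x') : ℝ) : ℂ) ^ (-(-(-(t₀ : ℂ) + (y : ℂ) * Complex.I)))) := by
  have hεabs : |ε| ≤ 1 := by
    rcases hε with h | h <;> simp [h]
  set H : (Fin k → ℝ) → ℝ → ℂ := fun x' y =>
    Complex.Gamma (a₀ + (-(t₀ : ℂ) + (y : ℂ) * Complex.I)) * Complex.Gamma (a 0 + (-(t₀ : ℂ) + (y : ℂ) * Complex.I)) *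
          Complex.Gamma (-(-(t₀ : ℂ) + (y : ℂ) * Complex.I)) /
          Complex.Gamma (b 0 + (-(t₀ : ℂ) + (y : ℂ) * Complex.I)) *
        Complex.exp (ε * π * Complex.I * (-(t₀ : ℂ) + (y : ℂ) * Complex.I)) *
      ((∏ j : Fin k, ((x' j : ℝ) : ℂ) ^ (a (j + 1) - 1) * (1 - ((x' j : ℝ) : ℂ)) ^ (b (j + 1) - a (j + 1) - 1)) *
        ((nestedQ (List.ofFn x') : ℝ) : ℂ) ^ (-(-(-(t₀ : ℂ) + (y : ℂ) * Complex.I)))) with hHdef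
  have hHint : Integrable (Function.uncurry H)
      (((volume : Measure (Fin k → ℝ)).restrict (Set.pi univ fun _ : Fin k => Icc (0 : ℝ) 1)).prod (volume : Measure ℝ)) := by
    rw [hHdef]
    exact integrable_joint_first ht₀ ht₀' hta hb hεabs hJ
  -- (1) split off the first variable
  rw [setIntegral_succ_eq_first k a₀ a b hF]
  -- (2) fibrewise: the Euler integral as a Barnes integral (a.e. `x'`, on the open cube)
  have hae : (Set.pi univ fun _ : Fin k => Icc (0 : ℝ) 1) =ᵐ[volume] (Set.pi univ fun _ : Fin k => Ioo (0 : ℝ) 1) := by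
    rw [volume_pi]; exact Measure.pi_Ioo_ae_eq_pi_Icc.symm
  have hopen : ∀ᵐ x' ∂((volume : Measure (Fin k → ℝ)).restrict (Set.pi univ fun _ : Fin k => Icc (0 : ℝ) 1)),
      ∀ j, x' j ∈ Ioo (0 : ℝ) 1 := by
    rw [Measure.restrict_congr_set hae]
    filter_upwards [ae_restrict_mem (MeasurableSet.univ_pi fun _ => measurableSet_Ioo)] with x hx
    exact fun j => hx j (mem_univ _)
  have hfibre : ∀ᵐ x' ∂((volume : Measure (Fin k → ℝ)).restrict (Set.pi univ fun _ : Fin k => Icc (0 : ℝ) 1)),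
      (∏ j : Fin k, ((x' j : ℝ) : ℂ) ^ (a (j + 1) - 1) * (1 - ((x' j : ℝ) : ℂ)) ^ (b (j + 1) - a (j + 1) - 1)) *
          eulerIntegral a₀ (a 0) (b 0) ((nestedQ (List.ofFn x') : ℝ) : ℂ) =
        Complex.Gamma (b 0 - a 0) / Complex.Gamma a₀ * ((1 / (2 * π) : ℂ) * ∫ y : ℝ, H x' y) := by
    filter_upwards [hopen] with x' hx'
    rw [hHdef]
    exact fibre_eq_first hk ht₀ ht₀' hta hb hx' hε
  rw [integral_congr_ae hfibre, integral_const_mul, integral_const_mul]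
  -- (3) swap the `x'`- and `y`-integrals
  rw [integral_integral_swap hHint]
  -- (4) pull the `y`-factors out of the inner `x'`-integral
  congr 2
  refine integral_congr_ae (Eventually.of_forall fun y => ?_)
  rw [hHdef]
  simp only
  rw [← integral_const_mul]

end Literature.NumberTheory.Irrationality.Zudilin2004.SorokinLemma3First

end Part11

/-!
## Part 12 — port of `Summits/KontsevichZagierPeriods/Zeta5Search/GammaRatioUniform.lean` (6 declarations kept)

# A uniform vertical ratio bound `‖Γ(w)‖ ≤ C ‖w+d‖^{−d} ‖Γ(w+d)‖` on `Re w ≥ x₀`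

Declarations of this Part (verbatim port; each keeps its own docstring and citation): `norm_le_norm_add_ofReal`, `norm_add_ofReal_le`, `im_mul_arg_sub_arg_nonneg`, `re_mul_log_sub_log_le`, `exists_norm_Gamma_le_rpow_mul`, `exists_norm_Gamma_conj_div_le`.

Reference keys (see `references.bib` and the declarations' citations): [Zudilin2004].
-/

section Part12

namespace Literature.NumberTheory.Irrationality.Zudilin2004.GammaRatioUniform

open scoped _root_.Real
open Literature.Analysis.SpecialFunctions.GammaStirling (abs_log_norm_Gamma_sub_le)

/-- `‖w‖ ≤ ‖w + d‖` for `Re w ≥ 0` and real `d ≥ 0`. [cite: Zudilin2004, §4 (supporting lemma)] -/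
theorem norm_le_norm_add_ofReal {w : ℂ} (hw : 0 ≤ w.re) {d : ℝ} (hd : 0 ≤ d) : ‖w‖ ≤ ‖w + d‖ := by
  have h1 : ‖w‖ ^ 2 ≤ ‖w + d‖ ^ 2 := by
    rw [Complex.sq_norm, Complex.sq_norm, Complex.normSq_apply, Complex.normSq_apply]
    simp only [Complex.add_re, Complex.ofReal_re, Complex.add_im, Complex.ofReal_im, add_zero]
    nlinarith
  exact le_of_pow_le_pow_left₀ two_ne_zero (norm_nonneg _) h1

/-- `‖w + d‖ ≤ ‖w‖ + d` for real `d ≥ 0`. [cite: Zudilin2004, §4 (supporting lemma)] -/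
theorem norm_add_ofReal_le (w : ℂ) {d : ℝ} (hd : 0 ≤ d) : ‖w + d‖ ≤ ‖w‖ + d := by
  calc ‖w + d‖ ≤ ‖w‖ + ‖(d : ℂ)‖ := norm_add_le _ _
    _ = ‖w‖ + d := by rw [Complex.norm_real, Real.norm_eq_abs, abs_of_nonneg hd]

/-- **The argument terms compare with the right sign**: `Im w · (arg w − arg(w + d)) ≥ 0` for `Re w > 0`, `d ≥ 0`
(on `Re ≥ 0`, `arg = arcsin(Im/‖·‖)` and `‖w‖ ≤ ‖w+d‖`). [cite: Zudilin2004, §4 (supporting lemma)] -/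
theorem im_mul_arg_sub_arg_nonneg {w : ℂ} (hw : 0 < w.re) {d : ℝ} (hd : 0 ≤ d) :
    0 ≤ w.im * (Complex.arg w - Complex.arg (w + d)) := by
  have hn : ‖w‖ ≤ ‖w + d‖ := norm_le_norm_add_ofReal hw.le hd
  have h0 : 0 < ‖w‖ := norm_pos_iff.mpr fun h => by rw [h] at hw; simp at hw
  rw [Complex.arg_of_re_nonneg hw.le, Complex.arg_of_re_nonneg (by simp; linarith)]
  simp only [Complex.add_im, Complex.ofReal_im, add_zero]
  rcases le_or_gt 0 w.im with hy | hy
  · have : w.im / ‖w + d‖ ≤ w.im / ‖w‖ := div_le_div_of_nonneg_left hy h0 hn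
    exact mul_nonneg hy (sub_nonneg.2 (Real.monotone_arcsin this))
  · have h1 : -w.im / ‖w + d‖ ≤ -w.im / ‖w‖ := div_le_div_of_nonneg_left (by linarith) h0 hn
    rw [neg_div, neg_div, neg_le_neg_iff] at h1
    exact mul_nonneg_of_nonpos_of_nonpos hy.le (sub_nonpos.2 (Real.monotone_arcsin h1))

/-- **The logarithmic terms**: `(Re w − ½)(log‖w‖ − log‖w+d‖) ≤ d/(2x₀)` for `Re w ≥ x₀ > 0`, `d ≥ 0`.
[cite: Zudilin2004, §4 (supporting lemma)] -/
theorem re_mul_log_sub_log_le {w : ℂ} {x₀ d : ℝ} (hx₀ : 0 < x₀) (hw : x₀ ≤ w.re) (hd : 0 ≤ d) :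
    (w.re - 1 / 2) * (Real.log ‖w‖ - Real.log ‖w + d‖) ≤ d / (2 * x₀) := by
  have hw0 : 0 < w.re := lt_of_lt_of_le hx₀ hw
  have hn0 : 0 < ‖w‖ := lt_of_lt_of_le hw0 (Complex.re_le_norm w)
  have hx₀n : x₀ ≤ ‖w‖ := le_trans hw (Complex.re_le_norm w)
  have hn : ‖w‖ ≤ ‖w + d‖ := norm_le_norm_add_ofReal hw0.le hd
  have hnd : 0 < ‖w + d‖ := lt_of_lt_of_le hn0 hn
  have hlog0 : Real.log ‖w‖ ≤ Real.log ‖w + d‖ := Real.log_le_log hn0 hn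
  -- `log‖w+d‖ − log‖w‖ ≤ d/‖w‖ ≤ d/x₀`
  have hlog1 : Real.log ‖w + d‖ - Real.log ‖w‖ ≤ d / x₀ := by
    rw [← Real.log_div hnd.ne' hn0.ne']
    have h1 := Real.log_le_sub_one_of_pos (div_pos hnd hn0)
    have h2 : ‖w + d‖ / ‖w‖ - 1 ≤ d / ‖w‖ := by
      rw [div_sub_one hn0.ne', div_le_div_iff_of_pos_right hn0]
      linarith [norm_add_ofReal_le w hd]
    have h3 : d / ‖w‖ ≤ d / x₀ := div_le_div_of_nonneg_left hd hx₀ hx₀n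
    linarith
  have hdx : 0 ≤ d / x₀ := div_nonneg hd hx₀.le
  rcases le_or_gt (1 / 2) w.re with h | h
  · calc (w.re - 1 / 2) * (Real.log ‖w‖ - Real.log ‖w + d‖) ≤ 0 :=
          mul_nonpos_of_nonneg_of_nonpos (by linarith) (by linarith)
      _ ≤ d / (2 * x₀) := by positivity
  · have : (w.re - 1 / 2) * (Real.log ‖w‖ - Real.log ‖w + d‖) = (1 / 2 - w.re) * (Real.log ‖w + d‖ - Real.log ‖w‖) := by ring
    rw [this]
    calc (1 / 2 - w.re) * (Real.log ‖w + d‖ - Real.log ‖w‖) ≤ (1 / 2) * (d / x₀) :=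
          mul_le_mul (by linarith) hlog1 (by linarith) (by norm_num)
      _ = d / (2 * x₀) := by field_simp

/-- **Uniform vertical ratio bound** [Stirling; Whittaker–Watson §13.6, Titchmarsh (4.12.3), here UNIFORM in the real part]:
for `x₀ > 0` and `d ≥ 0` there is `C > 0` with `‖Γ(w)‖ ≤ C · ‖w + d‖^{−d} · ‖Γ(w + d)‖` for every `w` with `Re w ≥ x₀`
(explicitly `C = exp(d/(2x₀) + d + (1/6)(1/x₀² + π/(2x₀)))`). [cite: Zudilin2004, §4 (supporting lemma)] -/
theorem exists_norm_Gamma_le_rpow_mul {x₀ d : ℝ} (hx₀ : 0 < x₀) (hd : 0 ≤ d) :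
    ∃ C : ℝ, 0 < C ∧ ∀ w : ℂ, x₀ ≤ w.re →
      ‖Complex.Gamma w‖ ≤ C * ‖w + d‖ ^ (-d) * ‖Complex.Gamma (w + d)‖ := by
  set e₀ : ℝ := (1 / 12) * (1 / x₀ ^ 2 + π / (2 * x₀)) with he₀
  refine ⟨Real.exp (d / (2 * x₀) + d + 2 * e₀), Real.exp_pos _, fun w hw => ?_⟩
  have hw0 : 0 < w.re := lt_of_lt_of_le hx₀ hw
  have hwd : 0 < (w + d).re := by simp; linarith
  have hΓ1 : Complex.Gamma w ≠ 0 := Complex.Gamma_ne_zero_of_re_pos hw0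
  have hΓ2 : Complex.Gamma (w + d) ≠ 0 := Complex.Gamma_ne_zero_of_re_pos hwd
  have hn1 : x₀ ≤ ‖w‖ := le_trans hw (Complex.re_le_norm w)
  have hn2 : x₀ ≤ ‖w + d‖ := le_trans (by simp; linarith : x₀ ≤ (w + d).re) (Complex.re_le_norm _)
  have hnd : 0 < ‖w + d‖ := lt_of_lt_of_le hx₀ hn2
  -- the Stirling errors are bounded by `e₀` on `Re ≥ x₀`
  have herr : ∀ z : ℂ, x₀ ≤ ‖z‖ → (1 / 12) * (1 / ‖z‖ ^ 2 + π / (2 * ‖z‖)) ≤ e₀ := by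
    intro z hz
    have hz0 : 0 < ‖z‖ := lt_of_lt_of_le hx₀ hz
    have h1 : 1 / ‖z‖ ^ 2 ≤ 1 / x₀ ^ 2 := by
      apply div_le_div_of_nonneg_left zero_le_one (by positivity)
      exact pow_le_pow_left₀ hx₀.le hz 2
    have h2 : π / (2 * ‖z‖) ≤ π / (2 * x₀) := div_le_div_of_nonneg_left Real.pi_pos.le (by positivity) (by linarith)
    rw [he₀]; linarith
  have h1 := abs_log_norm_Gamma_sub_le hw0
  have h2 := abs_log_norm_Gamma_sub_le hwd
  rw [abs_le] at h1 h2
  have e1 := herr w hn1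
  have e2 := herr (w + d) hn2
  simp only [Complex.add_re, Complex.ofReal_re, Complex.add_im, Complex.ofReal_im, add_zero] at h2
  have hlog := re_mul_log_sub_log_le hx₀ hw hd
  have harg := im_mul_arg_sub_arg_nonneg hw0 hd
  -- `log‖Γ w‖ ≤ log‖Γ(w+d)‖ − d log‖w+d‖ + K`
  have key : Real.log ‖Complex.Gamma w‖ ≤
      Real.log ‖Complex.Gamma (w + d)‖ + Real.log ‖w + d‖ * (-d) + (d / (2 * x₀) + d + 2 * e₀) := by
    nlinarith [h1.2, h2.1, e1, e2, hlog, harg]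
  calc ‖Complex.Gamma w‖ = Real.exp (Real.log ‖Complex.Gamma w‖) := (Real.exp_log (norm_pos_iff.2 hΓ1)).symm
    _ ≤ Real.exp (Real.log ‖Complex.Gamma (w + d)‖ + Real.log ‖w + d‖ * (-d) + (d / (2 * x₀) + d + 2 * e₀)) :=
        Real.exp_le_exp.2 key
    _ = Real.exp (d / (2 * x₀) + d + 2 * e₀) * ‖w + d‖ ^ (-d) * ‖Complex.Gamma (w + d)‖ := by
        rw [Real.exp_add, Real.exp_add, Real.exp_log (norm_pos_iff.2 hΓ2), Real.rpow_def_of_pos hnd]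
        ring

/-- **The shape met in the induction step**: conjugate ordinate in the numerator.  For `x₀ > 0`, `d ≥ 0` there is `C > 0` with
`‖Γ(x − iy)/Γ(x + d + iy)‖ ≤ C ‖x + d + iy‖^{−d}` for all real `x ≥ x₀` and `y` (since `‖Γ(x − iy)‖ = ‖Γ(x + iy)‖`).
[cite: Zudilin2004, §4 (supporting lemma)] -/
theorem exists_norm_Gamma_conj_div_le {x₀ d : ℝ} (hx₀ : 0 < x₀) (hd : 0 ≤ d) :
    ∃ C : ℝ, 0 < C ∧ ∀ x y : ℝ, x₀ ≤ x →
      ‖Complex.Gamma ((x : ℂ) - (y : ℂ) * Complex.I) / Complex.Gamma ((x : ℂ) + d + (y : ℂ) * Complex.I)‖ ≤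
        C * ‖(x : ℂ) + d + (y : ℂ) * Complex.I‖ ^ (-d) := by
  obtain ⟨C, hC, h⟩ := exists_norm_Gamma_le_rpow_mul hx₀ hd
  refine ⟨C, hC, fun x y hx => ?_⟩
  have hconj : (x : ℂ) - (y : ℂ) * Complex.I = (starRingEnd ℂ) ((x : ℂ) + (y : ℂ) * Complex.I) := by
    apply Complex.ext <;> simp
  have hΓ2 : Complex.Gamma ((x : ℂ) + d + (y : ℂ) * Complex.I) ≠ 0 := Complex.Gamma_ne_zero_of_re_pos (by simp; linarith)
  have hw : x₀ ≤ ((x : ℂ) + (y : ℂ) * Complex.I).re := by simp [hx]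
  have hwd : ((x : ℂ) + (y : ℂ) * Complex.I) + d = (x : ℂ) + d + (y : ℂ) * Complex.I := by ring
  have := h _ hw
  rw [hwd] at this
  rw [norm_div, div_le_iff₀ (norm_pos_iff.2 hΓ2), hconj, Complex.Gamma_conj, Complex.norm_conj]
  exact this

end Literature.NumberTheory.Irrationality.Zudilin2004.GammaRatioUniform

end Part12

/-!
## Part 13 — port of `Summits/KontsevichZagierPeriods/Zeta5Search/VWPBarnesKernel.lean` (1 declarations kept)

# The Barnes kernel of the very-well-poised series `F_m`: decay and absolute convergence

Declarations of this Part (verbatim port; each keeps its own docstring and citation): `integrable_norm_mul_exp_pi_of_tail`.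

Reference keys (see `references.bib` and the declarations' citations): [Zudilin2004].
-/

section Part13

namespace Literature.NumberTheory.Irrationality.Zudilin2004.VWPBarnesKernel

open _root_.MeasureTheory _root_.Set _root_.Filter
open scoped _root_.Real
open Literature.NumberTheory.Irrationality.Zudilin2004.BarnesKernelBounds
open Literature.NumberTheory.Irrationality.BrownZudilin2022.BarnesMellin (ne_neg_nat_of_re_pos integrable_of_norm_le_exp)

/-- A continuous `g : ℝ → ℂ` with `‖g(y)‖ ≤ C|y|^{E}e^{−π|y|}` far out and `E < −1`: `y ↦ ‖g(y)‖e^{π|y|}` is integrable.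
[cite: Zudilin2004, §4 (supporting lemma)] -/
theorem integrable_norm_mul_exp_pi_of_tail {g : ℝ → ℂ} (hg : Continuous g) {C E R : ℝ} (hR : 1 ≤ R) (hE : E < -1)
    (hb : ∀ y : ℝ, R ≤ |y| → ‖g y‖ ≤ C * |y| ^ E * Real.exp (-(π * |y|))) :
    Integrable fun y : ℝ => ‖g y‖ * Real.exp (π * |y|) := by
  have hcont : Continuous fun y : ℝ => ‖g y‖ * Real.exp (π * |y|) := hg.norm.mul (by fun_prop)
  obtain ⟨M, hM⟩ := (isCompact_Icc : IsCompact (Icc (-R) R)).exists_bound_of_continuousOn hcont.continuousOn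
  have hM0 : 0 ≤ M := le_trans (norm_nonneg _) (hM 0 (by constructor <;> linarith))
  set C' : ℝ := |C| * (2 : ℝ) ^ (-E) + M * (1 + R) ^ (-E) with hC'
  have hmaj : Integrable fun y : ℝ => C' * (1 + ‖y‖) ^ (-(-E)) :=
    (integrable_one_add_norm (E := ℝ) (μ := volume) (by simp; linarith)).const_mul C'
  refine hmaj.mono' hcont.aestronglyMeasurable (Eventually.of_forall fun y => ?_)
  rw [Real.norm_eq_abs, abs_of_nonneg (by positivity), neg_neg, Real.norm_eq_abs]
  have h1y : 0 < 1 + |y| := by positivity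
  by_cases hy : R ≤ |y|
  · have hy1 : 1 ≤ |y| := le_trans hR hy
    have hy0 : 0 < |y| := by linarith
    have hpow : |y| ^ E ≤ (2 : ℝ) ^ (-E) * (1 + |y|) ^ E := by
      have h2 : 1 + |y| ≤ 2 * |y| := by linarith
      have := Real.rpow_le_rpow_of_nonpos h1y h2 (by linarith : E ≤ 0)
      rw [Real.mul_rpow (by norm_num) (abs_nonneg y)] at this
      have h2q : (0 : ℝ) < 2 ^ E := Real.rpow_pos_of_pos (by norm_num) E
      rw [Real.rpow_neg (by norm_num : (0 : ℝ) ≤ 2)]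
      calc |y| ^ E = (2 ^ E)⁻¹ * (2 ^ E * |y| ^ E) := by field_simp
        _ ≤ (2 ^ E)⁻¹ * (1 + |y|) ^ E := mul_le_mul_of_nonneg_left this (by positivity)
    calc ‖g y‖ * Real.exp (π * |y|) ≤ (C * |y| ^ E * Real.exp (-(π * |y|))) * Real.exp (π * |y|) :=
          mul_le_mul_of_nonneg_right (hb y hy) (Real.exp_pos _).le
      _ = C * |y| ^ E := by
          rw [mul_assoc, ← Real.exp_add, show -(π * |y|) + π * |y| = 0 by ring, Real.exp_zero, mul_one]
      _ ≤ |C| * |y| ^ E := by gcongr; exact le_abs_self C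
      _ ≤ |C| * ((2 : ℝ) ^ (-E) * (1 + |y|) ^ E) := mul_le_mul_of_nonneg_left hpow (abs_nonneg C)
      _ ≤ C' * (1 + |y|) ^ E := by
          rw [hC', add_mul, ← mul_assoc]
          have : 0 ≤ M * (1 + R) ^ (-E) * (1 + |y|) ^ E := by positivity
          linarith
  · rw [not_le] at hy
    have hyI : y ∈ Icc (-R) R := by constructor <;> linarith [neg_abs_le y, le_abs_self y]
    have hMy := hM y hyI
    rw [Real.norm_eq_abs, abs_of_nonneg (by positivity)] at hMy
    have hpow : (1 + R) ^ E ≤ (1 + |y|) ^ E := Real.rpow_le_rpow_of_nonpos h1y (by linarith) (by linarith)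
    have hR0 : 0 < 1 + R := by linarith
    calc ‖g y‖ * Real.exp (π * |y|) ≤ M := hMy
      _ = M * (1 + R) ^ (-E) * (1 + R) ^ E := by
          rw [mul_assoc, Real.rpow_neg hR0.le, inv_mul_cancel₀ (Real.rpow_pos_of_pos hR0 E).ne', mul_one]
      _ ≤ M * (1 + R) ^ (-E) * (1 + |y|) ^ E := mul_le_mul_of_nonneg_left hpow (by positivity)
      _ ≤ C' * (1 + |y|) ^ E := by
          rw [hC', add_mul]
          have : 0 ≤ |C| * (2 : ℝ) ^ (-E) * (1 + |y|) ^ E := by positivity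
          linarith

end Literature.NumberTheory.Irrationality.Zudilin2004.VWPBarnesKernel

end Part13

/-!
## Part 14 — port of `Summits/KontsevichZagierPeriods/Zeta5Search/VWPBarnesShift.lean` (1 declarations kept)

# Shifting the Barnes contour of `F_m` past the poles `0, 1, …, N` of `Γ(−s)`

Declarations of this Part (verbatim port; each keeps its own docstring and citation): `norm_phase_le`.

Reference keys (see `references.bib` and the declarations' citations): [Zudilin2004].
-/

section Part14

namespace Literature.NumberTheory.Irrationality.Zudilin2004.VWPBarnesShift

open _root_.MeasureTheory _root_.Set _root_.Filter
open scoped _root_.Real _root_.Topology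
open Literature.Analysis.Complex (integral_vertical_sub_eq_sum_of_simplePoles Gamma_eq_div_div
  differentiableOn_Gamma_add_div_prod Gamma_add_div_prod_neg_nat)

variable {m : ℕ} {h : ℕ → ℂ} {s₁ ε w : ℝ}

/-- `‖e^{iεπs}‖ = e^{−επ Im s} ≤ e^{π|Im s|}` for `|ε| ≤ 1`. [cite: Zudilin2004, §4 (supporting lemma)] -/
theorem norm_phase_le (hε : |ε| ≤ 1) (s : ℂ) : ‖Complex.exp (ε * π * Complex.I * s)‖ ≤ Real.exp (π * |s.im|) := by
  rw [Complex.norm_exp]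
  apply Real.exp_le_exp.2
  have hre : ((ε : ℂ) * π * Complex.I * s).re = -(ε * π * s.im) := by simp [Complex.mul_re, Complex.mul_im]
  rw [hre]
  have h1 : -(ε * π * s.im) ≤ |ε * π * s.im| := neg_le_abs _
  rw [abs_mul, abs_mul, abs_of_pos Real.pi_pos] at h1
  have h2 : |ε| * π * |s.im| ≤ 1 * π * |s.im| := by gcongr
  linarith

end Literature.NumberTheory.Irrationality.Zudilin2004.VWPBarnesShift

end Part14

/-!
## Part 15 — port of `Summits/KontsevichZagierPeriods/Zeta5Search/VWPInnerBarnes.lean` (6 declarations kept)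

# The inner Barnes integrals of the induction step: evaluation and a bound uniform in `μ`

Declarations of this Part (verbatim port; each keeps its own docstring and citation): `exp_phase_nat`, `inner_barnes_eq`, `norm_inner_le`, `one_add_abs_rpow_neg_le`, `integrable_two_Gamma_weight`, `exists_integral_norm_inner_le`.

Reference keys (see `references.bib` and the declarations' citations): [Zudilin2004].
-/

section Part15

namespace Literature.NumberTheory.Irrationality.Zudilin2004.VWPInnerBarnes

open _root_.MeasureTheory _root_.Set _root_.Filter
open scoped _root_.Real
open Literature.NumberTheory.Irrationality.Zudilin2004.BarnesKernelBounds (norm_Gamma_shift_le)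
open Literature.NumberTheory.Irrationality.BrownZudilin2022.BarnesMellin (ne_neg_nat_of_re_pos)
open Literature.NumberTheory.Irrationality.Zudilin2004.VWPBarnesKernel (integrable_norm_mul_exp_pi_of_tail)
open Literature.NumberTheory.Irrationality.Zudilin2004.VWPBarnesShift (norm_phase_le)
open Literature.NumberTheory.Irrationality.Zudilin2004.GammaRatioUniform (exists_norm_Gamma_conj_div_le)

variable {t₀ : ℝ} {α β : ℂ}

/-! ### 1. The evaluation -/

/-- `e^{iεπμ} = (−1)^μ` for `ε = ±1` and a natural number `μ`. [cite: Zudilin2004, §4 (supporting lemma)] -/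
theorem exp_phase_nat {ε : ℝ} (hε : ε = 1 ∨ ε = -1) (μ : ℕ) : Complex.exp (ε * π * Complex.I * μ) = (-1 : ℂ) ^ μ := by
  rcases hε with rfl | rfl
  · rw [← Complex.exp_pi_mul_I, ← Complex.exp_nat_mul]; push_cast; ring_nf
  · rw [show ((-1 : ℝ) : ℂ) * π * Complex.I * μ = -(μ * (π * Complex.I)) by push_cast; ring, Complex.exp_neg,
      Complex.exp_nat_mul, Complex.exp_pi_mul_I, ← inv_pow, inv_neg_one]

/-- **The inner Barnes integral of the induction step** [Lemma 2 at `z = 1`, i.e. Gauss/Beta in Barnes form; Zudilin math/0206177,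
Lemma 2; Nesterenko 2003 §3.2]: for `0 < t₀ < Re α`, `t₀ < Re β`, `Re α + Re β < Re c`, `ε = ±1` and `μ : ℕ`,
`(1/2π)∫ Γ(α+s)Γ(β+s)Γ(μ−s)/Γ(c+μ+s)·e^{iεπs} dy = (−1)^μ · Γ(α+μ)Γ(β+μ)Γ(c−α−β)/(Γ(c−β+μ)Γ(c−α+μ))`, `s = −t₀+iy`
(g27's `barnes_exp_eq_Gamma` with `t₀+μ`, `α+μ`, `β+μ`, `c+2μ` after the reindexing `s = s' + μ`).
[cite: Zudilin2004, §4 (supporting lemma)] -/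
theorem inner_barnes_eq (ht₀ : 0 < t₀) (hα : t₀ < α.re) (hβ : t₀ < β.re) {c : ℂ} (hc : α.re + β.re < c.re)
    {ε : ℝ} (hε : ε = 1 ∨ ε = -1) (μ : ℕ) :
    (1 / (2 * π) : ℂ) * ∫ y : ℝ,
        Complex.Gamma (α + (-(t₀ : ℂ) + (y : ℂ) * Complex.I)) * Complex.Gamma (β + (-(t₀ : ℂ) + (y : ℂ) * Complex.I)) *
            Complex.Gamma ((μ : ℂ) - (-(t₀ : ℂ) + (y : ℂ) * Complex.I)) /
            Complex.Gamma (c + μ + (-(t₀ : ℂ) + (y : ℂ) * Complex.I)) *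
          Complex.exp (ε * π * Complex.I * (-(t₀ : ℂ) + (y : ℂ) * Complex.I)) =
      (-1 : ℂ) ^ μ * (Complex.Gamma (α + μ) * Complex.Gamma (β + μ) * Complex.Gamma (c - α - β) /
        (Complex.Gamma (c - β + μ) * Complex.Gamma (c - α + μ))) := by
  have hμ : (0 : ℝ) ≤ μ := μ.cast_nonneg
  have h := BarnesEulerIntegralCut.barnes_exp_eq_Gamma (t₀ := t₀ + μ) (a₀ := α + μ) (a := β + μ) (b := c + 2 * μ)
    (by positivity) (by simp; linarith) (by simp; linarith) (by simp; linarith) hε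
  have g1 : c + 2 * (μ : ℂ) - (β + μ) - (α + μ) = c - α - β := by ring
  have g2 : c + 2 * (μ : ℂ) - (β + μ) = c - β + μ := by ring
  have g3 : c + 2 * (μ : ℂ) - (α + μ) = c - α + μ := by ring
  rw [g1, g2, g3] at h
  -- pointwise reindexing `s = s' + μ`
  have hpt : ∀ y : ℝ,
      Complex.Gamma (α + (-(t₀ : ℂ) + (y : ℂ) * Complex.I)) * Complex.Gamma (β + (-(t₀ : ℂ) + (y : ℂ) * Complex.I)) *
            Complex.Gamma ((μ : ℂ) - (-(t₀ : ℂ) + (y : ℂ) * Complex.I)) /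
            Complex.Gamma (c + μ + (-(t₀ : ℂ) + (y : ℂ) * Complex.I)) *
          Complex.exp (ε * π * Complex.I * (-(t₀ : ℂ) + (y : ℂ) * Complex.I)) =
        Complex.Gamma (α + μ + (-((t₀ + μ : ℝ) : ℂ) + (y : ℂ) * Complex.I)) *
              Complex.Gamma (β + μ + (-((t₀ + μ : ℝ) : ℂ) + (y : ℂ) * Complex.I)) *
              Complex.Gamma (-(-((t₀ + μ : ℝ) : ℂ) + (y : ℂ) * Complex.I)) /
              Complex.Gamma (c + 2 * μ + (-((t₀ + μ : ℝ) : ℂ) + (y : ℂ) * Complex.I)) *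
            Complex.exp (ε * π * Complex.I * (-((t₀ + μ : ℝ) : ℂ) + (y : ℂ) * Complex.I)) *
          Complex.exp (ε * π * Complex.I * μ) := by
    intro y
    have e1 : α + (-(t₀ : ℂ) + (y : ℂ) * Complex.I) = α + μ + (-((t₀ + μ : ℝ) : ℂ) + (y : ℂ) * Complex.I) := by push_cast; ring
    have e2 : β + (-(t₀ : ℂ) + (y : ℂ) * Complex.I) = β + μ + (-((t₀ + μ : ℝ) : ℂ) + (y : ℂ) * Complex.I) := by push_cast; ring
    have e3 : (μ : ℂ) - (-(t₀ : ℂ) + (y : ℂ) * Complex.I) = -(-((t₀ + μ : ℝ) : ℂ) + (y : ℂ) * Complex.I) := by push_cast; ring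
    have e4 : c + μ + (-(t₀ : ℂ) + (y : ℂ) * Complex.I) = c + 2 * μ + (-((t₀ + μ : ℝ) : ℂ) + (y : ℂ) * Complex.I) := by
      push_cast; ring
    have e5 : Complex.exp (ε * π * Complex.I * (-(t₀ : ℂ) + (y : ℂ) * Complex.I)) =
        Complex.exp (ε * π * Complex.I * (-((t₀ + μ : ℝ) : ℂ) + (y : ℂ) * Complex.I)) * Complex.exp (ε * π * Complex.I * μ) := by
      rw [← Complex.exp_add]; push_cast; ring_nf
    rw [e1, e2, e3, e4, e5]; ring
  have hI : (∫ y : ℝ,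
        Complex.Gamma (α + (-(t₀ : ℂ) + (y : ℂ) * Complex.I)) * Complex.Gamma (β + (-(t₀ : ℂ) + (y : ℂ) * Complex.I)) *
            Complex.Gamma ((μ : ℂ) - (-(t₀ : ℂ) + (y : ℂ) * Complex.I)) /
            Complex.Gamma (c + μ + (-(t₀ : ℂ) + (y : ℂ) * Complex.I)) *
          Complex.exp (ε * π * Complex.I * (-(t₀ : ℂ) + (y : ℂ) * Complex.I))) =
      (∫ y : ℝ, Complex.Gamma (α + μ + (-((t₀ + μ : ℝ) : ℂ) + (y : ℂ) * Complex.I)) *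
              Complex.Gamma (β + μ + (-((t₀ + μ : ℝ) : ℂ) + (y : ℂ) * Complex.I)) *
              Complex.Gamma (-(-((t₀ + μ : ℝ) : ℂ) + (y : ℂ) * Complex.I)) /
              Complex.Gamma (c + 2 * μ + (-((t₀ + μ : ℝ) : ℂ) + (y : ℂ) * Complex.I)) *
            Complex.exp (ε * π * Complex.I * (-((t₀ + μ : ℝ) : ℂ) + (y : ℂ) * Complex.I))) *
        Complex.exp (ε * π * Complex.I * μ) := by
    rw [← integral_mul_const]
    exact integral_congr_ae (Eventually.of_forall hpt)
  rw [hI, ← mul_assoc, h, exp_phase_nat hε, mul_comm]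

/-! ### 2. A bound uniform in `μ` -/

/-- **Uniform bound for the inner integrand** (real `c ≥ 2t₀`, `|ε| ≤ 1`): there is `C > 0` with
`‖Γ(α+s)Γ(β+s)Γ(μ−s)/Γ(c+μ+s)·e^{iεπs}‖ ≤ C·(‖Γ(α+s)Γ(β+s)‖e^{π|y|})·‖(c−t₀+μ)+iy‖^{−(c−2t₀)}` for all `μ : ℕ`, `y : ℝ`
(`GammaRatioUniform`: the ratio `Γ(μ+t₀−iy)/Γ(c+μ−t₀+iy)` has the decay of Stirling UNIFORMLY in `μ`).
[cite: Zudilin2004, §4 (supporting lemma)] -/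
theorem norm_inner_le (ht₀ : 0 < t₀) {c : ℝ} (hc : 2 * t₀ ≤ c) {ε : ℝ} (hε : |ε| ≤ 1) :
    ∃ C : ℝ, 0 < C ∧ ∀ (μ : ℕ) (y : ℝ),
      ‖Complex.Gamma (α + (-(t₀ : ℂ) + (y : ℂ) * Complex.I)) * Complex.Gamma (β + (-(t₀ : ℂ) + (y : ℂ) * Complex.I)) *
            Complex.Gamma ((μ : ℂ) - (-(t₀ : ℂ) + (y : ℂ) * Complex.I)) /
            Complex.Gamma ((c : ℂ) + μ + (-(t₀ : ℂ) + (y : ℂ) * Complex.I)) *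
          Complex.exp (ε * π * Complex.I * (-(t₀ : ℂ) + (y : ℂ) * Complex.I))‖ ≤
        C * (‖Complex.Gamma (α + (-(t₀ : ℂ) + (y : ℂ) * Complex.I)) * Complex.Gamma (β + (-(t₀ : ℂ) + (y : ℂ) * Complex.I))‖ *
          Real.exp (π * |y|)) * ‖((c - t₀ + μ : ℝ) : ℂ) + (y : ℂ) * Complex.I‖ ^ (-(c - 2 * t₀)) := by
  obtain ⟨C, hC, h⟩ := exists_norm_Gamma_conj_div_le (x₀ := t₀) (d := c - 2 * t₀) ht₀ (by linarith)
  refine ⟨C, hC, fun μ y => ?_⟩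
  have hx : t₀ ≤ (μ : ℝ) + t₀ := by linarith [μ.cast_nonneg (α := ℝ)]
  have hr := h ((μ : ℝ) + t₀) y hx
  have e1 : (μ : ℂ) - (-(t₀ : ℂ) + (y : ℂ) * Complex.I) = (((μ : ℝ) + t₀ : ℝ) : ℂ) - (y : ℂ) * Complex.I := by push_cast; ring
  have e2 : (c : ℂ) + μ + (-(t₀ : ℂ) + (y : ℂ) * Complex.I) = (((μ : ℝ) + t₀ : ℝ) : ℂ) + ((c - 2 * t₀ : ℝ) : ℂ) + (y : ℂ) * Complex.I := by
    push_cast; ring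
  have e3 : (((μ : ℝ) + t₀ : ℝ) : ℂ) + ((c - 2 * t₀ : ℝ) : ℂ) + (y : ℂ) * Complex.I = ((c - t₀ + μ : ℝ) : ℂ) + (y : ℂ) * Complex.I := by
    push_cast; ring
  rw [e3] at hr
  have hph := norm_phase_le hε (-(t₀ : ℂ) + (y : ℂ) * Complex.I)
  simp only [Complex.add_im, Complex.neg_im, Complex.ofReal_im, neg_zero, Complex.mul_im, Complex.I_re, Complex.I_im,
    Complex.ofReal_re, mul_zero, mul_one, zero_add, add_zero] at hph
  rw [mul_div_assoc, e1, e2, e3, norm_mul, norm_mul]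
  set G := ‖Complex.Gamma (α + (-(t₀ : ℂ) + (y : ℂ) * Complex.I)) * Complex.Gamma (β + (-(t₀ : ℂ) + (y : ℂ) * Complex.I))‖
  calc G * ‖Complex.Gamma ((((μ : ℝ) + t₀ : ℝ) : ℂ) - (y : ℂ) * Complex.I) /
          Complex.Gamma (((c - t₀ + μ : ℝ) : ℂ) + (y : ℂ) * Complex.I)‖ *
        ‖Complex.exp (ε * π * Complex.I * (-(t₀ : ℂ) + (y : ℂ) * Complex.I))‖
      ≤ G * (C * ‖((c - t₀ + μ : ℝ) : ℂ) + (y : ℂ) * Complex.I‖ ^ (-(c - 2 * t₀))) * Real.exp (π * |y|) := by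
        gcongr
    _ = _ := by ring

/-- For `|y| ≥ 1` and real `q`: `(1+|y|)^{−q} ≤ 2^{|q|} |y|^{−q}`. [cite: Zudilin2004, §4 (supporting lemma)] -/
theorem one_add_abs_rpow_neg_le (q : ℝ) {y : ℝ} (hy : 1 ≤ |y|) : (1 + |y|) ^ (-q) ≤ (2 : ℝ) ^ |q| * |y| ^ (-q) := by
  have hy0 : 0 < |y| := by linarith
  rcases le_or_gt 0 q with hq | hq
  · rw [abs_of_nonneg hq]
    calc (1 + |y|) ^ (-q) ≤ |y| ^ (-q) := Real.rpow_le_rpow_of_nonpos hy0 (by linarith) (by linarith)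
      _ ≤ (2 : ℝ) ^ q * |y| ^ (-q) := le_mul_of_one_le_left (Real.rpow_nonneg hy0.le _) (Real.one_le_rpow (by norm_num) hq)
  · rw [abs_of_neg hq]
    calc (1 + |y|) ^ (-q) ≤ (2 * |y|) ^ (-q) := Real.rpow_le_rpow (by positivity) (by linarith) (by linarith)
      _ = (2 : ℝ) ^ (-q) * |y| ^ (-q) := Real.mul_rpow (by norm_num) hy0.le

/-- **Integrability of the two-Gamma weight**: for `t₀ < Re α`, `t₀ < Re β` and `q > Re α + Re β − 2t₀`,
`y ↦ ‖Γ(α+s)Γ(β+s)·(1+|y|)^{−q}‖·e^{π|y|}` is integrable (`s = −t₀+iy`; the two Stirling factors give `|y|^{Re α+Re β−2t₀−1}e^{−π|y|}`).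
[cite: Zudilin2004, §4 (supporting lemma)] -/
theorem integrable_two_Gamma_weight (hα : t₀ < α.re) (hβ : t₀ < β.re) {q : ℝ} (hq : α.re + β.re - 2 * t₀ < q) :
    Integrable fun y : ℝ =>
      ‖Complex.Gamma (α + (-(t₀ : ℂ) + (y : ℂ) * Complex.I)) * Complex.Gamma (β + (-(t₀ : ℂ) + (y : ℂ) * Complex.I)) *
          (((1 + |y|) ^ (-q) : ℝ) : ℂ)‖ * Real.exp (π * |y|) := by
  obtain ⟨C₁, hC₁, R₁, hR₁, h₁⟩ := norm_Gamma_shift_le α t₀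
  obtain ⟨C₂, hC₂, R₂, hR₂, h₂⟩ := norm_Gamma_shift_le β t₀
  have hcont : Continuous fun y : ℝ =>
      Complex.Gamma (α + (-(t₀ : ℂ) + (y : ℂ) * Complex.I)) * Complex.Gamma (β + (-(t₀ : ℂ) + (y : ℂ) * Complex.I)) *
        (((1 + |y|) ^ (-q) : ℝ) : ℂ) := by
    have hΓ : ∀ (f : ℝ → ℂ), Continuous f → (∀ y, 0 < (f y).re) → Continuous fun y => Complex.Gamma (f y) := by
      intro f hf hpos
      refine continuous_iff_continuousAt.mpr fun y => (Complex.continuousAt_Gamma _ ?_).comp hf.continuousAt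
      exact ne_neg_nat_of_re_pos (hpos y)
    refine ((hΓ _ (by fun_prop) fun y => by simp; linarith).mul (hΓ _ (by fun_prop) fun y => by simp; linarith)).mul ?_
    exact Complex.continuous_ofReal.comp ((continuous_const.add continuous_abs).rpow_const fun y =>
      Or.inl (by positivity : (0 : ℝ) < 1 + |y|).ne')
  refine integrable_norm_mul_exp_pi_of_tail hcont (C := C₁ * C₂ * (2 : ℝ) ^ |q|)
    (E := (α.re - t₀ - 1 / 2) + (β.re - t₀ - 1 / 2) + -q) (R := max R₁ R₂) (le_max_of_le_left hR₁) (by linarith)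
    fun y hy => ?_
  have hy₁ : R₁ ≤ |y| := le_trans (le_max_left _ _) hy
  have hy₂ : R₂ ≤ |y| := le_trans (le_max_right _ _) hy
  have hy1 : 1 ≤ |y| := le_trans hR₁ hy₁
  have hy0 : 0 < |y| := by linarith
  have g1 := h₁ y hy₁
  have g2 := h₂ y hy₂
  have g3 : ‖(((1 + |y|) ^ (-q) : ℝ) : ℂ)‖ ≤ (2 : ℝ) ^ |q| * |y| ^ (-q) := by
    rw [Complex.norm_real, Real.norm_eq_abs, abs_of_nonneg (Real.rpow_nonneg (by positivity) _)]
    exact one_add_abs_rpow_neg_le q hy1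
  rw [norm_mul, norm_mul]
  calc ‖Complex.Gamma (α + (-(t₀ : ℂ) + (y : ℂ) * Complex.I))‖ * ‖Complex.Gamma (β + (-(t₀ : ℂ) + (y : ℂ) * Complex.I))‖ *
          ‖(((1 + |y|) ^ (-q) : ℝ) : ℂ)‖
      ≤ (C₁ * |y| ^ (α.re - t₀ - 1 / 2) * Real.exp (-(π * |y|) / 2)) * (C₂ * |y| ^ (β.re - t₀ - 1 / 2) * Real.exp (-(π * |y|) / 2)) *
          ((2 : ℝ) ^ |q| * |y| ^ (-q)) := by gcongr
    _ = C₁ * C₂ * (2 : ℝ) ^ |q| * (|y| ^ (α.re - t₀ - 1 / 2) * |y| ^ (β.re - t₀ - 1 / 2) * |y| ^ (-q)) *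
          (Real.exp (-(π * |y|) / 2) * Real.exp (-(π * |y|) / 2)) := by ring
    _ = C₁ * C₂ * (2 : ℝ) ^ |q| * |y| ^ ((α.re - t₀ - 1 / 2) + (β.re - t₀ - 1 / 2) + -q) * Real.exp (-(π * |y|)) := by
        rw [← Real.rpow_add hy0, ← Real.rpow_add hy0, ← Real.exp_add]; ring_nf

/-- **The `μ`-uniform bound for the inner integrals**: for real `c` with `2t₀ ≤ c`, `1 ≤ c − t₀`, `0 < t₀ < Re α, Re β`, `|ε| ≤ 1`,
and `θ ≥ 0` with `Re α + Re β − 2t₀ < (c − 2t₀)(1 − θ)`, there is `C > 0` such that for EVERY `μ : ℕ` the inner integrand is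
integrable and `∫‖Γ(α+s)Γ(β+s)Γ(μ−s)/Γ(c+μ+s)·e^{iεπs}‖ dy ≤ C·(c − t₀ + μ)^{−(c−2t₀)θ}` (`θ ≤ 1` is the useful range).
[cite: Zudilin2004, §4 (supporting lemma)] -/
theorem exists_integral_norm_inner_le (ht₀ : 0 < t₀) (hα : t₀ < α.re) (hβ : t₀ < β.re) {c : ℝ} (hc : 2 * t₀ ≤ c)
    (hc1 : 1 ≤ c - t₀) {ε : ℝ} (hε : |ε| ≤ 1) {θ : ℝ} (hθ0 : 0 ≤ θ)
    (hq : α.re + β.re - 2 * t₀ < (c - 2 * t₀) * (1 - θ)) :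
    ∃ C : ℝ, 0 < C ∧ ∀ μ : ℕ,
      Integrable (fun y : ℝ =>
        Complex.Gamma (α + (-(t₀ : ℂ) + (y : ℂ) * Complex.I)) * Complex.Gamma (β + (-(t₀ : ℂ) + (y : ℂ) * Complex.I)) *
            Complex.Gamma ((μ : ℂ) - (-(t₀ : ℂ) + (y : ℂ) * Complex.I)) /
            Complex.Gamma ((c : ℂ) + μ + (-(t₀ : ℂ) + (y : ℂ) * Complex.I)) *
          Complex.exp (ε * π * Complex.I * (-(t₀ : ℂ) + (y : ℂ) * Complex.I))) ∧
      ∫ y : ℝ, ‖Complex.Gamma (α + (-(t₀ : ℂ) + (y : ℂ) * Complex.I)) * Complex.Gamma (β + (-(t₀ : ℂ) + (y : ℂ) * Complex.I)) *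
            Complex.Gamma ((μ : ℂ) - (-(t₀ : ℂ) + (y : ℂ) * Complex.I)) /
            Complex.Gamma ((c : ℂ) + μ + (-(t₀ : ℂ) + (y : ℂ) * Complex.I)) *
          Complex.exp (ε * π * Complex.I * (-(t₀ : ℂ) + (y : ℂ) * Complex.I))‖ ≤
        C * (c - t₀ + μ) ^ (-((c - 2 * t₀) * θ)) := by
  set d : ℝ := c - 2 * t₀ with hd
  have hd0 : 0 ≤ d := by linarith
  obtain ⟨C₁, hC₁, hb⟩ := norm_inner_le (α := α) (β := β) ht₀ hc hε
  have hW := integrable_two_Gamma_weight (α := α) (β := β) hα hβ (q := d * (1 - θ)) (by linarith)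
  set I₀ : ℝ := ∫ y : ℝ, ‖Complex.Gamma (α + (-(t₀ : ℂ) + (y : ℂ) * Complex.I)) * Complex.Gamma (β + (-(t₀ : ℂ) + (y : ℂ) * Complex.I)) *
      (((1 + |y|) ^ (-(d * (1 - θ))) : ℝ) : ℂ)‖ * Real.exp (π * |y|) with hI₀
  have hI₀0 : 0 ≤ I₀ := integral_nonneg fun y => by positivity
  refine ⟨C₁ * (2 : ℝ) ^ (d * (1 - θ)) * (I₀ + 1), by positivity, fun μ => ?_⟩
  have hμ : (0 : ℝ) ≤ μ := μ.cast_nonneg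
  have hRe : 1 ≤ c - t₀ + μ := by linarith
  -- the pointwise majorant
  set M : ℝ := C₁ * (2 : ℝ) ^ (d * (1 - θ)) * (c - t₀ + μ) ^ (-(d * θ)) with hM
  have hmaj : ∀ y : ℝ,
      ‖Complex.Gamma (α + (-(t₀ : ℂ) + (y : ℂ) * Complex.I)) * Complex.Gamma (β + (-(t₀ : ℂ) + (y : ℂ) * Complex.I)) *
            Complex.Gamma ((μ : ℂ) - (-(t₀ : ℂ) + (y : ℂ) * Complex.I)) /
            Complex.Gamma ((c : ℂ) + μ + (-(t₀ : ℂ) + (y : ℂ) * Complex.I)) *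
          Complex.exp (ε * π * Complex.I * (-(t₀ : ℂ) + (y : ℂ) * Complex.I))‖ ≤
        M * (‖Complex.Gamma (α + (-(t₀ : ℂ) + (y : ℂ) * Complex.I)) * Complex.Gamma (β + (-(t₀ : ℂ) + (y : ℂ) * Complex.I)) *
          (((1 + |y|) ^ (-(d * (1 - θ))) : ℝ) : ℂ)‖ * Real.exp (π * |y|)) := by
    intro y
    set w : ℂ := ((c - t₀ + μ : ℝ) : ℂ) + (y : ℂ) * Complex.I with hw
    have hwre : w.re = c - t₀ + μ := by simp [hw]
    have hw1 : 1 ≤ ‖w‖ := le_trans hRe (by rw [← hwre]; exact Complex.re_le_norm w)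
    have hw0 : 0 < ‖w‖ := by linarith
    have hwy : (1 + |y|) / 2 ≤ ‖w‖ := by
      have : |y| ≤ ‖w‖ := by have := Complex.abs_im_le_norm w; simpa [hw] using this
      linarith
    -- `‖w‖^{-d} ≤ (Re w)^{-dθ} · ((1+|y|)/2)^{-d(1-θ)}`
    have hsplit : ‖w‖ ^ (-d) ≤ (c - t₀ + μ) ^ (-(d * θ)) * ((2 : ℝ) ^ (d * (1 - θ)) * (1 + |y|) ^ (-(d * (1 - θ)))) := by
      have e : ‖w‖ ^ (-d) = ‖w‖ ^ (-(d * θ)) * ‖w‖ ^ (-(d * (1 - θ))) := by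
        rw [← Real.rpow_add hw0]; ring_nf
      rw [e]
      have f1 : ‖w‖ ^ (-(d * θ)) ≤ (c - t₀ + μ) ^ (-(d * θ)) :=
        Real.rpow_le_rpow_of_nonpos (by linarith) (by rw [← hwre]; exact Complex.re_le_norm w)
          (by nlinarith)
      have f2 : ‖w‖ ^ (-(d * (1 - θ))) ≤ ((1 + |y|) / 2) ^ (-(d * (1 - θ))) :=
        Real.rpow_le_rpow_of_nonpos (by positivity) hwy (by nlinarith)
      have f3 : ((1 + |y|) / 2) ^ (-(d * (1 - θ))) = (2 : ℝ) ^ (d * (1 - θ)) * (1 + |y|) ^ (-(d * (1 - θ))) := by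
        rw [Real.div_rpow (by positivity) (by norm_num), Real.rpow_neg (by norm_num : (0 : ℝ) ≤ 2), div_eq_mul_inv, inv_inv,
          mul_comm]
      rw [← f3]
      exact mul_le_mul f1 f2 (Real.rpow_nonneg hw0.le _) (Real.rpow_nonneg (by linarith) _)
    have hG0 : 0 ≤ ‖Complex.Gamma (α + (-(t₀ : ℂ) + (y : ℂ) * Complex.I)) * Complex.Gamma (β + (-(t₀ : ℂ) + (y : ℂ) * Complex.I))‖ *
        Real.exp (π * |y|) := by positivity
    have hnw : ‖(((1 + |y|) ^ (-(d * (1 - θ))) : ℝ) : ℂ)‖ = (1 + |y|) ^ (-(d * (1 - θ))) := by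
      rw [Complex.norm_real, Real.norm_eq_abs, abs_of_nonneg (Real.rpow_nonneg (by positivity) _)]
    calc _ ≤ C₁ * (‖Complex.Gamma (α + (-(t₀ : ℂ) + (y : ℂ) * Complex.I)) * Complex.Gamma (β + (-(t₀ : ℂ) + (y : ℂ) * Complex.I))‖ *
            Real.exp (π * |y|)) * ‖w‖ ^ (-d) := hb μ y
      _ ≤ C₁ * (‖Complex.Gamma (α + (-(t₀ : ℂ) + (y : ℂ) * Complex.I)) * Complex.Gamma (β + (-(t₀ : ℂ) + (y : ℂ) * Complex.I))‖ *
            Real.exp (π * |y|)) * ((c - t₀ + μ) ^ (-(d * θ)) * ((2 : ℝ) ^ (d * (1 - θ)) * (1 + |y|) ^ (-(d * (1 - θ))))) :=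
          mul_le_mul_of_nonneg_left hsplit (mul_nonneg hC₁.le hG0)
      _ = _ := by
          have hn2 : ‖Complex.Gamma (α + (-(t₀ : ℂ) + (y : ℂ) * Complex.I)) * Complex.Gamma (β + (-(t₀ : ℂ) + (y : ℂ) * Complex.I)) *
              (((1 + |y|) ^ (-(d * (1 - θ))) : ℝ) : ℂ)‖ =
              ‖Complex.Gamma (α + (-(t₀ : ℂ) + (y : ℂ) * Complex.I)) * Complex.Gamma (β + (-(t₀ : ℂ) + (y : ℂ) * Complex.I))‖ *
                (1 + |y|) ^ (-(d * (1 - θ))) := by rw [norm_mul, hnw]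
          rw [hM, hn2]; ring
  -- continuity of the inner integrand (no pole on the line)
  have hcont : Continuous fun y : ℝ =>
      Complex.Gamma (α + (-(t₀ : ℂ) + (y : ℂ) * Complex.I)) * Complex.Gamma (β + (-(t₀ : ℂ) + (y : ℂ) * Complex.I)) *
          Complex.Gamma ((μ : ℂ) - (-(t₀ : ℂ) + (y : ℂ) * Complex.I)) /
          Complex.Gamma ((c : ℂ) + μ + (-(t₀ : ℂ) + (y : ℂ) * Complex.I)) *
        Complex.exp (ε * π * Complex.I * (-(t₀ : ℂ) + (y : ℂ) * Complex.I)) := by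
    have hΓ : ∀ (f : ℝ → ℂ), Continuous f → (∀ y, 0 < (f y).re) → Continuous fun y => Complex.Gamma (f y) := by
      intro f hf hpos
      refine continuous_iff_continuousAt.mpr fun y => (Complex.continuousAt_Gamma _ ?_).comp hf.continuousAt
      exact ne_neg_nat_of_re_pos (hpos y)
    refine (((((hΓ _ (by fun_prop) fun y => by simp; linarith).mul (hΓ _ (by fun_prop) fun y => by simp; linarith)).mul
      (hΓ _ (by fun_prop) fun y => by simp; linarith)).div (hΓ _ (by fun_prop) fun y => by simp; linarith) fun y => ?_).mul
      (by fun_prop))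
    exact Complex.Gamma_ne_zero_of_re_pos (by simp; linarith)
  have hint : Integrable (fun y : ℝ =>
      Complex.Gamma (α + (-(t₀ : ℂ) + (y : ℂ) * Complex.I)) * Complex.Gamma (β + (-(t₀ : ℂ) + (y : ℂ) * Complex.I)) *
          Complex.Gamma ((μ : ℂ) - (-(t₀ : ℂ) + (y : ℂ) * Complex.I)) /
          Complex.Gamma ((c : ℂ) + μ + (-(t₀ : ℂ) + (y : ℂ) * Complex.I)) *
        Complex.exp (ε * π * Complex.I * (-(t₀ : ℂ) + (y : ℂ) * Complex.I))) :=
    (hW.const_mul M).mono' hcont.aestronglyMeasurable (Eventually.of_forall hmaj)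
  refine ⟨hint, ?_⟩
  calc _ ≤ ∫ y : ℝ, M * (‖Complex.Gamma (α + (-(t₀ : ℂ) + (y : ℂ) * Complex.I)) *
            Complex.Gamma (β + (-(t₀ : ℂ) + (y : ℂ) * Complex.I)) * (((1 + |y|) ^ (-(d * (1 - θ))) : ℝ) : ℂ)‖ * Real.exp (π * |y|)) :=
        integral_mono_of_nonneg (Eventually.of_forall fun y => norm_nonneg _) (hW.const_mul M) (Eventually.of_forall hmaj)
    _ = M * I₀ := by rw [integral_const_mul]
    _ ≤ M * (I₀ + 1) := mul_le_mul_of_nonneg_left (by linarith) (by positivity)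
    _ = C₁ * (2 : ℝ) ^ (d * (1 - θ)) * (I₀ + 1) * (c - t₀ + μ) ^ (-(d * θ)) := by rw [hM]; ring
    _ = _ := by rw [hd]

end Literature.NumberTheory.Irrationality.Zudilin2004.VWPInnerBarnes

end Part15

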